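import Literature.Analysis.FluidPDE.SereginZajaczkowski2007L42Vorticity
import Literature.Analysis.FluidPDE.SereginZajaczkowski2007L42Meridian
import Literature.Analysis.FluidPDE.SwirlCutoff
import Literature.Analysis.FluidPDE.NSWeakProductRule
import HarnessLib

/-!
# Seregin–Zajaczkowski 2007, proof of Lemma 4.2: the energy inequality (4.13), proved

G. Seregin, W. Zajaczkowski, *A sufficient condition of regularity for axially symmetric
solutions to the Navier–Stokes equations*, SIAM J. Math. Anal. 39 (2007) 669–685 =
arXiv:math/0702720, §4, proof of Lemma 4.2 (arXiv pp. 5–6). The sibling file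
`SereginZajaczkowski2007L42Vorticity.lean` vendors the second step of that proof as the named fact
`LocalizedVorticityEnergyInequality`: for every cut-off `ψ` of the class `IsLemma42Cutoff` there
is a constant `C` such that, for the class `IsSmoothAxisymmetricSolutionOn Q̃ V P` of Prop. 4.1
together with the equation (4.5) for `χ = ω_φ` (`AngularVorticityEqOn Q̃ V`) and `𝒜₂ ≤ K`, the
localized weighted enstrophy `y(t) = ∫_𝒞̃ |χ̃/ϱ|² dx` (`vortEnergy`, `χ̃ = χψ`) is bounded on
`[-2², T]`, `T < 0`, and obeys (4.13) in integrated form,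
`y(t) ≤ ∫_{-2²}^{t} C (1 + K)² (1 + ∫_𝒞̃ |∇V(·, s)|² dx)(1 + y(s)) ds`.

This file PROVES that fact (`LocalizedVorticityEnergyInequality_holds`), following the printed
argument: "we multiply (4.8) by `χ̃ϱ⁻²` and integrate the product by parts over `𝒞̃`" — the energy
identity (4.9) — then the estimates (4.10)–(4.12) of the three right-hand sides `J₁, J₂, J₃` by
integration by parts in `x₃`, Hölder's inequality and Ladyzhenskaya's inequality in the variables
`(ϱ, x₃)`, and Young's inequality, giving (4.13). Together with the already proved
`AngularVorticityEquation_holds` (sibling file `…L42VorticityProofs.lean`) and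
`offAxisVorticityL2Bound_of`, the first half of the proof of Lemma 4.2 is thereby unconditional.

## The proof (Cartesian rendering)

Fix a time `s ∈ ]-2², 0[` and write `χ = ω_φ(s, ·)`, `ψ = ψ(s, ·)`, `η₁ = ψ/ϱ`,
`u = χ̃/ϱ = η₁χ` (`uFun`), `φ = η₁u = ψ²χ/ϱ²` (`phiFun`; this is the printed multiplier `χ̃ϱ⁻²`
times one more `ψ`, which turns the equation (4.5) for `χ` directly into the identity (4.9) for
`χ̃` without passing through (4.8)). All these are `C¹` with compact support in a fixed compact
`K₀ ⊂ 𝒞̃` (`CutoffData`: the compact set off which `ψ` vanishes, a bound `M` for `‖Dψ‖` on the slab,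
an auxiliary axially symmetric cut-off `η = 1` on `K₀` built from Mathlib's smooth transition,
`shellCutoff`, and a Ladyzhenskaya constant). The density `u²` has the time derivative
`∂ₛ(u²) = 2φ ∂ₛχ + 2u χ ∂ₛψ/ϱ` (`dFun`, `hasDerivAt_uFun_sq`), and by (4.5)
`φ ∂ₛχ = -φ Dχ·V + φ V_ϱχ/ϱ + φ Δχ - φ χ/ϱ² + φ (2/ϱ)V_φ∂₃V_φ`. Three integrations by parts
without boundary terms (Mathlib's `integral_mul_fderiv_eq_neg_fderiv_mul_of_integrable`, one factor
compactly supported inside the open shell, the other differentiable there only,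
`integral_mul_fderiv_apply_eq_neg_of_tsupport_subset`) give

* the dissipation (`integral_phiFun_mul_laplacian`): `∫ φΔχ = -∫ |∇u|² + ∫ χ²|∇η₁|²`, i.e. the
  left-hand side `∫ |∇_a(χ̃/ϱ)|²` of (4.9) and the part `-2(χ_{,ϱ}ψ_{,ϱ} + χ_{,3}ψ_{,3})` of `J₂`;
* the transport terms (`integral_phiFun_mul_fderiv_apply_velocity`, `transport_pointwise`):
  `-∫ φ Dχ·V + ∫ φV_ϱχ/ϱ = ∫ χ²ψ (Dψ·V)/ϱ²`, which is `∫ J₃ χ̃/ϱ²` (`div V = 0`, and the `V_ϱ`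
  terms cancel as in (4.8));
* the source (`integral_phiFun_mul_source`): `∫ φ(2/ϱ)V_φ∂₃V_φ = -∫ ∂₃(φ/ϱ) V_φ²`, the display
  before (4.10).

The zeroth-order term `-∫ φχ/ϱ²` is nonpositive, and the `∂ₛψ`-term is the `∂ₜψ` part of `J₂`.
The estimates: `|χ| ≤ |curl V| ≤ c|∇V|`, so every `∫_{K₀} χ²` is `≤ c ∫_𝒞̃ |∇V|²` ((4.11));
`∫ χ²ψ(Dψ·V)/ϱ² ≤ 2M(∫ (ηχ)² + ∫ u²(η|V|)²)` and `(η|V|)² = f₁² + f₂² + f₃²` with the three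
axially symmetric compactly supported components `f₁ = (η/ϱ)⟪V, x_h⟫ = ηV_ϱ`,
`f₂ = (η/ϱ)⟪V, Jx⟫ = ηV_φ`, `f₃ = ηV₃`; Young's inequality `u²fⱼ² ≤ ½(εu⁴ + ε⁻¹fⱼ⁴)` and
Ladyzhenskaya's inequality on the shell (accepted `exists_axisym_ladyzhenskaya_const`, applied
to `u` and to the `fⱼ`: `∫u⁴ ≤ C ∫u² ∫|∇u|²`, `∫fⱼ⁴ ≤ C Λ A(A + G)`, `A = ∫_𝒞̃|V|² ≤ 𝒜₂ ≤ K`,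
`G = ∫_𝒞̃|∇V|²`) give (4.12); the source term is bounded the same way through `f₂ = ηV_φ`
((4.10)). Choosing `ε = (12MC(1 + y) + 1)⁻¹` the dissipation absorbs the `∫|∇u|²` contributions
(`energy_arith`), and `∫ ∂ₛ(u²) dx ≤ c (1 + K)²(1 + G(s))(1 + y(s))` (`integral_dFun_le`, with an
explicit polynomial constant `lemma42EnergyConst` in `M`, `M_η`, `C` and `‖curlCLM‖`). Finally
`y(t) = ∫_{t₀}^{t} ∫ ∂ₛ(u²) dx ds` by the fundamental theorem of calculus in `s` for each `x` and
Fubini (`integral_uFun_sq_eq`; `ψ = 0` for `s ≤ t₀`), and the real bound passes to the `lintegral`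
form of the fact (a time with `G(s) = ∞` contributes `∞` to the kernel).

## Rendering choices

* Everything is Cartesian: `Dχ·V = fderiv χ x (V x)`, `Δ` is Mathlib's Laplacian
  (`Δχ = Σᵢ ∂ᵢ∂ᵢχ` at `C²` points, `laplacian_eq_sum_of_contDiffAt`), `V_ϱ = Dϱ·V`, `ϱV_φ = ⟪V, Jx⟫`.
* The bound is proved with the generous explicit constant `lemma42EnergyConst M M_η C ≥ 1`; the
  fact only asks for some `C : ℝ≥0`.
* Hypothesis structures (`IsShellLadyzhenskayaConst`, `CutoffData`) bundle the data of the energy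
  method; nothing is asserted by them (`exists_isShellLadyzhenskayaConst`,
  `IsLemma42Cutoff.exists_cutoffData`).

## Mathlib / tree search

Mathlib: `integral_mul_fderiv_eq_neg_fderiv_mul_of_integrable` (localized differentiability
hypotheses), `InnerProductSpace.laplacian_eq_iteratedFDerivWithin_orthonormalBasis`,
`intervalIntegral.integral_eq_sub_of_hasDerivAt_of_le`, `integral_integral_swap`,
`Real.smoothTransition`, `hasFDerivAt_inv`. Tree: `exists_axisym_ladyzhenskaya_const`
(`AxisymShellLadyzhenskaya`), `angularVorticity_rotZ_of_mem`, `contDiff_mul_of_tsupport_subset`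
(`…L42Meridian`), `IsSmoothAxisymmetricSolutionOn.setLIntegral_sq_le`, `.divergence_eq_zero`
(`…L42`), `hasFDerivAt_cylRadius` (`MeridianReduction`), `norm_curl_sq_le_frobeniusNormSq`
(`VorticityCalculus`), `integrable_prod_of_continuousOn` (`ClassicalSolutionCalculus`),
`rotGen`, `rotGenL`, `swirl_eq_inner_rotGen` (`SwirlTransportProofs`), `contDiffAt_cylRadius`
(`SwirlCutoff`), `fderiv_coord_apply` (`NSWeakProductRule`), `SereginSverak2009.rotZ_add_vec`.

## References

* G. Seregin, W. Zajaczkowski, SIAM J. Math. Anal. 39 (2007) 669–685, arXiv:math/0702720, §4: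
  proof of Lemma 4.2, (4.5)–(4.13) (arXiv pp. 5–6). [`SereginZajaczkowski2007`]
* O. A. Ladyzhenskaya, Comm. Pure Appl. Math. 12 (1959) 427–433 (the planar inequality, through
  the tree's `exists_axisym_ladyzhenskaya_const`).
-/

noncomputable section

open MeasureTheory Set Function Filter Topology TopologicalSpace Metric WithLp
open scoped NNReal ENNReal ContDiff InnerProductSpace RealInnerProductSpace Laplacian

namespace Literature.Analysis.FluidPDE

namespace SereginZajaczkowski2007

open SereginSverak2009

/-- Local notation for physical space `ℝ³ = EuclideanSpace ℝ (Fin 3)`. -/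
local notation "ℝ³" => EuclideanSpace ℝ (Fin 3)

/-- Local notation for the standard orthonormal basis of `ℝ³`. -/
local notation "𝐞" => EuclideanSpace.basisFun (Fin 3) ℝ

/-! ### Integration by parts against a factor supported inside an open set -/

/-- **Integration by parts without boundary terms, local form.** If `f ∈ C¹_c(ℝ³)` has
`tsupport f ⊆ W`, `W` open, and `g` is differentiable at the points of `W` with `g` and `∂ᵥ g`
continuous on `W`, then `∫ f ∂ᵥg = -∫ ∂ᵥf g` (Mathlib's
`integral_mul_fderiv_eq_neg_fderiv_mul_of_integrable`; the three products are continuous with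
compact support because `f` vanishes near every point outside `W`). [folklore] -/
theorem integral_mul_fderiv_apply_eq_neg_of_tsupport_subset {W : Set ℝ³} (hW : IsOpen W)
    {f g : ℝ³ → ℝ} (hf : ContDiff ℝ 1 f) (hfc : HasCompactSupport f) (hfW : tsupport f ⊆ W)
    (hgd : ∀ x ∈ W, DifferentiableAt ℝ g x) (hgc : ContinuousOn g W) (v : ℝ³)
    (hg'c : ContinuousOn (fun x => fderiv ℝ g x v) W) :
    ∫ x, f x * fderiv ℝ g x v = -∫ x, fderiv ℝ f x v * g x := by
  have hfc' : Continuous f := hf.continuous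
  have hf'c : Continuous fun x => fderiv ℝ f x v :=
    (hf.continuous_fderiv one_ne_zero).clm_apply continuous_const
  have hsub' : tsupport (fun x => fderiv ℝ f x v) ⊆ W :=
    (tsupport_fderiv_apply_subset ℝ v).trans hfW
  have i1 : Integrable (fun x => fderiv ℝ f x v * g x) :=
    (continuous_mul_of_tsupport_subset' hW hf'c hsub' hgc).integrable_of_hasCompactSupport
      ((hfc.fderiv_apply (𝕜 := ℝ) v).mul_right)
  have i2 : Integrable (fun x => f x * fderiv ℝ g x v) :=
    (continuous_mul_of_tsupport_subset' hW hfc' hfW hg'c).integrable_of_hasCompactSupport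
      hfc.mul_right
  have i3 : Integrable (fun x => f x * g x) :=
    (continuous_mul_of_tsupport_subset' hW hfc' hfW hgc).integrable_of_hasCompactSupport
      hfc.mul_right
  exact integral_mul_fderiv_eq_neg_fderiv_mul_of_integrable i1 i2 i3
    (fun x _ => hf.differentiable one_ne_zero x) (fun x hx => hgd x (hfW hx))

/-! ### The Laplacian and derivatives in coordinates -/

/-- **Local form of `Δ = Σᵢ ∂ᵢ∂ᵢ`**: at a point where `f` is `C²`,
`Δ f (x) = Σᵢ ∂ᵢ(∂ᵢ f)(x)` in the standard basis. [folklore] -/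
theorem laplacian_eq_sum_of_contDiffAt {f : ℝ³ → ℝ} {x : ℝ³} (hf : ContDiffAt ℝ 2 f x) :
    (Δ f) x = ∑ i, fderiv ℝ (fun y => fderiv ℝ f y (𝐞 i)) x (𝐞 i) := by
  rw [InnerProductSpace.laplacian_eq_iteratedFDeriv_orthonormalBasis f 𝐞]
  refine Finset.sum_congr rfl fun i _ => ?_
  have hd : DifferentiableAt ℝ (fderiv ℝ f) x :=
    (hf.fderiv_right (m := 1) le_rfl).differentiableAt one_ne_zero
  rw [iteratedFDeriv_two_apply, fderiv_clm_apply hd (differentiableAt_const _)]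
  simp

/-- Expansion of a derivative along a vector in the standard basis:
`Df(x) v = Σᵢ vᵢ Df(x) eᵢ`. [folklore] -/
theorem fderiv_apply_eq_sum (f : ℝ³ → ℝ) (x v : ℝ³) :
    fderiv ℝ f x v = ∑ i, v i * fderiv ℝ f x (𝐞 i) := by
  conv_lhs => rw [← (EuclideanSpace.basisFun (Fin 3) ℝ).sum_repr v]
  simp [map_sum, map_smul]

/-- The divergence in coordinates: `div v (x) = Σᵢ (Dv(x) eᵢ)ᵢ`. [folklore] -/
theorem divergence_eq_sum_apply (v : ℝ³ → ℝ³) (x : ℝ³) :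
    VectorCalculus.divergence v x = ∑ i, fderiv ℝ v x (𝐞 i) i := by
  rw [divergence_eq_sum_inner_fderiv 𝐞]
  refine Finset.sum_congr rfl fun i _ => ?_
  rw [EuclideanSpace.basisFun_apply, EuclideanSpace.inner_single_left]
  simp

/-- The squared Frobenius norm in the standard coordinates: `|L|² = Σᵢ ‖L eᵢ‖²`. [folklore] -/
theorem frobeniusNormSq_eq_sum_basisFun {F : Type*} [NormedAddCommGroup F]
    [InnerProductSpace ℝ F] [FiniteDimensional ℝ F] (L : ℝ³ →L[ℝ] F) :
    frobeniusNormSq L = ∑ i, ‖L (𝐞 i)‖ ^ 2 :=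
  frobeniusNormSq_eq_sum 𝐞 L

/-- For a real functional, `|L|² = Σᵢ (L eᵢ)²`. [folklore] -/
theorem frobeniusNormSq_eq_sum_sq (L : ℝ³ →L[ℝ] ℝ) :
    frobeniusNormSq L = ∑ i, L (𝐞 i) ^ 2 := by
  rw [frobeniusNormSq_eq_sum_basisFun]
  simp [Real.norm_eq_abs, sq_abs]

/-- The squared Frobenius norm of a real functional on `ℝ³` depends continuously on it.
[folklore] -/
theorem continuous_frobeniusNormSq_real : Continuous fun L : ℝ³ →L[ℝ] ℝ => frobeniusNormSq L := by
  have h : (fun L : ℝ³ →L[ℝ] ℝ => frobeniusNormSq L) = fun L => ∑ i, L (𝐞 i) ^ 2 :=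
    funext frobeniusNormSq_eq_sum_sq
  rw [h]
  exact continuous_finsetSum _ fun i _ =>
    ((ContinuousLinearMap.apply ℝ ℝ (𝐞 i)).continuous).pow 2

/-- The norm of a vector of `ℝ³` is controlled by its components: `‖v‖² = Σᵢ vᵢ²`. [folklore] -/
theorem norm_sq_eq_sum_sq (v : ℝ³) : ‖v‖ ^ 2 = ∑ i, v i ^ 2 := by
  rw [EuclideanSpace.norm_eq, Real.sq_sqrt (Finset.sum_nonneg fun i _ => sq_nonneg _)]
  simp [Real.norm_eq_abs, sq_abs]

/-! ### Room around a compact subset of the shell, and an adapted axisymmetric cut-off -/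

/-- **Room around a compact subset of `𝒞̃`**: a compact `K₀ ⊆ 𝒞(1/4, 3; 2)` keeps a distance
`δ ∈ ]0, 1]` from the boundary of the shell in the coordinates `ϱ` and `x₃`. [folklore] -/
theorem exists_room_of_isCompact_subset_shell {K₀ : Set ℝ³} (hK : IsCompact K₀)
    (hsub : K₀ ⊆ shell (1 / 4) 3 2) :
    ∃ δ : ℝ, 0 < δ ∧ δ ≤ 1 ∧
      ∀ x ∈ K₀, 1 / 4 + δ ≤ cylRadius x ∧ cylRadius x ≤ 3 - δ ∧ |x 2| ≤ 2 - δ := by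
  rcases K₀.eq_empty_or_nonempty with h0 | hne
  · exact ⟨1, one_pos, le_rfl, fun x hx => by simp [h0] at hx⟩
  set d : ℝ³ → ℝ := fun x => min (min (cylRadius x - 1 / 4) (3 - cylRadius x)) (2 - |x 2|) with hd
  have hdc : Continuous d := by
    have h2 : Continuous fun x : ℝ³ => |x 2| := (EuclideanSpace.proj (2 : Fin 3)).continuous.abs
    exact ((continuous_cylRadius.sub continuous_const).min
      (continuous_const.sub continuous_cylRadius)).min (continuous_const.sub h2)
  obtain ⟨x₀, hx₀, hmin⟩ := hK.exists_isMinOn hne hdc.continuousOn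
  have hpos : 0 < d x₀ := by
    have h := hsub hx₀
    rw [mem_shell] at h
    simp only [hd, lt_min_iff]
    exact ⟨⟨by linarith [h.1.1], by linarith [h.1.2]⟩, by linarith [h.2]⟩
  refine ⟨min (d x₀) 1, lt_min hpos one_pos, min_le_right _ _, fun x hx => ?_⟩
  have hle : d x₀ ≤ d x := hmin hx
  have h1 : min (d x₀) 1 ≤ d x := (min_le_left _ _).trans hle
  simp only [hd, le_min_iff] at h1
  exact ⟨by linarith [h1.1.1], by linarith [h1.1.2], by linarith [h1.2]⟩

/-- **An axisymmetric cut-off adapted to the room `δ`**: with Mathlib's smooth transition `S`,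
`η_δ(x) = S((ϱ² - a₁)/(b₁ - a₁)) · S((a₂ - ϱ²)/(a₂ - b₂)) · S((a₃ - x₃²)/(a₃ - b₃))`,
`a₁ = (1/4 + δ/2)²`, `b₁ = (1/4 + δ)²`, `b₂ = (3 - δ)²`, `a₂ = (3 - δ/2)²`, `b₃ = (2 - δ)²`,
`a₃ = (2 - δ/2)²`: smooth, axially symmetric, with values in `[0, 1]`, equal to `1` on
`{1/4 + δ ≤ ϱ ≤ 3 - δ, |x₃| ≤ 2 - δ}` and vanishing outside `{a₁ ≤ ϱ² ≤ a₂, x₃² ≤ a₃} ⊂ 𝒞̃`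
(for `0 < δ ≤ 1`). [folklore] -/
def shellCutoff (δ : ℝ) (x : ℝ³) : ℝ :=
  Real.smoothTransition ((cylRadius x ^ 2 - (1 / 4 + δ / 2) ^ 2) /
      ((1 / 4 + δ) ^ 2 - (1 / 4 + δ / 2) ^ 2)) *
    Real.smoothTransition (((3 - δ / 2) ^ 2 - cylRadius x ^ 2) / ((3 - δ / 2) ^ 2 - (3 - δ) ^ 2)) *
    Real.smoothTransition (((2 - δ / 2) ^ 2 - x 2 ^ 2) / ((2 - δ / 2) ^ 2 - (2 - δ) ^ 2))

/-- The closed set `{a₁ ≤ ϱ² ≤ a₂, x₃² ≤ a₃}` off which `shellCutoff δ` vanishes. [folklore] -/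
def shellCutoffSupport (δ : ℝ) : Set ℝ³ :=
  {x | (1 / 4 + δ / 2) ^ 2 ≤ cylRadius x ^ 2 ∧ cylRadius x ^ 2 ≤ (3 - δ / 2) ^ 2 ∧
    x 2 ^ 2 ≤ (2 - δ / 2) ^ 2}

/-- `shellCutoff δ` is smooth. [folklore] -/
theorem contDiff_shellCutoff (δ : ℝ) {n : ℕ∞} : ContDiff ℝ n (shellCutoff δ) := by
  have h2 : ContDiff ℝ n fun x : ℝ³ => x 2 := contDiff_euclidean.mp contDiff_id 2
  have hρ : ContDiff ℝ n fun x : ℝ³ => cylRadius x ^ 2 := by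
    have h0 : ContDiff ℝ n fun x : ℝ³ => x 0 := contDiff_euclidean.mp contDiff_id 0
    have h1 : ContDiff ℝ n fun x : ℝ³ => x 1 := contDiff_euclidean.mp contDiff_id 1
    have heq : (fun x : ℝ³ => cylRadius x ^ 2) = fun x => x 0 ^ 2 + x 1 ^ 2 :=
      funext fun x => cylRadius_sq x
    rw [heq]
    exact (h0.pow 2).add (h1.pow 2)
  have hS : ContDiff ℝ n Real.smoothTransition := Real.smoothTransition.contDiff
  unfold shellCutoff
  exact ((hS.comp ((hρ.sub contDiff_const).div_const _)).mul
    (hS.comp ((contDiff_const.sub hρ).div_const _))).mul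
    (hS.comp ((contDiff_const.sub (h2.pow 2)).div_const _))

/-- `0 ≤ shellCutoff δ`. [folklore] -/
theorem shellCutoff_nonneg (δ : ℝ) (x : ℝ³) : 0 ≤ shellCutoff δ x := by
  unfold shellCutoff
  have h0 := Real.smoothTransition.nonneg
  exact mul_nonneg (mul_nonneg (h0 _) (h0 _)) (h0 _)

/-- `shellCutoff δ ≤ 1`. [folklore] -/
theorem shellCutoff_le_one (δ : ℝ) (x : ℝ³) : shellCutoff δ x ≤ 1 := by
  unfold shellCutoff
  have h0 := Real.smoothTransition.nonneg
  have h1 := Real.smoothTransition.le_one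
  exact mul_le_one₀ (mul_le_one₀ (h1 _) (h0 _) (h1 _)) (h0 _) (h1 _)

/-- `shellCutoff δ` is an axially symmetric scalar. [folklore] -/
theorem isAxisymmetricScalar_shellCutoff (δ : ℝ) : IsAxisymmetricScalar (shellCutoff δ) := by
  intro θ x
  simp only [shellCutoff, cylRadius_rotZ, rotZ_apply_two]

/-- `shellCutoff δ = 1` on `{1/4 + δ ≤ ϱ ≤ 3 - δ, |x₃| ≤ 2 - δ}` (`0 < δ ≤ 1`). [folklore] -/
theorem shellCutoff_eq_one {δ : ℝ} (hδ : 0 < δ) (hδ1 : δ ≤ 1) {x : ℝ³}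
    (h1 : 1 / 4 + δ ≤ cylRadius x) (h2 : cylRadius x ≤ 3 - δ) (h3 : |x 2| ≤ 2 - δ) :
    shellCutoff δ x = 1 := by
  have hρ := cylRadius_nonneg x
  have hsq1 : (1 / 4 + δ) ^ 2 ≤ cylRadius x ^ 2 := pow_le_pow_left₀ (by linarith) h1 2
  have hsq2 : cylRadius x ^ 2 ≤ (3 - δ) ^ 2 := pow_le_pow_left₀ hρ h2 2
  have hsq3 : x 2 ^ 2 ≤ (2 - δ) ^ 2 := by
    rw [← sq_abs]
    exact pow_le_pow_left₀ (abs_nonneg _) h3 2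
  unfold shellCutoff
  rw [Real.smoothTransition.one_of_one_le, Real.smoothTransition.one_of_one_le,
    Real.smoothTransition.one_of_one_le]
  · norm_num
  · rw [le_div_iff₀ (by nlinarith)]
    nlinarith
  · rw [le_div_iff₀ (by nlinarith)]
    nlinarith
  · rw [le_div_iff₀ (by nlinarith)]
    nlinarith

/-- `shellCutoff δ` vanishes off `shellCutoffSupport δ` (`0 < δ ≤ 1`). [folklore] -/
theorem shellCutoff_eq_zero {δ : ℝ} (hδ : 0 < δ) (hδ1 : δ ≤ 1) {x : ℝ³}
    (hx : x ∉ shellCutoffSupport δ) : shellCutoff δ x = 0 := by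
  simp only [shellCutoffSupport, mem_setOf_eq, not_and_or, not_le] at hx
  unfold shellCutoff
  rcases hx with h1 | h2 | h3
  · rw [Real.smoothTransition.zero_of_nonpos
        (x := (cylRadius x ^ 2 - (1 / 4 + δ / 2) ^ 2) / ((1 / 4 + δ) ^ 2 - (1 / 4 + δ / 2) ^ 2))
        (div_nonpos_of_nonpos_of_nonneg (by linarith) (by nlinarith))]
    ring
  · rw [Real.smoothTransition.zero_of_nonpos
        (x := ((3 - δ / 2) ^ 2 - cylRadius x ^ 2) / ((3 - δ / 2) ^ 2 - (3 - δ) ^ 2))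
        (div_nonpos_of_nonpos_of_nonneg (by linarith) (by nlinarith))]
    ring
  · rw [Real.smoothTransition.zero_of_nonpos
        (x := ((2 - δ / 2) ^ 2 - x 2 ^ 2) / ((2 - δ / 2) ^ 2 - (2 - δ) ^ 2))
        (div_nonpos_of_nonpos_of_nonneg (by linarith) (by nlinarith))]
    ring

/-- `shellCutoffSupport δ` is closed. [folklore] -/
theorem isClosed_shellCutoffSupport (δ : ℝ) : IsClosed (shellCutoffSupport δ) := by
  have hρ2 : Continuous fun x : ℝ³ => cylRadius x ^ 2 := continuous_cylRadius.pow 2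
  have hx2 : Continuous fun x : ℝ³ => x 2 ^ 2 := (EuclideanSpace.proj (2 : Fin 3)).continuous.pow 2
  exact (isClosed_le continuous_const hρ2).inter
    ((isClosed_le hρ2 continuous_const).inter (isClosed_le hx2 continuous_const))

/-- `shellCutoffSupport δ` is compact (`0 < δ ≤ 1`: it lies in the ball of radius `4`).
[folklore] -/
theorem isCompact_shellCutoffSupport {δ : ℝ} (hδ : 0 < δ) (hδ1 : δ ≤ 1) :
    IsCompact (shellCutoffSupport δ) := by
  refine (isCompact_closedBall (0 : ℝ³) 4).of_isClosed_subset (isClosed_shellCutoffSupport δ)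
    fun x hx => ?_
  obtain ⟨-, h2, h3⟩ := hx
  rw [mem_closedBall, dist_zero_right, EuclideanSpace.norm_eq]
  have hsum : ∑ i, ‖x i‖ ^ 2 = cylRadius x ^ 2 + x 2 ^ 2 := by
    simp only [Fin.sum_univ_three, Real.norm_eq_abs, sq_abs, cylRadius_sq]
  rw [hsum]
  calc Real.sqrt (cylRadius x ^ 2 + x 2 ^ 2) ≤ Real.sqrt (4 ^ 2) :=
        Real.sqrt_le_sqrt (by nlinarith)
    _ = 4 := Real.sqrt_sq (by norm_num)

/-- `shellCutoffSupport δ ⊆ 𝒞̃` (`0 < δ ≤ 1`). [folklore] -/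
theorem shellCutoffSupport_subset_shell {δ : ℝ} (hδ : 0 < δ) (hδ1 : δ ≤ 1) :
    shellCutoffSupport δ ⊆ shell (1 / 4) 3 2 := by
  intro x hx
  obtain ⟨h1, h2, h3⟩ := hx
  have hρ := cylRadius_nonneg x
  rw [mem_shell]
  refine ⟨⟨?_, ?_⟩, ?_⟩
  · nlinarith
  · nlinarith
  · exact abs_lt_of_sq_lt_sq (by nlinarith) (by norm_num)

/-- The topological support of `shellCutoff δ` lies in `shellCutoffSupport δ` (`0 < δ ≤ 1`).
[folklore] -/
theorem tsupport_shellCutoff_subset {δ : ℝ} (hδ : 0 < δ) (hδ1 : δ ≤ 1) :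
    tsupport (shellCutoff δ) ⊆ shellCutoffSupport δ := by
  refine closure_minimal (fun x hx => ?_) (isClosed_shellCutoffSupport δ)
  by_contra h
  exact hx (shellCutoff_eq_zero hδ hδ1 h)

/-- `shellCutoff δ` has compact support (`0 < δ ≤ 1`). [folklore] -/
theorem hasCompactSupport_shellCutoff {δ : ℝ} (hδ : 0 < δ) (hδ1 : δ ≤ 1) :
    HasCompactSupport (shellCutoff δ) :=
  (isCompact_shellCutoffSupport hδ hδ1).of_isClosed_subset (isClosed_tsupport _)
    (tsupport_shellCutoff_subset hδ hδ1)

/-- **An axisymmetric cut-off equal to `1` on a given compact subset of `𝒞̃`.** For a compact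
`K₀ ⊆ 𝒞(1/4, 3; 2)` there is a smooth axially symmetric `η : ℝ³ → [0, 1]` with compact support,
`tsupport η ⊆ 𝒞̃`, `η = 1` on `K₀`, and bounded gradient `‖Dη‖ ≤ M`. [folklore] -/
theorem exists_cutoff_eq_one_of_isCompact_subset_shell {K₀ : Set ℝ³} (hK : IsCompact K₀)
    (hsub : K₀ ⊆ shell (1 / 4) 3 2) :
    ∃ η : ℝ³ → ℝ, ContDiff ℝ ∞ η ∧ HasCompactSupport η ∧ tsupport η ⊆ shell (1 / 4) 3 2 ∧
      (∀ x, 0 ≤ η x) ∧ (∀ x, η x ≤ 1) ∧ IsAxisymmetricScalar η ∧ (∀ x ∈ K₀, η x = 1) ∧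
      ∃ M : ℝ, 0 ≤ M ∧ ∀ x, ‖fderiv ℝ η x‖ ≤ M := by
  obtain ⟨δ, hδ, hδ1, hroom⟩ := exists_room_of_isCompact_subset_shell hK hsub
  have hc : HasCompactSupport (shellCutoff δ) := hasCompactSupport_shellCutoff hδ hδ1
  have hd : ContDiff ℝ ∞ (shellCutoff δ) := contDiff_shellCutoff δ
  obtain ⟨M, hM⟩ := ((hd.continuous_fderiv (by simp)).norm).bounded_above_of_compact_support
    (hc.fderiv ℝ).norm
  refine ⟨shellCutoff δ, hd, hc,
    (tsupport_shellCutoff_subset hδ hδ1).trans (shellCutoffSupport_subset_shell hδ hδ1),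
    shellCutoff_nonneg δ, shellCutoff_le_one δ, isAxisymmetricScalar_shellCutoff δ,
    fun x hx => ?_, max M 0, le_max_right _ _, fun x => ?_⟩
  · obtain ⟨h1, h2, h3⟩ := hroom x hx
    exact shellCutoff_eq_one hδ hδ1 h1 h2 h3
  · have h := hM x
    rw [Real.norm_eq_abs, abs_of_nonneg (norm_nonneg _)] at h
    exact h.trans (le_max_left _ _)

/-! ### Slices of a jointly smooth space–time function -/

section Slices

variable {Ψ : ℝ → ℝ³ → ℝ}

/-- The slice `Ψ(t, ·)` of a jointly differentiable function is differentiable, with derivative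
`D_xΨ(t, x) = DΨ(t, x) ∘ inr`. [folklore] -/
theorem hasFDerivAt_space_slice (hΨ : Differentiable ℝ (uncurry Ψ)) (t : ℝ) (x : ℝ³) :
    HasFDerivAt (Ψ t) ((fderiv ℝ (uncurry Ψ) (t, x)).comp (ContinuousLinearMap.inr ℝ ℝ ℝ³)) x :=
  (hΨ (t, x)).hasFDerivAt.comp x (hasFDerivAt_prodMk_right t x)

/-- Applied form: `D_xΨ(t, x) v = DΨ(t, x) (0, v)`. [folklore] -/
theorem fderiv_slice_apply (hΨ : Differentiable ℝ (uncurry Ψ)) (t : ℝ) (x v : ℝ³) :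
    fderiv ℝ (Ψ t) x v = fderiv ℝ (uncurry Ψ) (t, x) (0, v) := by
  rw [(hasFDerivAt_space_slice hΨ t x).fderiv]
  rfl

/-- The time derivative of `Ψ(·, x)`: `∂ₜΨ(t, x) = DΨ(t, x) (1, 0)`. [folklore] -/
theorem hasDerivAt_time_slice (hΨ : Differentiable ℝ (uncurry Ψ)) (t : ℝ) (x : ℝ³) :
    HasDerivAt (fun s => Ψ s x) (fderiv ℝ (uncurry Ψ) (t, x) (1, 0)) t := by
  have h : HasFDerivAt (uncurry Ψ ∘ fun s : ℝ => ((s, x) : ℝ × ℝ³))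
      ((fderiv ℝ (uncurry Ψ) (t, x)).comp (ContinuousLinearMap.inl ℝ ℝ ℝ³)) t :=
    (hΨ (t, x)).hasFDerivAt.comp t (hasFDerivAt_prodMk_left t x)
  have h' : HasDerivAt (fun s => Ψ s x)
      (((fderiv ℝ (uncurry Ψ) (t, x)).comp (ContinuousLinearMap.inl ℝ ℝ ℝ³)) (1 : ℝ)) t :=
    h.hasDerivAt
  rwa [ContinuousLinearMap.comp_apply, ContinuousLinearMap.inl_apply] at h'

/-- `deriv` form of the time derivative of a slice. [folklore] -/
theorem deriv_time_slice (hΨ : Differentiable ℝ (uncurry Ψ)) (t : ℝ) (x : ℝ³) :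
    deriv (fun s => Ψ s x) t = fderiv ℝ (uncurry Ψ) (t, x) (1, 0) :=
  (hasDerivAt_time_slice hΨ t x).deriv

/-- The spatial derivative of a slice is bounded by the full derivative:
`‖D_xΨ(t, x)‖ ≤ ‖DΨ(t, x)‖`. [folklore] -/
theorem norm_fderiv_slice_le (hΨ : Differentiable ℝ (uncurry Ψ)) (t : ℝ) (x : ℝ³) :
    ‖fderiv ℝ (Ψ t) x‖ ≤ ‖fderiv ℝ (uncurry Ψ) (t, x)‖ := by
  refine ContinuousLinearMap.opNorm_le_bound _ (norm_nonneg _) fun v => ?_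
  rw [fderiv_slice_apply hΨ]
  refine ((fderiv ℝ (uncurry Ψ) (t, x)).le_opNorm _).trans ?_
  gcongr
  simp [Prod.norm_def]

/-- The time derivative of a slice is bounded by the full derivative:
`|∂ₜΨ(t, x)| ≤ ‖DΨ(t, x)‖`. [folklore] -/
theorem abs_deriv_time_slice_le (hΨ : Differentiable ℝ (uncurry Ψ)) (t : ℝ) (x : ℝ³) :
    |deriv (fun s => Ψ s x) t| ≤ ‖fderiv ℝ (uncurry Ψ) (t, x)‖ := by
  rw [deriv_time_slice hΨ, ← Real.norm_eq_abs]
  refine ((fderiv ℝ (uncurry Ψ) (t, x)).le_opNorm _).trans ?_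
  have : ‖((1 : ℝ), (0 : ℝ³))‖ = 1 := by simp [Prod.norm_def]
  rw [this, mul_one]

/-- Joint continuity of the time derivative of the slices. [folklore] -/
theorem continuous_deriv_time_slice (hΨ : ContDiff ℝ 1 (uncurry Ψ)) :
    Continuous fun z : ℝ × ℝ³ => deriv (fun s => Ψ s z.2) z.1 := by
  have hd : Differentiable ℝ (uncurry Ψ) := hΨ.differentiable one_ne_zero
  have heq : (fun z : ℝ × ℝ³ => deriv (fun s => Ψ s z.2) z.1) =
      fun z => fderiv ℝ (uncurry Ψ) z (1, 0) := by
    funext z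
    exact deriv_time_slice hd z.1 z.2
  rw [heq]
  exact (hΨ.continuous_fderiv one_ne_zero).clm_apply continuous_const

/-- Slices of a jointly `Cⁿ` function are `Cⁿ`. [folklore] -/
theorem contDiff_slice {n : WithTop ℕ∞} (hΨ : ContDiff ℝ n (uncurry Ψ)) (t : ℝ) :
    ContDiff ℝ n (Ψ t) :=
  hΨ.comp (contDiff_prodMk_right t)

variable {K₀ : Set ℝ³}

/-- If `Ψ(t, x) = 0` whenever `x ∉ K₀`, `K₀` closed, then `tsupport Ψ(t, ·) ⊆ K₀`. [folklore] -/
theorem tsupport_slice_subset (hK : IsClosed K₀) (hzero : ∀ t x, x ∉ K₀ → Ψ t x = 0) (t : ℝ) :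
    tsupport (Ψ t) ⊆ K₀ :=
  closure_minimal (fun x hx => by_contra fun h => hx (hzero t x h)) hK

/-- If `Ψ(t, x) = 0` whenever `x ∉ K₀`, `K₀` closed, then the full derivative vanishes at
such points: `DΨ(t, x) = 0` for `x ∉ K₀`. [folklore] -/
theorem fderiv_uncurry_eq_zero_of_notMem (hK : IsClosed K₀) (hzero : ∀ t x, x ∉ K₀ → Ψ t x = 0)
    {t : ℝ} {x : ℝ³} (hx : x ∉ K₀) : fderiv ℝ (uncurry Ψ) (t, x) = 0 := by
  refine fderiv_of_notMem_tsupport ℝ (notMem_tsupport_iff_eventuallyEq.2 ?_)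
  have hU : (univ : Set ℝ) ×ˢ K₀ᶜ ∈ 𝓝 ((t, x) : ℝ × ℝ³) :=
    (isOpen_univ.prod hK.isOpen_compl).mem_nhds ⟨mem_univ _, hx⟩
  filter_upwards [hU] with z hz
  exact hzero z.1 z.2 hz.2

/-- **A uniform bound for the derivative of a cut-off on a time slab.** If `Ψ` is `C¹` jointly
and `Ψ(t, x) = 0` for `x` off a compact `K₀`, then `‖DΨ(t, x)‖ ≤ M` for all `t ∈ [a, b]` and
ALL `x` (on `[a, b] × K₀` by compactness, and `DΨ = 0` elsewhere). [folklore] -/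
theorem exists_norm_fderiv_uncurry_le (hΨ : ContDiff ℝ 1 (uncurry Ψ)) (hK : IsCompact K₀)
    (hzero : ∀ t x, x ∉ K₀ → Ψ t x = 0) (a b : ℝ) :
    ∃ M : ℝ, 0 ≤ M ∧ ∀ t ∈ Icc a b, ∀ x, ‖fderiv ℝ (uncurry Ψ) (t, x)‖ ≤ M := by
  obtain ⟨M, hM⟩ := (isCompact_Icc.prod hK).exists_bound_of_continuousOn
    (s := Icc a b ×ˢ K₀) (hΨ.continuous_fderiv one_ne_zero).continuousOn
  refine ⟨max M 0, le_max_right _ _, fun t ht x => ?_⟩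
  by_cases hx : x ∈ K₀
  · exact (hM (t, x) ⟨ht, hx⟩).trans (le_max_left _ _)
  · rw [fderiv_uncurry_eq_zero_of_notMem hK.isClosed hzero hx, norm_zero]
    exact le_max_right _ _

end Slices

/-! ### Time slices of the smooth class on `Q̃` -/

/-- Local notation: the shell `𝒞̃ = 𝒞(1/4, 3; 2)`. -/
local notation "𝒞" => shell (1 / 4) 3 2

/-- Local notation: the cylinder `Q̃ = 𝒞̃ × ]-2², 0[` as an open set. -/
local notation "Q" => shellCylOpens (1 / 4) 3 2 2

/-- Points of `]-2², 0[ × 𝒞̃` are points of `Q̃`. [folklore] -/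
theorem mk_mem_Q {s : ℝ} (hs : s ∈ Ioo (-(2 : ℝ) ^ 2) 0) {x : ℝ³} (hx : x ∈ 𝒞) :
    ((s, x) : ℝ × ℝ³) ∈ (Q : Set (ℝ × ℝ³)) :=
  ⟨hs, hx⟩

/-- On the shell the cylindrical radius is at least `1/4`. [folklore] -/
theorem cylRadius_gt_of_mem_shell {x : ℝ³} (hx : x ∈ 𝒞) : 1 / 4 < cylRadius x :=
  ((mem_shell.1 hx).1).1

/-- On the shell the cylindrical radius is less than `3`. [folklore] -/
theorem cylRadius_lt_of_mem_shell {x : ℝ³} (hx : x ∈ 𝒞) : cylRadius x < 3 :=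
  ((mem_shell.1 hx).1).2

/-- On the shell the cylindrical radius is positive. [folklore] -/
theorem cylRadius_pos_of_mem_shell {x : ℝ³} (hx : x ∈ 𝒞) : 0 < cylRadius x :=
  lt_trans (by norm_num) (cylRadius_gt_of_mem_shell hx)

/-- The shell is invariant under the rotations about the axis. [folklore] -/
theorem rotZ_mem_shell {θ : ℝ} {x : ℝ³} (hx : x ∈ 𝒞) : rotZ θ x ∈ 𝒞 :=
  (rotZ_mem_shell_iff θ).2 hx

/-- A function continuous on `Q̃` in space–time has continuous slices on `𝒞̃`. [folklore] -/
theorem continuousOn_slice_of_continuousOn {F : Type*} [TopologicalSpace F] {f : ℝ × ℝ³ → F}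
    (hf : ContinuousOn f (Q : Set (ℝ × ℝ³))) {s : ℝ} (hs : s ∈ Ioo (-(2 : ℝ) ^ 2) 0) :
    ContinuousOn (fun x => f (s, x)) 𝒞 := fun _ hx =>
  (hf.continuousAt ((isOpen_shellCyl _ _ _ _).mem_nhds (mk_mem_Q hs hx))).comp_continuousWithinAt
    ((continuous_const.prodMk continuous_id).continuousWithinAt)

namespace IsSmoothAxisymmetricSolutionOn

variable {V : ℝ → ℝ³ → ℝ³} {P : ℝ → ℝ³ → ℝ} (hV : IsSmoothAxisymmetricSolutionOn Q V P)
include hV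

/-- Slices are smooth at the points of the shell. [folklore] -/
theorem contDiffAt_slice {s : ℝ} (hs : s ∈ Ioo (-(2 : ℝ) ^ 2) 0) {x : ℝ³} (hx : x ∈ 𝒞)
    {n : ℕ∞} : ContDiffAt ℝ n (V s) x :=
  (hV.contDiffAt (s, x) (mk_mem_Q hs hx)).of_le (by exact_mod_cast le_top)

/-- Slices are differentiable at the points of the shell. [folklore] -/
theorem differentiableAt_slice {s : ℝ} (hs : s ∈ Ioo (-(2 : ℝ) ^ 2) 0) {x : ℝ³} (hx : x ∈ 𝒞) :
    DifferentiableAt ℝ (V s) x :=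
  hV.differentiableAt (mk_mem_Q hs hx)

/-- Slices are continuous on the shell. [folklore] -/
theorem continuousOn_slice {s : ℝ} (hs : s ∈ Ioo (-(2 : ℝ) ^ 2) 0) : ContinuousOn (V s) 𝒞 :=
  continuousOn_slice_of_continuousOn hV.continuousOn_velocity hs

/-- The gradient of a slice is continuous on the shell. [folklore] -/
theorem continuousOn_fderiv_slice' {s : ℝ} (hs : s ∈ Ioo (-(2 : ℝ) ^ 2) 0) :
    ContinuousOn (fun x => fderiv ℝ (V s) x) 𝒞 :=
  continuousOn_slice_of_continuousOn hV.continuousOn_fderiv hs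

/-- Slices are divergence free on the shell. [folklore] -/
theorem divergence_slice {s : ℝ} (hs : s ∈ Ioo (-(2 : ℝ) ^ 2) 0) {x : ℝ³} (hx : x ∈ 𝒞) :
    VectorCalculus.divergence (V s) x = 0 :=
  hV.divergence_eq_zero (mk_mem_Q hs hx)

/-- Slices are axially symmetric at the points of the shell. [folklore] -/
theorem rotZ_slice {s : ℝ} (hs : s ∈ Ioo (-(2 : ℝ) ^ 2) 0) (θ : ℝ) {x : ℝ³} (hx : x ∈ 𝒞) :
    V s (rotZ θ x) = rotZ θ (V s x) :=
  hV.axisymmetric θ (s, x) (mk_mem_Q hs hx)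

/-- The angular vorticity of a slice is an axially symmetric scalar on the shell. [folklore] -/
theorem angularVorticity_rotZ_slice {s : ℝ} (hs : s ∈ Ioo (-(2 : ℝ) ^ 2) 0) (θ : ℝ) {x : ℝ³}
    (hx : x ∈ 𝒞) : angularVorticity (V s) (rotZ θ x) = angularVorticity (V s) x :=
  angularVorticity_rotZ_of_mem (isOpen_shell _ _ _) (fun _ _ hy => rotZ_mem_shell hy)
    (fun θ' _ hy => hV.rotZ_slice hs θ' hy) (fun _ hy => hV.differentiableAt_slice hs hy) θ hx

/-- **Every slice has energy at most `𝒜₂`**, real form: `x ↦ ‖V(s, x)‖²` is integrable on `𝒞̃`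
with `∫_𝒞̃ ‖V(s, ·)‖² ≤ K` whenever `𝒜₂ ≤ K`. [folklore] -/
theorem integrableOn_norm_sq_slice {s : ℝ} (hs : s ∈ Ioo (-(2 : ℝ) ^ 2) 0) {K : ℝ≥0}
    (hK : szEnergy V P (fun t x => fderiv ℝ (V t) x) ≤ K) :
    IntegrableOn (fun x => ‖V s x‖ ^ 2) 𝒞 ∧ ∫ x in 𝒞, ‖V s x‖ ^ 2 ≤ K := by
  have hlin : ∫⁻ x in 𝒞, ‖V s x‖ₑ ^ 2 ≤ K := hV.setLIntegral_sq_le hK s hs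
  have hm : AEStronglyMeasurable (fun x => ‖V s x‖ ^ 2) (volume.restrict 𝒞) :=
    ((hV.continuousOn_slice hs).norm.pow 2).aestronglyMeasurable (isOpen_shell _ _ _).measurableSet
  have heq : ∀ x, ENNReal.ofReal (‖V s x‖ ^ 2) = ‖V s x‖ₑ ^ 2 := fun x => by
    rw [ENNReal.ofReal_pow (norm_nonneg _), ofReal_norm]
  have hfin : HasFiniteIntegral (fun x => ‖V s x‖ ^ 2) (volume.restrict 𝒞) := by
    rw [hasFiniteIntegral_iff_ofReal (Eventually.of_forall fun x => sq_nonneg _)]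
    simp_rw [heq]
    exact lt_of_le_of_lt hlin ENNReal.coe_lt_top
  refine ⟨⟨hm, hfin⟩, ?_⟩
  rw [integral_eq_lintegral_of_nonneg_ae (Eventually.of_forall fun x => sq_nonneg _) hm]
  simp_rw [heq]
  have h := ENNReal.toReal_mono ENNReal.coe_ne_top hlin
  rwa [ENNReal.coe_toReal] at h

/-- **The gradient energy of a slice**, real form: if `∫_𝒞̃ |∇V(s, ·)|² < ∞` then
`x ↦ |∇V(s, x)|²` is integrable on `𝒞̃` with integral `(shellGradEnergy V s).toReal`. [folklore] -/
theorem integrableOn_frobeniusNormSq_slice {s : ℝ} (hs : s ∈ Ioo (-(2 : ℝ) ^ 2) 0)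
    (hG : shellGradEnergy V s ≠ ⊤) :
    IntegrableOn (fun x => frobeniusNormSq (fderiv ℝ (V s) x)) 𝒞 ∧
      ∫ x in 𝒞, frobeniusNormSq (fderiv ℝ (V s) x) = (shellGradEnergy V s).toReal := by
  have hm : AEStronglyMeasurable (fun x => frobeniusNormSq (fderiv ℝ (V s) x))
      (volume.restrict 𝒞) :=
    (continuous_frobeniusNormSq.comp_continuousOn (hV.continuousOn_fderiv_slice' hs))
      |>.aestronglyMeasurable (isOpen_shell _ _ _).measurableSet
  have h0 : ∀ x, 0 ≤ frobeniusNormSq (fderiv ℝ (V s) x) := fun x => frobeniusNormSq_nonneg _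
  have hfin : HasFiniteIntegral (fun x => frobeniusNormSq (fderiv ℝ (V s) x))
      (volume.restrict 𝒞) := by
    rw [hasFiniteIntegral_iff_ofReal (Eventually.of_forall h0)]
    exact lt_top_iff_ne_top.2 hG
  refine ⟨⟨hm, hfin⟩, ?_⟩
  rw [integral_eq_lintegral_of_nonneg_ae (Eventually.of_forall h0) hm]
  rfl

end IsSmoothAxisymmetricSolutionOn

namespace AngularVorticityEqOn

variable {V : ℝ → ℝ³ → ℝ³} (hχ : AngularVorticityEqOn Q V)
include hχ

/-- The angular vorticity of a slice is `C²` at the points of the shell. [folklore] -/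
theorem contDiffAt_slice {s : ℝ} (hs : s ∈ Ioo (-(2 : ℝ) ^ 2) 0) {x : ℝ³} (hx : x ∈ 𝒞) :
    ContDiffAt ℝ 2 (fun y => angularVorticity (V s) y) x :=
  hχ.contDiffAt (s, x) (mk_mem_Q hs hx)

/-- The angular vorticity of a slice is differentiable at the points of the shell. [folklore] -/
theorem differentiableAt_slice {s : ℝ} (hs : s ∈ Ioo (-(2 : ℝ) ^ 2) 0) {x : ℝ³} (hx : x ∈ 𝒞) :
    DifferentiableAt ℝ (fun y => angularVorticity (V s) y) x :=
  (hχ.contDiffAt_slice hs hx).differentiableAt (by simp)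

/-- The angular vorticity of a slice is continuous on the shell. [folklore] -/
theorem continuousOn_slice {s : ℝ} (hs : s ∈ Ioo (-(2 : ℝ) ^ 2) 0) :
    ContinuousOn (fun y => angularVorticity (V s) y) 𝒞 :=
  continuousOn_slice_of_continuousOn hχ.continuousOn hs

/-- The gradient of the angular vorticity of a slice is continuous on the shell. [folklore] -/
theorem continuousOn_fderiv_slice {s : ℝ} (hs : s ∈ Ioo (-(2 : ℝ) ^ 2) 0) :
    ContinuousOn (fun y => fderiv ℝ (fun y => angularVorticity (V s) y) y) 𝒞 :=
  continuousOn_slice_of_continuousOn hχ.continuousOn_fderiv hs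

/-- The partial derivatives of the angular vorticity of a slice are differentiable at the points
of the shell. [folklore] -/
theorem differentiableAt_fderiv_apply_slice {s : ℝ} (hs : s ∈ Ioo (-(2 : ℝ) ^ 2) 0) {x : ℝ³}
    (hx : x ∈ 𝒞) (v : ℝ³) :
    DifferentiableAt ℝ (fun y => fderiv ℝ (fun y => angularVorticity (V s) y) y v) x :=
  (((hχ.contDiffAt_slice hs hx).fderiv_right (m := 1) le_rfl).differentiableAt
    one_ne_zero).clm_apply (differentiableAt_const v)

/-- The second partial derivatives `∂ᵥ∂ᵥ ω_φ` of a slice are continuous on the shell. [folklore] -/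
theorem continuousOn_fderiv_fderiv_apply_slice {s : ℝ} (hs : s ∈ Ioo (-(2 : ℝ) ^ 2) 0) (v : ℝ³) :
    ContinuousOn (fun x => fderiv ℝ (fun y => fderiv ℝ (fun y => angularVorticity (V s) y) y v) x v)
      𝒞 := by
  intro x hx
  have h1 : ContDiffAt ℝ 1 (fun y => fderiv ℝ (fun y => angularVorticity (V s) y) y v) x :=
    ((hχ.contDiffAt_slice hs hx).fderiv_right (m := 1) le_rfl).clm_apply contDiffAt_const
  have h0 : ContDiffAt ℝ 0
      (fderiv ℝ (fun y => fderiv ℝ (fun y => angularVorticity (V s) y) y v)) x :=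
    h1.fderiv_right (m := 0) le_rfl
  exact (h0.continuousAt.clm_apply continuousAt_const).continuousWithinAt

/-- **The equation (4.5) on a slice**, solved for the time derivative: at `x ∈ 𝒞̃`,
`∂ₜχ = -Dχ·V + V_ϱ χ/ϱ + Δχ - χ/ϱ² + (2/ϱ) V_φ ∂₃V_φ`. [folklore] -/
theorem timeDeriv_eq {s : ℝ} (hs : s ∈ Ioo (-(2 : ℝ) ^ 2) 0) {x : ℝ³} (hx : x ∈ 𝒞) :
    timeDeriv (fun t y => angularVorticity (V t) y) s x =
      -fderiv ℝ (fun y => angularVorticity (V s) y) x (V s x) +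
        radialVelocity (V s) x * angularVorticity (V s) x / cylRadius x +
        (Δ fun y => angularVorticity (V s) y) x -
        angularVorticity (V s) x / cylRadius x ^ 2 +
        2 / cylRadius x * swirlVelocity (V s) x *
          fderiv ℝ (fun y => swirlVelocity (V s) y) x eZ := by
  have h := hχ.eq (s, x) (mk_mem_Q hs hx)
  dsimp only at h
  linarith

end AngularVorticityEqOn

/-! ### Small calculus helpers -/

/-- The derivative of a square: `D(f²)(x) h = 2 f(x) Df(x) h`. [folklore] -/
theorem fderiv_sq_apply {f : ℝ³ → ℝ} {x : ℝ³} (hf : DifferentiableAt ℝ f x) (h : ℝ³) :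
    fderiv ℝ (fun y => f y ^ 2) x h = 2 * f x * fderiv ℝ f x h := by
  rw [show (fun y => f y ^ 2) = fun y => f y * f y from funext fun y => sq _,
    fderiv_mul_apply_of_differentiableAt hf hf]
  ring

/-- A function `Cⁿ` at every point of the shell is continuous there. [folklore] -/
theorem continuousOn_shell_of_contDiffAt {F : Type*} [NormedAddCommGroup F] [NormedSpace ℝ F]
    {f : ℝ³ → F} {n : WithTop ℕ∞} (h : ∀ x ∈ 𝒞, ContDiffAt ℝ n f x) : ContinuousOn f 𝒞 :=
  fun x hx => (h x hx).continuousAt.continuousWithinAt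

/-- A function `C¹` at every point of the shell has continuous partial derivatives there.
[folklore] -/
theorem continuousOn_fderiv_apply_shell_of_contDiffAt {f : ℝ³ → ℝ}
    (h : ∀ x ∈ 𝒞, ContDiffAt ℝ 1 f x) (v : ℝ³) : ContinuousOn (fun x => fderiv ℝ f x v) 𝒞 := by
  intro x hx
  have h0 : ContDiffAt ℝ 0 (fderiv ℝ f) x := (h x hx).fderiv_right (m := 0) le_rfl
  exact (h0.continuousAt.clm_apply continuousAt_const).continuousWithinAt

/-! ### Integrals of functions supported in the shell -/

/-- **Comparison with a shell integral**: if `h` is integrable, vanishes off `𝒞̃`, and `h ≤ g`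
on `𝒞̃` with `g` integrable there, then `∫ h ≤ ∫_𝒞̃ g`. [folklore] -/
theorem integral_le_setIntegral_shell {h g : ℝ³ → ℝ} (hh : Integrable h)
    (hzero : ∀ x ∉ 𝒞, h x = 0) (hg : IntegrableOn g 𝒞) (hle : ∀ x ∈ 𝒞, h x ≤ g x) :
    ∫ x, h x ≤ ∫ x in 𝒞, g x := by
  rw [← setIntegral_eq_integral_of_forall_compl_eq_zero (s := 𝒞) fun x hx => hzero x hx]
  exact setIntegral_mono_on hh.integrableOn hg (isOpen_shell _ _ _).measurableSet hle

/-! ### Cylindrical algebra -/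

/-- `‖J x‖ = ϱ` (the tree's `norm_rotGen_eq_cylRadius` of `PeriodicCylinderWithinCalculus`,
restated to keep the imports light). [folklore] -/
theorem norm_rotGen_eq (x : ℝ³) : ‖rotGen x‖ = cylRadius x := by
  rw [EuclideanSpace.norm_eq, cylRadius]
  congr 1
  simp only [Fin.sum_univ_three, rotGen_apply_zero, rotGen_apply_one, rotGen_apply_two,
    Real.norm_eq_abs, sq_abs]
  ring

/-- `‖J‖ ≤ 1` as an operator. [folklore] -/
theorem norm_rotGenL_le : ‖rotGenL‖ ≤ 1 :=
  ContinuousLinearMap.opNorm_le_bound _ zero_le_one fun x => by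
    rw [rotGenL_apply, norm_rotGen_eq, one_mul]
    exact cylRadius_le_norm' x

/-- `‖J (J x)‖ = ϱ`: `J (J x) = -(x₀, x₁, 0)`. [folklore] -/
theorem norm_rotGen_rotGen_eq (x : ℝ³) : ‖rotGen (rotGen x)‖ = cylRadius x := by
  rw [norm_rotGen_eq, cylRadius, cylRadius]
  congr 1
  simp only [rotGen_apply_zero, rotGen_apply_one]
  ring

/-- The generator commutes with the rotations: `J (R_θ x) = R_θ (J x)`. [folklore] -/
theorem rotGen_rotZ' (θ : ℝ) (x : ℝ³) : rotGen (rotZ θ x) = rotZ θ (rotGen x) := by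
  ext i
  fin_cases i <;> simp [rotGen, rotZ] <;> ring

/-- The axis is fixed by the rotations: `R_θ e_z = e_z` (also in the barrier catalogue's
`NavierStokesInequalityPressureSymmetry`, restated to keep the imports topical). [folklore] -/
theorem rotZ_eZ (θ : ℝ) : rotZ θ eZ = eZ := by
  ext i
  fin_cases i <;> simp [rotZ, eZ]

/-- **The speed in cylindrical components**: for `ϱ = |x'|`,
`ϱ² ‖w‖² = ⟪w, J(J x)⟫² + ⟪w, J x⟫² + ϱ² w₃²` (`-J(Jx) = (x₀, x₁, 0)`, so the first two terms
are `ϱ² (w_ϱ² + w_φ²)`). [folklore] -/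
theorem cylRadius_sq_mul_norm_sq (x w : ℝ³) :
    cylRadius x ^ 2 * ‖w‖ ^ 2 =
      ⟪w, rotGen (rotGen x)⟫ ^ 2 + ⟪w, rotGen x⟫ ^ 2 + cylRadius x ^ 2 * w 2 ^ 2 := by
  rw [cylRadius_sq, norm_sq_eq_sum_sq, real_inner_comm, inner_rotGen_left, real_inner_comm,
    inner_rotGen_left]
  simp only [Fin.sum_univ_three, rotGen_apply_zero, rotGen_apply_one]
  ring

/-- `w₃ = ⟪w, e_z⟫`. [folklore] -/
theorem inner_eZ_right (w : ℝ³) : ⟪w, eZ⟫ = w 2 := by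
  rw [eZ, EuclideanSpace.inner_single_right]
  simp

/-- Off the axis `e_r` is a unit vector. [folklore] -/
theorem norm_eR_eq_one {x : ℝ³} (hx : cylRadius x ≠ 0) : ‖eR x‖ = 1 := by
  have h := inner_eR_self hx
  rw [real_inner_self_eq_norm_sq] at h
  nlinarith [norm_nonneg (eR x)]

/-- `ϱ⁻¹` is smooth off the axis. [folklore] -/
theorem contDiffAt_inv_cylRadius {x : ℝ³} (hx : cylRadius x ≠ 0) {n : WithTop ℕ∞} :
    ContDiffAt ℝ n (fun y => (cylRadius y)⁻¹) x :=
  (contDiffAt_cylRadius hx).inv hx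

/-- The derivative of `ϱ⁻¹` off the axis: `D(ϱ⁻¹)(x) = -ϱ⁻² ⟪e_r, ·⟫`. [folklore] -/
theorem hasFDerivAt_inv_cylRadius_comp {x : ℝ³} (hx : cylRadius x ≠ 0) :
    HasFDerivAt (fun y => (cylRadius y)⁻¹)
      ((ContinuousLinearMap.toSpanSingleton ℝ (-(cylRadius x ^ 2)⁻¹)).comp (innerSL ℝ (eR x))) x :=
  (hasFDerivAt_inv hx).comp x (hasFDerivAt_cylRadius hx)

/-- `‖D(ϱ⁻¹)(x)‖ ≤ ϱ⁻²` off the axis. [folklore] -/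
theorem norm_fderiv_inv_cylRadius_le {x : ℝ³} (hx : cylRadius x ≠ 0) :
    ‖fderiv ℝ (fun y => (cylRadius y)⁻¹) x‖ ≤ (cylRadius x ^ 2)⁻¹ := by
  rw [(hasFDerivAt_inv_cylRadius_comp hx).fderiv]
  refine ContinuousLinearMap.opNorm_le_bound _ (by positivity) fun v => ?_
  rw [ContinuousLinearMap.comp_apply, ContinuousLinearMap.toSpanSingleton_apply, innerSL_apply_apply,
    smul_eq_mul]
  have h1 : |⟪eR x, v⟫| ≤ ‖v‖ :=
    (abs_real_inner_le_norm _ _).trans (by rw [norm_eR_eq_one hx, one_mul])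
  have hρ2 : 0 < cylRadius x ^ 2 := by positivity
  rw [Real.norm_eq_abs, abs_mul, abs_neg, abs_inv, abs_of_pos hρ2]
  calc |⟪eR x, v⟫| * (cylRadius x ^ 2)⁻¹ ≤ ‖v‖ * (cylRadius x ^ 2)⁻¹ := by gcongr
    _ = (cylRadius x ^ 2)⁻¹ * ‖v‖ := mul_comm _ _

/-! ### The angular frame vector and the swirl velocity off the axis -/

/-- `e_φ = ϱ⁻¹ J` as functions. [folklore] -/
theorem eTheta_eq_inv_cylRadius_smul_rotGen : eTheta = fun x : ℝ³ => (cylRadius x)⁻¹ • rotGen x :=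
  rfl

/-- `e_φ` is smooth off the axis. [folklore] -/
theorem contDiffAt_eTheta {x : ℝ³} (hx : cylRadius x ≠ 0) {n : WithTop ℕ∞} :
    ContDiffAt ℝ n eTheta x := by
  rw [eTheta_eq_inv_cylRadius_smul_rotGen]
  exact (contDiffAt_inv_cylRadius hx).smul (rotGenL.contDiff.contDiffAt : ContDiffAt ℝ n rotGenL x)

/-- The swirl velocity `V_φ = ⟪V, e_φ⟫` is `Cⁿ` at an off-axis point where `V` is. [folklore] -/
theorem contDiffAt_swirlVelocity {v : ℝ³ → ℝ³} {x : ℝ³} {n : WithTop ℕ∞}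
    (hv : ContDiffAt ℝ n v x) (hx : cylRadius x ≠ 0) :
    ContDiffAt ℝ n (fun y => swirlVelocity v y) x :=
  hv.inner ℝ (contDiffAt_eTheta hx)

/-- Off the axis, `ϱ V_φ = ⟪V, J x⟫`. [folklore] -/
theorem cylRadius_mul_swirlVelocity {v : ℝ³ → ℝ³} {x : ℝ³} (hx : cylRadius x ≠ 0) :
    cylRadius x * swirlVelocity v x = ⟪v x, rotGen x⟫ := by
  rw [swirlVelocity, rotGen_eq_cylRadius_smul_eTheta hx, inner_smul_right]

/-! ### Products with a cut-off supported in the shell -/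

section CutoffProducts

/-- **Norm of the derivative of a product**: `‖D(fg)(x)‖ ≤ ‖Df(x)‖ |g x| + |f x| ‖Dg(x)‖`.
[folklore] -/
theorem norm_fderiv_mul_le {f g : ℝ³ → ℝ} {x : ℝ³} (hf : DifferentiableAt ℝ f x)
    (hg : DifferentiableAt ℝ g x) :
    ‖fderiv ℝ (fun y => f y * g y) x‖ ≤ ‖fderiv ℝ f x‖ * |g x| + |f x| * ‖fderiv ℝ g x‖ := by
  rw [fderiv_fun_mul hf hg]
  refine (norm_add_le _ _).trans ?_
  rw [norm_smul, norm_smul, Real.norm_eq_abs, Real.norm_eq_abs]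
  linarith [mul_comm ‖fderiv ℝ f x‖ |g x|]

/-- Off the topological support of the cut-off, the derivative of a cut-off product vanishes
(as a linear map). [folklore] -/
theorem fderiv_cutoff_mul_of_notMem {θ F : ℝ³ → ℝ} {x : ℝ³} (hx : x ∉ tsupport θ) :
    fderiv ℝ (fun y => θ y * F y) x = 0 := by
  ext h
  rw [fderiv_mul_apply_of_notMem_tsupport hx]
  rfl

/-- Off the topological support of the cut-off, a cut-off product vanishes. [folklore] -/
theorem cutoff_mul_of_notMem {θ F : ℝ³ → ℝ} {x : ℝ³} (hx : x ∉ tsupport θ) : θ x * F x = 0 := by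
  rw [image_eq_zero_of_notMem_tsupport hx, zero_mul]

/-- A cut-off product has compact support if the cut-off does. [folklore] -/
theorem hasCompactSupport_cutoff_mul {θ F : ℝ³ → ℝ} (hθ : HasCompactSupport θ) :
    HasCompactSupport fun y => θ y * F y :=
  hθ.mul_right

/-- The topological support of a cut-off product lies in that of the cut-off. [folklore] -/
theorem tsupport_cutoff_mul_subset (θ F : ℝ³ → ℝ) :
    tsupport (fun y => θ y * F y) ⊆ tsupport θ :=
  closure_mono (support_mul_subset_left θ F)

/-! #### The pairings `⟪v, L x + c⟫` -/

/-- The pairing `x ↦ ⟪v x, L x + c⟫` is `Cⁿ` where `v` is. [folklore] -/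
theorem contDiffAt_inner_clm {v : ℝ³ → ℝ³} {x : ℝ³} {n : WithTop ℕ∞} (hv : ContDiffAt ℝ n v x)
    (L : ℝ³ →L[ℝ] ℝ³) (c : ℝ³) : ContDiffAt ℝ n (fun y => ⟪v y, L y + c⟫) x :=
  hv.inner ℝ (L.contDiff.contDiffAt.add contDiffAt_const)

/-- The derivative of the pairing: `D⟪v, L· + c⟫(x) h = ⟪v x, L h⟫ + ⟪Dv(x) h, L x + c⟫`.
[folklore] -/
theorem fderiv_inner_clm_apply {v : ℝ³ → ℝ³} {x : ℝ³} (hv : DifferentiableAt ℝ v x)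
    (L : ℝ³ →L[ℝ] ℝ³) (c : ℝ³) (h : ℝ³) :
    fderiv ℝ (fun y => ⟪v y, L y + c⟫) x h = ⟪v x, L h⟫ + ⟪fderiv ℝ v x h, L x + c⟫ := by
  have hL : DifferentiableAt ℝ (fun y => L y + c) x := L.differentiableAt.add_const c
  rw [fderiv_inner_apply ℝ hv hL, fderiv_add_const, ContinuousLinearMap.fderiv]

/-- Norm bound for the derivative of the pairing:
`‖D⟪v, L· + c⟫(x)‖ ≤ ‖v x‖ ‖L‖ + ‖Dv(x)‖ ‖L x + c‖`. [folklore] -/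
theorem norm_fderiv_inner_clm_le {v : ℝ³ → ℝ³} {x : ℝ³} (hv : DifferentiableAt ℝ v x)
    (L : ℝ³ →L[ℝ] ℝ³) (c : ℝ³) :
    ‖fderiv ℝ (fun y => ⟪v y, L y + c⟫) x‖ ≤ ‖v x‖ * ‖L‖ + ‖fderiv ℝ v x‖ * ‖L x + c‖ := by
  refine ContinuousLinearMap.opNorm_le_bound _ (by positivity) fun h => ?_
  rw [fderiv_inner_clm_apply hv, Real.norm_eq_abs]
  calc |⟪v x, L h⟫ + ⟪fderiv ℝ v x h, L x + c⟫|
      ≤ |⟪v x, L h⟫| + |⟪fderiv ℝ v x h, L x + c⟫| := abs_add_le _ _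
    _ ≤ ‖v x‖ * ‖L h‖ + ‖fderiv ℝ v x h‖ * ‖L x + c‖ :=
        add_le_add (abs_real_inner_le_norm _ _) (abs_real_inner_le_norm _ _)
    _ ≤ ‖v x‖ * (‖L‖ * ‖h‖) + ‖fderiv ℝ v x‖ * ‖h‖ * ‖L x + c‖ := by
        gcongr
        · exact L.le_opNorm h
        · exact (fderiv ℝ v x).le_opNorm h
    _ = (‖v x‖ * ‖L‖ + ‖fderiv ℝ v x‖ * ‖L x + c‖) * ‖h‖ := by ring

/-- The pairing is bounded by `‖v x‖ ‖L x + c‖`. [folklore] -/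
theorem abs_inner_clm_le (v : ℝ³ → ℝ³) (L : ℝ³ →L[ℝ] ℝ³) (c x : ℝ³) :
    |⟪v x, L x + c⟫| ≤ ‖v x‖ * ‖L x + c‖ :=
  abs_real_inner_le_norm _ _

/-! #### The component functions `θ ⟪v, L x + c⟫` -/

variable {θ : ℝ³ → ℝ} {v : ℝ³ → ℝ³} {L : ℝ³ →L[ℝ] ℝ³} {c : ℝ³}

/-- A component function `θ ⟪v, L· + c⟫` with `tsupport θ ⊆ 𝒞̃` and `v` of class `C¹` at the
points of `𝒞̃` is `C¹`. [folklore] -/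
theorem contDiff_compFun (hθ : ContDiff ℝ 1 θ) (hθW : tsupport θ ⊆ 𝒞)
    (hv : ∀ x ∈ 𝒞, ContDiffAt ℝ 1 v x) (L : ℝ³ →L[ℝ] ℝ³) (c : ℝ³) :
    ContDiff ℝ 1 fun x => θ x * ⟪v x, L x + c⟫ :=
  contDiff_mul_of_tsupport_subset hθ hθW fun x hx => contDiffAt_inner_clm (hv x hx) L c

/-- Pointwise bound for a component function on the shell. [folklore] -/
theorem abs_compFun_le {B₀ l : ℝ} (hB₀ : ∀ x, |θ x| ≤ B₀) (hl : ∀ x ∈ 𝒞, ‖L x + c‖ ≤ l)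
    {x : ℝ³} (hx : x ∈ 𝒞) : |θ x * ⟪v x, L x + c⟫| ≤ B₀ * l * ‖v x‖ := by
  have hB : 0 ≤ B₀ := (abs_nonneg _).trans (hB₀ x)
  rw [abs_mul]
  calc |θ x| * |⟪v x, L x + c⟫| ≤ B₀ * (‖v x‖ * ‖L x + c‖) :=
        mul_le_mul (hB₀ x) (abs_inner_clm_le v L c x) (abs_nonneg _) hB
    _ ≤ B₀ * (‖v x‖ * l) := by gcongr; exact hl x hx
    _ = B₀ * l * ‖v x‖ := by ring

/-- **Derivative bound for a component function** at a point of the shell: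
`‖D(θ⟪v, L· + c⟫)(x)‖ ≤ (B₁ l + B₀ ‖L‖) ‖v x‖ + B₀ l ‖Dv(x)‖`. [folklore] -/
theorem norm_fderiv_compFun_le {B₀ B₁ l : ℝ} (hθ : ContDiff ℝ 1 θ) (hB₀ : ∀ x, |θ x| ≤ B₀)
    (hB₁ : ∀ x, ‖fderiv ℝ θ x‖ ≤ B₁) (hl : ∀ x ∈ 𝒞, ‖L x + c‖ ≤ l) {x : ℝ³} (hx : x ∈ 𝒞)
    (hv : DifferentiableAt ℝ v x) :
    ‖fderiv ℝ (fun y => θ y * ⟪v y, L y + c⟫) x‖ ≤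
      (B₁ * l + B₀ * ‖L‖) * ‖v x‖ + B₀ * l * ‖fderiv ℝ v x‖ := by
  have hB : 0 ≤ B₀ := (abs_nonneg _).trans (hB₀ x)
  have hB' : 0 ≤ B₁ := (norm_nonneg _).trans (hB₁ x)
  have hl0 : 0 ≤ l := (norm_nonneg _).trans (hl x hx)
  have hF : DifferentiableAt ℝ (fun y => ⟪v y, L y + c⟫) x :=
    hv.inner ℝ (L.differentiableAt.add_const c)
  calc ‖fderiv ℝ (fun y => θ y * ⟪v y, L y + c⟫) x‖
      ≤ ‖fderiv ℝ θ x‖ * |⟪v x, L x + c⟫| + |θ x| * ‖fderiv ℝ (fun y => ⟪v y, L y + c⟫) x‖ :=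
        norm_fderiv_mul_le (hθ.differentiable one_ne_zero x) hF
    _ ≤ B₁ * (‖v x‖ * l) + B₀ * (‖v x‖ * ‖L‖ + ‖fderiv ℝ v x‖ * l) := by
        refine add_le_add (mul_le_mul (hB₁ x) ?_ (abs_nonneg _) hB')
          (mul_le_mul (hB₀ x) ?_ (norm_nonneg _) hB)
        · exact (abs_inner_clm_le v L c x).trans (by gcongr; exact hl x hx)
        · exact (norm_fderiv_inner_clm_le hv L c).trans (by gcongr; exact hl x hx)
    _ = (B₁ * l + B₀ * ‖L‖) * ‖v x‖ + B₀ * l * ‖fderiv ℝ v x‖ := by ring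

/-- **Axial symmetry of a component function**: if `θ` is an axially symmetric scalar with
`tsupport θ ⊆ 𝒞̃`, `v` is axially symmetric at the points of `𝒞̃`, `L` commutes with the
rotations about the axis and `c` is fixed by them, then `θ ⟪v, L· + c⟫` is an axially
symmetric scalar. [folklore] -/
theorem isAxisymmetricScalar_compFun (hθa : IsAxisymmetricScalar θ) (hθW : tsupport θ ⊆ 𝒞)
    (hva : ∀ θ' : ℝ, ∀ x ∈ 𝒞, v (rotZ θ' x) = rotZ θ' (v x))
    (hL : ∀ θ' : ℝ, ∀ y : ℝ³, L (rotZ θ' y) = rotZ θ' (L y)) (hc : ∀ θ' : ℝ, rotZ θ' c = c) :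
    IsAxisymmetricScalar fun x => θ x * ⟪v x, L x + c⟫ := by
  intro θ' x
  dsimp only
  by_cases hx : x ∈ 𝒞
  · rw [hθa θ' x, hva θ' x hx, hL θ' x]
    conv_lhs => rw [← hc θ', ← rotZ_add_vec, inner_rotZ_rotZ]
  · have h1 : x ∉ tsupport θ := fun h => hx (hθW h)
    have h2 : rotZ θ' x ∉ tsupport θ := fun h => hx ((rotZ_mem_shell_iff θ').1 (hθW h))
    rw [image_eq_zero_of_notMem_tsupport h1, image_eq_zero_of_notMem_tsupport h2, zero_mul,
      zero_mul]

/-- A component function vanishes off the shell, hence is supported in `{1/4 ≤ ϱ ≤ 3}`.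
[folklore] -/
theorem compFun_support (hθW : tsupport θ ⊆ 𝒞) (x : ℝ³) (hx : θ x * ⟪v x, L x + c⟫ ≠ 0) :
    1 / 4 ≤ cylRadius x ∧ cylRadius x ≤ 3 := by
  have hx' : x ∈ 𝒞 := by
    by_contra h
    exact hx (cutoff_mul_of_notMem (F := fun y => ⟪v y, L y + c⟫) fun h' => h (hθW h'))
  exact ⟨(cylRadius_gt_of_mem_shell hx').le, (cylRadius_lt_of_mem_shell hx').le⟩

/-- **`L²` bound of a component function**: `∫ (θ⟪v, L·+c⟫)² ≤ (B₀ l)² ∫_𝒞̃ ‖v‖²`. [folklore] -/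
theorem integral_compFun_sq_le {B₀ l : ℝ} (hθ : ContDiff ℝ 1 θ) (hθc : HasCompactSupport θ)
    (hθW : tsupport θ ⊆ 𝒞) (hv : ∀ x ∈ 𝒞, ContDiffAt ℝ 1 v x) (hB₀ : ∀ x, |θ x| ≤ B₀)
    (hl : ∀ x ∈ 𝒞, ‖L x + c‖ ≤ l) (hvi : IntegrableOn (fun x => ‖v x‖ ^ 2) 𝒞) :
    ∫ x, (θ x * ⟪v x, L x + c⟫) ^ 2 ≤ (B₀ * l) ^ 2 * ∫ x in 𝒞, ‖v x‖ ^ 2 := by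
  have hf := contDiff_compFun hθ hθW hv L c
  have hfc : HasCompactSupport fun x => θ x * ⟪v x, L x + c⟫ := hasCompactSupport_cutoff_mul hθc
  have hfc2 : HasCompactSupport fun x => (θ x * ⟪v x, L x + c⟫) ^ 2 :=
    hfc.comp_left (g := fun t : ℝ => t ^ 2) (zero_pow two_ne_zero)
  have hi : Integrable fun x => (θ x * ⟪v x, L x + c⟫) ^ 2 :=
    (hf.continuous.pow 2).integrable_of_hasCompactSupport hfc2
  rw [← integral_const_mul]
  refine integral_le_setIntegral_shell hi (fun x hx => ?_) (hvi.const_mul _) fun x hx => ?_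
  · rw [cutoff_mul_of_notMem (F := fun y => ⟪v y, L y + c⟫) fun h => hx (hθW h),
      zero_pow two_ne_zero]
  · have h := abs_compFun_le (v := v) hB₀ hl hx
    have h0 : 0 ≤ B₀ * l * ‖v x‖ := (abs_nonneg _).trans h
    calc (θ x * ⟪v x, L x + c⟫) ^ 2 = |θ x * ⟪v x, L x + c⟫| ^ 2 := (sq_abs _).symm
      _ ≤ (B₀ * l * ‖v x‖) ^ 2 := pow_le_pow_left₀ (abs_nonneg _) h 2
      _ = (B₀ * l) ^ 2 * ‖v x‖ ^ 2 := by ring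

/-- **`L²` bound of the gradient of a component function**:
`∫ ‖D(θ⟪v, L·+c⟫)‖² ≤ 2 (B₁ l + B₀ ‖L‖)² ∫_𝒞̃ ‖v‖² + 2 (B₀ l)² ∫_𝒞̃ |∇v|²`. [folklore] -/
theorem integral_norm_fderiv_compFun_sq_le {B₀ B₁ l : ℝ} (hθ : ContDiff ℝ 1 θ)
    (hθc : HasCompactSupport θ) (hθW : tsupport θ ⊆ 𝒞) (hv : ∀ x ∈ 𝒞, ContDiffAt ℝ 1 v x)
    (hB₀ : ∀ x, |θ x| ≤ B₀) (hB₁ : ∀ x, ‖fderiv ℝ θ x‖ ≤ B₁) (hl : ∀ x ∈ 𝒞, ‖L x + c‖ ≤ l)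
    (hvi : IntegrableOn (fun x => ‖v x‖ ^ 2) 𝒞)
    (hDvi : IntegrableOn (fun x => frobeniusNormSq (fderiv ℝ v x)) 𝒞) :
    ∫ x, ‖fderiv ℝ (fun y => θ y * ⟪v y, L y + c⟫) x‖ ^ 2 ≤
      2 * (B₁ * l + B₀ * ‖L‖) ^ 2 * (∫ x in 𝒞, ‖v x‖ ^ 2) +
        2 * (B₀ * l) ^ 2 * ∫ x in 𝒞, frobeniusNormSq (fderiv ℝ v x) := by
  have hf := contDiff_compFun hθ hθW hv L c
  have hfc : HasCompactSupport fun x => θ x * ⟪v x, L x + c⟫ := hasCompactSupport_cutoff_mul hθc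
  have hfc2 : HasCompactSupport fun x => ‖fderiv ℝ (fun y => θ y * ⟪v y, L y + c⟫) x‖ ^ 2 :=
    (hfc.fderiv ℝ).norm.comp_left (g := fun t : ℝ => t ^ 2) (zero_pow two_ne_zero)
  have hi : Integrable fun x => ‖fderiv ℝ (fun y => θ y * ⟪v y, L y + c⟫) x‖ ^ 2 :=
    ((hf.continuous_fderiv one_ne_zero).norm.pow 2).integrable_of_hasCompactSupport hfc2
  set a : ℝ := B₁ * l + B₀ * ‖L‖ with ha
  set b : ℝ := B₀ * l with hb
  have hgi : IntegrableOn (fun x => 2 * a ^ 2 * ‖v x‖ ^ 2 +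
      2 * b ^ 2 * frobeniusNormSq (fderiv ℝ v x)) 𝒞 :=
    (hvi.const_mul _).add (hDvi.const_mul _)
  calc ∫ x, ‖fderiv ℝ (fun y => θ y * ⟪v y, L y + c⟫) x‖ ^ 2
      ≤ ∫ x in 𝒞, (2 * a ^ 2 * ‖v x‖ ^ 2 + 2 * b ^ 2 * frobeniusNormSq (fderiv ℝ v x)) := by
        refine integral_le_setIntegral_shell hi (fun x hx => ?_) hgi fun x hx => ?_
        · rw [fderiv_cutoff_mul_of_notMem fun h => hx (hθW h), norm_zero, zero_pow two_ne_zero]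
        · have hvd : DifferentiableAt ℝ v x := (hv x hx).differentiableAt one_ne_zero
          have h := norm_fderiv_compFun_le hθ hB₀ hB₁ hl hx hvd
          rw [← ha, ← hb] at h
          have hF : ‖fderiv ℝ v x‖ ^ 2 ≤ frobeniusNormSq (fderiv ℝ v x) :=
            sq_opNorm_le_frobeniusNormSq _
          have h0 : 0 ≤ a * ‖v x‖ + b * ‖fderiv ℝ v x‖ := (norm_nonneg _).trans h
          calc ‖fderiv ℝ (fun y => θ y * ⟪v y, L y + c⟫) x‖ ^ 2
              ≤ (a * ‖v x‖ + b * ‖fderiv ℝ v x‖) ^ 2 := pow_le_pow_left₀ (norm_nonneg _) h 2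
            _ ≤ 2 * a ^ 2 * ‖v x‖ ^ 2 + 2 * b ^ 2 * ‖fderiv ℝ v x‖ ^ 2 := by
                nlinarith [sq_nonneg (a * ‖v x‖ - b * ‖fderiv ℝ v x‖)]
            _ ≤ 2 * a ^ 2 * ‖v x‖ ^ 2 + 2 * b ^ 2 * frobeniusNormSq (fderiv ℝ v x) := by
                gcongr
    _ = 2 * a ^ 2 * (∫ x in 𝒞, ‖v x‖ ^ 2) + 2 * b ^ 2 * ∫ x in 𝒞, frobeniusNormSq (fderiv ℝ v x) := by
        rw [integral_add (hvi.const_mul _) (hDvi.const_mul _), integral_const_mul,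
          integral_const_mul]

end CutoffProducts

/-! ### Ladyzhenskaya's inequality for the component functions -/

section Ladyzhenskaya

/-- The specification of a Ladyzhenskaya constant `C` for the shell `{1/4 ≤ ϱ ≤ 3}` (the
conclusion of the accepted `exists_axisym_ladyzhenskaya_const` with `ϱ₀ = 1/4`, `ϱ₁ = 3`):
`C ≥ 0` and `∫ f⁴ ≤ C ∫ f² ∫ ‖Df‖²` for every `C¹` compactly supported axially symmetric scalar
`f` vanishing outside `{1/4 ≤ ϱ ≤ 3}`. A hypothesis structure on the real number `C`; nothing is
asserted. [folklore] -/
structure IsShellLadyzhenskayaConst (C : ℝ) : Prop where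
  /-- the constant is nonnegative -/
  nonneg : 0 ≤ C
  /-- Ladyzhenskaya's inequality with this constant -/
  ineq : ∀ f : ℝ³ → ℝ, ContDiff ℝ 1 f → HasCompactSupport f → IsAxisymmetricScalar f →
    (∀ x, f x ≠ 0 → 1 / 4 ≤ cylRadius x ∧ cylRadius x ≤ 3) →
      ∫ x, f x ^ 4 ≤ C * (∫ x, f x ^ 2) * ∫ x, ‖fderiv ℝ f x‖ ^ 2

/-- **A Ladyzhenskaya constant for the shell exists** (accepted
`exists_axisym_ladyzhenskaya_const`). [cite: SereginZajaczkowski2007, proof of Lemma 4.2, displays before (4.10) and (4.12)] -/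
theorem exists_isShellLadyzhenskayaConst : ∃ C : ℝ, IsShellLadyzhenskayaConst C := by
  obtain ⟨C, hC0, hC⟩ := exists_axisym_ladyzhenskaya_const (ρ₀ := 1 / 4) (ρ₁ := 3)
    (by norm_num) (by norm_num)
  exact ⟨C, hC0, fun f hf hc ha hs => by simpa [mul_assoc] using hC f hf hc ha hs⟩

variable {θ : ℝ³ → ℝ} {v : ℝ³ → ℝ³} {L : ℝ³ →L[ℝ] ℝ³} {c : ℝ³}

/-- **Ladyzhenskaya's inequality for a component function** `f = θ⟪v, L· + c⟫` (all the
hypotheses of the previous section, plus the symmetry ones):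
`∫ f⁴ ≤ C_L (B₀ l)² A · (2 (B₁ l + B₀‖L‖)² A + 2 (B₀ l)² G)`, `A = ∫_𝒞̃ ‖v‖²`, `G = ∫_𝒞̃ |∇v|²`
("by Ladyzhenskaya's inequality … `≤ c ∫_𝒞̃ |V|² dx ∫_𝒞̃ (|V|² + |∇V|²) dx`").
[cite: SereginZajaczkowski2007, proof of Lemma 4.2, display before (4.10)] -/
theorem integral_compFun_pow_four_le {C B₀ B₁ l : ℝ} (hC : IsShellLadyzhenskayaConst C)
    (hθ : ContDiff ℝ 1 θ) (hθc : HasCompactSupport θ) (hθW : tsupport θ ⊆ 𝒞)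
    (hθa : IsAxisymmetricScalar θ) (hv : ∀ x ∈ 𝒞, ContDiffAt ℝ 1 v x)
    (hva : ∀ θ' : ℝ, ∀ x ∈ 𝒞, v (rotZ θ' x) = rotZ θ' (v x))
    (hL : ∀ θ' : ℝ, ∀ y : ℝ³, L (rotZ θ' y) = rotZ θ' (L y)) (hc : ∀ θ' : ℝ, rotZ θ' c = c)
    (hB₀ : ∀ x, |θ x| ≤ B₀) (hB₁ : ∀ x, ‖fderiv ℝ θ x‖ ≤ B₁) (hl : ∀ x ∈ 𝒞, ‖L x + c‖ ≤ l)
    (hvi : IntegrableOn (fun x => ‖v x‖ ^ 2) 𝒞)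
    (hDvi : IntegrableOn (fun x => frobeniusNormSq (fderiv ℝ v x)) 𝒞) :
    ∫ x, (θ x * ⟪v x, L x + c⟫) ^ 4 ≤
      C * ((B₀ * l) ^ 2 * ∫ x in 𝒞, ‖v x‖ ^ 2) *
        (2 * (B₁ * l + B₀ * ‖L‖) ^ 2 * (∫ x in 𝒞, ‖v x‖ ^ 2) +
          2 * (B₀ * l) ^ 2 * ∫ x in 𝒞, frobeniusNormSq (fderiv ℝ v x)) := by
  have h4 := hC.ineq _ (contDiff_compFun hθ hθW hv L c) (hasCompactSupport_cutoff_mul hθc)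
    (isAxisymmetricScalar_compFun hθa hθW hva hL hc) (compFun_support hθW)
  have h2 := integral_compFun_sq_le hθ hθc hθW hv hB₀ hl hvi
  have hD := integral_norm_fderiv_compFun_sq_le hθ hθc hθW hv hB₀ hB₁ hl hvi hDvi
  have h2n : 0 ≤ ∫ x, (θ x * ⟪v x, L x + c⟫) ^ 2 := integral_nonneg fun x => by positivity
  have hDn : 0 ≤ ∫ x, ‖fderiv ℝ (fun y => θ y * ⟪v y, L y + c⟫) x‖ ^ 2 :=
    integral_nonneg fun x => by positivity
  calc ∫ x, (θ x * ⟪v x, L x + c⟫) ^ 4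
      ≤ C * (∫ x, (θ x * ⟪v x, L x + c⟫) ^ 2) *
          ∫ x, ‖fderiv ℝ (fun y => θ y * ⟪v y, L y + c⟫) x‖ ^ 2 := h4
    _ ≤ C * ((B₀ * l) ^ 2 * ∫ x in 𝒞, ‖v x‖ ^ 2) *
        (2 * (B₁ * l + B₀ * ‖L‖) ^ 2 * (∫ x in 𝒞, ‖v x‖ ^ 2) +
          2 * (B₀ * l) ^ 2 * ∫ x in 𝒞, frobeniusNormSq (fderiv ℝ v x)) := by
        have hC0 := hC.nonneg
        gcongr

/-! #### The three cylindrical components -/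

/-- `J ∘ J` commutes with the rotations. [folklore] -/
theorem rotGenL_comp_rotGenL_rotZ (θ' : ℝ) (y : ℝ³) :
    (rotGenL.comp rotGenL) (rotZ θ' y) = rotZ θ' ((rotGenL.comp rotGenL) y) := by
  simp only [ContinuousLinearMap.comp_apply, rotGenL_apply, rotGen_rotZ']

/-- `J` commutes with the rotations (operator form). [folklore] -/
theorem rotGenL_rotZ (θ' : ℝ) (y : ℝ³) : rotGenL (rotZ θ' y) = rotZ θ' (rotGenL y) := by
  simp only [rotGenL_apply, rotGen_rotZ']

/-- The zero operator commutes with the rotations. [folklore] -/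
theorem zero_clm_rotZ (θ' : ℝ) (y : ℝ³) :
    (0 : ℝ³ →L[ℝ] ℝ³) (rotZ θ' y) = rotZ θ' ((0 : ℝ³ →L[ℝ] ℝ³) y) := by
  rw [_root_.zero_apply, _root_.zero_apply]
  exact (map_zero (rotZL θ')).symm

/-- The rotations fix the origin. [folklore] -/
theorem rotZ_zero_vec (θ' : ℝ) : rotZ θ' (0 : ℝ³) = 0 :=
  map_zero (rotZL θ')

/-- On the shell, `‖J (J x) + 0‖ ≤ 3`. [folklore] -/
theorem norm_rotGenL_comp_apply_le {x : ℝ³} (hx : x ∈ 𝒞) :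
    ‖(rotGenL.comp rotGenL) x + 0‖ ≤ 3 := by
  rw [add_zero, ContinuousLinearMap.comp_apply, rotGenL_apply, rotGenL_apply,
    norm_rotGen_rotGen_eq]
  exact (cylRadius_lt_of_mem_shell hx).le

/-- On the shell, `‖J x + 0‖ ≤ 3`. [folklore] -/
theorem norm_rotGenL_apply_le {x : ℝ³} (hx : x ∈ 𝒞) : ‖rotGenL x + 0‖ ≤ 3 := by
  rw [add_zero, rotGenL_apply, norm_rotGen_eq]
  exact (cylRadius_lt_of_mem_shell hx).le

/-- `‖0 x + e_z‖ ≤ 1`. [folklore] -/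
theorem norm_zero_apply_add_eZ_le (x : ℝ³) : ‖(0 : ℝ³ →L[ℝ] ℝ³) x + eZ‖ ≤ 1 := by
  rw [_root_.zero_apply, zero_add, eZ, EuclideanSpace.norm_eq]
  simp

/-- `‖J ∘ J‖ ≤ 1`. [folklore] -/
theorem norm_rotGenL_comp_le : ‖rotGenL.comp rotGenL‖ ≤ 1 :=
  (ContinuousLinearMap.opNorm_comp_le _ _).trans
    (by nlinarith [norm_rotGenL_le, norm_nonneg rotGenL])

/-- **The speed from the three components**: with `θ₁ = θ₃ ϱ⁻¹`,
`(θ₁⟪v, J(Jx)⟫)² + (θ₁⟪v, Jx⟫)² + (θ₃⟪v, e_z⟫)² = θ₃² ‖v‖²` at every off-axis point.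
[folklore] -/
theorem sum_compFun_sq_eq {θ₃ : ℝ³ → ℝ} (v : ℝ³ → ℝ³) {x : ℝ³} (hx : cylRadius x ≠ 0) :
    (θ₃ x * (cylRadius x)⁻¹ * ⟪v x, (rotGenL.comp rotGenL) x + 0⟫) ^ 2 +
        (θ₃ x * (cylRadius x)⁻¹ * ⟪v x, rotGenL x + 0⟫) ^ 2 +
        (θ₃ x * ⟪v x, (0 : ℝ³ →L[ℝ] ℝ³) x + eZ⟫) ^ 2 =
      θ₃ x ^ 2 * ‖v x‖ ^ 2 := by
  have h := cylRadius_sq_mul_norm_sq x (v x)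
  have hkey : ⟪v x, rotGen (rotGen x)⟫ ^ 2 + ⟪v x, rotGen x⟫ ^ 2 =
      cylRadius x ^ 2 * (‖v x‖ ^ 2 - v x 2 ^ 2) := by linarith
  have hone : (cylRadius x)⁻¹ ^ 2 * cylRadius x ^ 2 = 1 := by
    rw [inv_pow, inv_mul_cancel₀ (pow_ne_zero 2 hx)]
  rw [_root_.zero_apply]
  simp only [add_zero, ContinuousLinearMap.comp_apply, rotGenL_apply, zero_add, inner_eZ_right]
  calc (θ₃ x * (cylRadius x)⁻¹ * ⟪v x, rotGen (rotGen x)⟫) ^ 2 +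
          (θ₃ x * (cylRadius x)⁻¹ * ⟪v x, rotGen x⟫) ^ 2 + (θ₃ x * v x 2) ^ 2
      = θ₃ x ^ 2 * (cylRadius x)⁻¹ ^ 2 * (⟪v x, rotGen (rotGen x)⟫ ^ 2 + ⟪v x, rotGen x⟫ ^ 2) +
          θ₃ x ^ 2 * v x 2 ^ 2 := by ring
    _ = θ₃ x ^ 2 * (cylRadius x)⁻¹ ^ 2 * (cylRadius x ^ 2 * (‖v x‖ ^ 2 - v x 2 ^ 2)) +
          θ₃ x ^ 2 * v x 2 ^ 2 := by rw [hkey]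
    _ = θ₃ x ^ 2 * ‖v x‖ ^ 2 := by
        linear_combination (θ₃ x ^ 2 * (‖v x‖ ^ 2 - v x 2 ^ 2)) * hone

/-- **Ladyzhenskaya's inequality with the Frobenius norm of the gradient**: for a `C¹` compactly
supported axially symmetric scalar `u` vanishing outside `{1/4 ≤ ϱ ≤ 3}`,
`∫ u⁴ ≤ C ∫ u² ∫ |∇u|²` (`‖Du‖² ≤ |Du|²_F = Σᵢ (∂ᵢu)²`). [folklore] -/
theorem IsShellLadyzhenskayaConst.pow_four_le_frob {C : ℝ} (hC : IsShellLadyzhenskayaConst C)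
    {u : ℝ³ → ℝ} (hu : ContDiff ℝ 1 u) (huc : HasCompactSupport u) (hua : IsAxisymmetricScalar u)
    (hus : ∀ x, u x ≠ 0 → 1 / 4 ≤ cylRadius x ∧ cylRadius x ≤ 3) :
    ∫ x, u x ^ 4 ≤ C * (∫ x, u x ^ 2) * ∫ x, frobeniusNormSq (fderiv ℝ u x) := by
  have h := hC.ineq u hu huc hua hus
  have hDc : Continuous fun x => fderiv ℝ u x := hu.continuous_fderiv one_ne_zero
  have hc1 : HasCompactSupport fun x => ‖fderiv ℝ u x‖ ^ 2 :=
    (huc.fderiv ℝ).norm.comp_left (g := fun t : ℝ => t ^ 2) (zero_pow two_ne_zero)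
  have hi1 : Integrable fun x => ‖fderiv ℝ u x‖ ^ 2 :=
    (hDc.norm.pow 2).integrable_of_hasCompactSupport hc1
  have hc2 : HasCompactSupport fun x => frobeniusNormSq (fderiv ℝ u x) := by
    refine (huc.fderiv ℝ).mono fun x hx => ?_
    contrapose! hx
    simp only [mem_support, not_not] at hx ⊢
    rw [hx]
    exact frobeniusNormSq_zero
  have hi2 : Integrable fun x => frobeniusNormSq (fderiv ℝ u x) :=
    (continuous_frobeniusNormSq_real.comp hDc).integrable_of_hasCompactSupport hc2
  have hle : ∫ x, ‖fderiv ℝ u x‖ ^ 2 ≤ ∫ x, frobeniusNormSq (fderiv ℝ u x) :=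
    integral_mono hi1 hi2 fun x => sq_opNorm_le_frobeniusNormSq _
  have h2n : 0 ≤ ∫ x, u x ^ 2 := integral_nonneg fun x => by positivity
  have hC0 := hC.nonneg
  exact h.trans (by gcongr)

end Ladyzhenskaya

/-! ### Integrability of cut-off products -/

/-- A product of a continuous compactly supported `θ` with `tsupport θ ⊆ 𝒞̃` and a function
continuous on `𝒞̃` is integrable. [folklore] -/
theorem integrable_cutoff_mul {θ g : ℝ³ → ℝ} (hθ : Continuous θ) (hθc : HasCompactSupport θ)
    (hθW : tsupport θ ⊆ 𝒞) (hg : ContinuousOn g 𝒞) : Integrable fun x => θ x * g x :=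
  (continuous_mul_of_tsupport_subset' (isOpen_shell _ _ _) hθ hθW hg).integrable_of_hasCompactSupport
    hθc.mul_right

/-! ## The cut-off data of the energy method -/

section CutoffDataSection

/-- **The data attached to a cut-off of the class `IsLemma42Cutoff`** used by the energy method
at a fixed time: the compact `K₀ ⊆ 𝒞̃` off which `ψ` vanishes, the smoothness, range and
symmetry of `ψ`, a bound `M` for `‖Dψ‖` on the time slab `[-2², 0]`, an auxiliary smooth
axially symmetric spatial cut-off `η : ℝ³ → [0, 1]` with `tsupport η ⊆ 𝒞̃`, `η = 1` on `K₀`,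
`‖Dη‖ ≤ M_η`, and a Ladyzhenskaya constant `C` for the shell. A hypothesis structure; nothing
is asserted (every cut-off of the class admits such data, `IsLemma42Cutoff.exists_cutoffData`).
[folklore] -/
structure CutoffData (ψ : ℝ → ℝ³ → ℝ) (K₀ : Set ℝ³) (η : ℝ³ → ℝ) (M Mη C : ℝ) : Prop where
  /-- `K₀` is compact. -/
  isCompact : IsCompact K₀
  /-- `K₀ ⊆ 𝒞̃`. -/
  subset : K₀ ⊆ shell (1 / 4) 3 2
  /-- `ψ(t, x) = 0` for `x ∉ K₀`. -/
  zero : ∀ t x, x ∉ K₀ → ψ t x = 0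
  /-- `ψ` is smooth. -/
  contDiff : ContDiff ℝ ∞ (uncurry ψ)
  /-- `0 ≤ ψ`. -/
  nonneg : ∀ t x, 0 ≤ ψ t x
  /-- `ψ ≤ 1`. -/
  le_one : ∀ t x, ψ t x ≤ 1
  /-- the slices of `ψ` are axially symmetric. -/
  axisym : ∀ t, IsAxisymmetricScalar (ψ t)
  /-- `0 ≤ M`. -/
  M_nonneg : 0 ≤ M
  /-- `‖Dψ(t, x)‖ ≤ M` on the slab `[-2², 0] × ℝ³`. -/
  norm_fderiv_le : ∀ t ∈ Icc (-(2 : ℝ) ^ 2) 0, ∀ x, ‖fderiv ℝ (uncurry ψ) (t, x)‖ ≤ M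
  /-- `η` is smooth. -/
  η_contDiff : ContDiff ℝ ∞ η
  /-- `η` has compact support. -/
  η_hasCompactSupport : HasCompactSupport η
  /-- `tsupport η ⊆ 𝒞̃`. -/
  η_tsupport : tsupport η ⊆ shell (1 / 4) 3 2
  /-- `0 ≤ η`. -/
  η_nonneg : ∀ x, 0 ≤ η x
  /-- `η ≤ 1`. -/
  η_le_one : ∀ x, η x ≤ 1
  /-- `η` is axially symmetric. -/
  η_axisym : IsAxisymmetricScalar η
  /-- `η = 1` on `K₀`. -/
  η_eq_one : ∀ x ∈ K₀, η x = 1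
  /-- `0 ≤ M_η`. -/
  Mη_nonneg : 0 ≤ Mη
  /-- `‖Dη‖ ≤ M_η`. -/
  η_norm_fderiv_le : ∀ x, ‖fderiv ℝ η x‖ ≤ Mη
  /-- `C` is a Ladyzhenskaya constant for the shell. -/
  ladyzhenskaya : IsShellLadyzhenskayaConst C

/-- **Every cut-off of the class `IsLemma42Cutoff` admits cut-off data**, together with a time
`t₀ ∈ ]-2², -(15/8)²[` before which it vanishes. [folklore] -/
theorem IsLemma42Cutoff.exists_cutoffData {ψ : ℝ → ℝ³ → ℝ} (hψ : IsLemma42Cutoff ψ) :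
    ∃ (K₀ : Set ℝ³) (η : ℝ³ → ℝ) (M Mη C : ℝ), CutoffData ψ K₀ η M Mη C ∧
      ∃ t₀ ∈ Ioo (-(2 : ℝ) ^ 2) (-(15 / 8 : ℝ) ^ 2), ∀ t x, t ≤ t₀ → ψ t x = 0 := by
  obtain ⟨K₀, hK, hK𝒞, t₀, ht₀, hzero⟩ := hψ.support
  have hz : ∀ t x, x ∉ K₀ → ψ t x = 0 := fun t x hx => hzero t x (Or.inl hx)
  obtain ⟨M, hM0, hM⟩ := exists_norm_fderiv_uncurry_le (hψ.contDiff.of_le (by simp)) hK hz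
    (-(2 : ℝ) ^ 2) 0
  obtain ⟨η, hη, hηc, hη𝒞, hη0, hη1, hηa, hηK, Mη, hMη0, hMη⟩ :=
    exists_cutoff_eq_one_of_isCompact_subset_shell hK hK𝒞
  obtain ⟨C, hC⟩ := exists_isShellLadyzhenskayaConst
  exact ⟨K₀, η, M, Mη, C, ⟨hK, hK𝒞, hz, hψ.contDiff, hψ.nonneg, hψ.le_one,
    hψ.isAxisymmetricScalar, hM0, hM, hη, hηc, hη𝒞, hη0, hη1, hηa, hηK, hMη0, hMη, hC⟩,
    t₀, ht₀, fun t x ht => hzero t x (Or.inr ht)⟩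

end CutoffDataSection

/-! ## The functions of the energy method at a fixed time -/

section FixedTimeFunctions

/-- `η₁(s, x) = ψ(s, x)/ϱ`, the cut-off divided by the radius (`χ̃/ϱ = η₁ χ`). [folklore] -/
def eta1 (ψ : ℝ → ℝ³ → ℝ) (s : ℝ) (x : ℝ³) : ℝ :=
  ψ s x * (cylRadius x)⁻¹

/-- `u = χ̃/ϱ = η₁ χ`, `χ = ω_φ`, the localized weighted angular vorticity whose `L²` norm is the
energy `y(s) = ∫ |χ̃/ϱ|²` of (4.9) and (4.13). [cite: SereginZajaczkowski2007, proof of Lemma 4.2, (4.9)] -/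
def uFun (ψ : ℝ → ℝ³ → ℝ) (V : ℝ → ℝ³ → ℝ³) (s : ℝ) (x : ℝ³) : ℝ :=
  eta1 ψ s x * angularVorticity (V s) x

/-- `φ = η₁ u = ψ² χ/ϱ² = χ̃ ϱ⁻² ψ`, the multiplier of the energy identity (4.9) ("we multiply
(4.8) by `χ̃ϱ⁻²`"; the extra `ψ` converts the equation (4.5) for `χ` into (4.8) for `χ̃ = χψ`).
[cite: SereginZajaczkowski2007, proof of Lemma 4.2, (4.9)] -/
def phiFun (ψ : ℝ → ℝ³ → ℝ) (V : ℝ → ℝ³ → ℝ³) (s : ℝ) (x : ℝ³) : ℝ :=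
  eta1 ψ s x * uFun ψ V s x

/-- `∂ₛ (u²) = 2 u (∂ₛχ ψ + χ ∂ₛψ)/ϱ`, the time derivative of the energy density.
[cite: SereginZajaczkowski2007, proof of Lemma 4.2, (4.9) (the term ½∂ₜ∫|χ̃/ϱ|²)] -/
def dFun (ψ : ℝ → ℝ³ → ℝ) (V : ℝ → ℝ³ → ℝ³) (s : ℝ) (x : ℝ³) : ℝ :=
  2 * uFun ψ V s x *
    ((timeDeriv (fun t y => angularVorticity (V t) y) s x * ψ s x +
        angularVorticity (V s) x * deriv (fun t => ψ t x) s) * (cylRadius x)⁻¹)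

/-- `u = ω_φ ψ / ϱ`, the integrand of `vortEnergy`. [folklore] -/
theorem uFun_eq (ψ : ℝ → ℝ³ → ℝ) (V : ℝ → ℝ³ → ℝ³) (s : ℝ) (x : ℝ³) :
    uFun ψ V s x = angularVorticity (V s) x * ψ s x / cylRadius x := by
  rw [uFun, eta1, div_eq_mul_inv]
  ring

variable {ψ : ℝ → ℝ³ → ℝ} {K₀ : Set ℝ³} {η : ℝ³ → ℝ} {M Mη C : ℝ}

namespace CutoffData

variable (d : CutoffData ψ K₀ η M Mη C)
include d

/-! ### The slice cut-off `ψ(s, ·)` -/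

/-- The slices of `ψ` are smooth. [folklore] -/
theorem contDiff_slice (s : ℝ) {n : ℕ∞} : ContDiff ℝ n (ψ s) :=
  (FluidPDE.SereginZajaczkowski2007.contDiff_slice d.contDiff s).of_le (by exact_mod_cast le_top)

/-- `ψ` is differentiable jointly. [folklore] -/
theorem differentiable_uncurry : Differentiable ℝ (uncurry ψ) :=
  d.contDiff.differentiable (by simp)

/-- `tsupport ψ(s, ·) ⊆ K₀`. [folklore] -/
theorem tsupport_slice (s : ℝ) : tsupport (ψ s) ⊆ K₀ :=
  tsupport_slice_subset d.isCompact.isClosed d.zero s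

/-- `tsupport ψ(s, ·) ⊆ 𝒞̃`. [folklore] -/
theorem tsupport_slice_shell (s : ℝ) : tsupport (ψ s) ⊆ shell (1 / 4) 3 2 :=
  (d.tsupport_slice s).trans d.subset

/-- The slices of `ψ` have compact support. [folklore] -/
theorem hasCompactSupport_slice (s : ℝ) : HasCompactSupport (ψ s) :=
  d.isCompact.of_isClosed_subset (isClosed_tsupport _) (d.tsupport_slice s)

/-- `|ψ| ≤ 1`. [folklore] -/
theorem abs_slice_le (s : ℝ) (x : ℝ³) : |ψ s x| ≤ 1 := by
  rw [abs_of_nonneg (d.nonneg s x)]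
  exact d.le_one s x

/-- `‖D_xψ(s, x)‖ ≤ M` on the slab. [folklore] -/
theorem norm_fderiv_slice_le {s : ℝ} (hs : s ∈ Icc (-(2 : ℝ) ^ 2) 0) (x : ℝ³) :
    ‖fderiv ℝ (ψ s) x‖ ≤ M :=
  (FluidPDE.SereginZajaczkowski2007.norm_fderiv_slice_le d.differentiable_uncurry s x).trans
    (d.norm_fderiv_le s hs x)

/-- `|∂ₛψ(s, x)| ≤ M` on the slab. [folklore] -/
theorem abs_deriv_time_le {s : ℝ} (hs : s ∈ Icc (-(2 : ℝ) ^ 2) 0) (x : ℝ³) :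
    |deriv (fun t => ψ t x) s| ≤ M :=
  (abs_deriv_time_slice_le d.differentiable_uncurry s x).trans (d.norm_fderiv_le s hs x)

/-! ### The auxiliary cut-off `η` and `η/ϱ` -/

/-- `|η| ≤ 1`. [folklore] -/
theorem abs_η_le (x : ℝ³) : |η x| ≤ 1 := by
  rw [abs_of_nonneg (d.η_nonneg x)]
  exact d.η_le_one x

/-- `η/ϱ` is smooth. [folklore] -/
theorem contDiff_η_div : ContDiff ℝ 1 fun x => η x * (cylRadius x)⁻¹ :=
  contDiff_mul_of_tsupport_subset (d.η_contDiff.of_le (by simp)) d.η_tsupport fun _ hx =>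
    contDiffAt_inv_cylRadius (cylRadius_pos_of_mem_shell hx).ne'

/-- `tsupport (η/ϱ) ⊆ 𝒞̃`. [folklore] -/
theorem tsupport_η_div : tsupport (fun x => η x * (cylRadius x)⁻¹) ⊆ shell (1 / 4) 3 2 :=
  (tsupport_cutoff_mul_subset _ _).trans d.η_tsupport

/-- `η/ϱ` has compact support. [folklore] -/
theorem hasCompactSupport_η_div : HasCompactSupport fun x => η x * (cylRadius x)⁻¹ :=
  d.η_hasCompactSupport.mul_right

/-- `η/ϱ` is axially symmetric. [folklore] -/
theorem isAxisymmetricScalar_η_div : IsAxisymmetricScalar fun x => η x * (cylRadius x)⁻¹ :=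
  fun θ x => by simp only [d.η_axisym θ x, cylRadius_rotZ]

/-- `|η/ϱ| ≤ 4`. [folklore] -/
theorem abs_η_div_le (x : ℝ³) : |η x * (cylRadius x)⁻¹| ≤ 4 := by
  by_cases hx : x ∈ shell (1 / 4) 3 2
  · have hρ := cylRadius_gt_of_mem_shell hx
    have hρ0 : 0 < cylRadius x := by linarith
    rw [abs_mul, abs_inv, abs_of_pos hρ0]
    calc |η x| * (cylRadius x)⁻¹ ≤ 1 * (1 / 4)⁻¹ := by
          gcongr
          · exact d.abs_η_le x
      _ = 4 := by norm_num
  · rw [image_eq_zero_of_notMem_tsupport fun h => hx (d.η_tsupport h), zero_mul, abs_zero]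
    norm_num

/-- `‖D(η/ϱ)‖ ≤ 4 M_η + 16`. [folklore] -/
theorem norm_fderiv_η_div_le (x : ℝ³) :
    ‖fderiv ℝ (fun x => η x * (cylRadius x)⁻¹) x‖ ≤ 4 * Mη + 16 := by
  by_cases hx : x ∈ shell (1 / 4) 3 2
  · have hρ := cylRadius_gt_of_mem_shell hx
    have hρ0 : 0 < cylRadius x := by linarith
    have hd := (d.η_contDiff.differentiable (by simp)) x
    refine (norm_fderiv_mul_le hd
      ((contDiffAt_inv_cylRadius (n := 1) hρ0.ne').differentiableAt one_ne_zero)).trans ?_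
    · rw [abs_inv, abs_of_pos hρ0]
      have h1 : ‖fderiv ℝ η x‖ * (cylRadius x)⁻¹ ≤ Mη * 4 := by
        calc ‖fderiv ℝ η x‖ * (cylRadius x)⁻¹ ≤ Mη * (1 / 4)⁻¹ := by
              gcongr
              · exact d.Mη_nonneg
              · exact d.η_norm_fderiv_le x
          _ = Mη * 4 := by norm_num
      have h2 : |η x| * ‖fderiv ℝ (fun y => (cylRadius y)⁻¹) x‖ ≤ 1 * 16 := by
        refine mul_le_mul (d.abs_η_le x) ?_ (norm_nonneg _) zero_le_one
        calc ‖fderiv ℝ (fun y => (cylRadius y)⁻¹) x‖ ≤ (cylRadius x ^ 2)⁻¹ :=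
              norm_fderiv_inv_cylRadius_le hρ0.ne'
          _ ≤ ((1 / 4 : ℝ) ^ 2)⁻¹ := by gcongr
          _ = 16 := by norm_num
      linarith
  · rw [fderiv_cutoff_mul_of_notMem fun h => hx (d.η_tsupport h), norm_zero]
    linarith [d.Mη_nonneg]

/-! ### `η₁ = ψ(s, ·)/ϱ` -/

/-- `η₁` is smooth. [folklore] -/
theorem contDiff_eta1 (s : ℝ) {n : ℕ∞} : ContDiff ℝ n (eta1 ψ s) :=
  contDiff_mul_of_tsupport_subset (d.contDiff_slice s) (d.tsupport_slice_shell s) fun _ hx =>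
    contDiffAt_inv_cylRadius (cylRadius_pos_of_mem_shell hx).ne'

/-- `tsupport η₁ ⊆ K₀`. [folklore] -/
theorem tsupport_eta1 (s : ℝ) : tsupport (eta1 ψ s) ⊆ K₀ :=
  (tsupport_cutoff_mul_subset _ _).trans (d.tsupport_slice s)

/-- `tsupport η₁ ⊆ 𝒞̃`. [folklore] -/
theorem tsupport_eta1_shell (s : ℝ) : tsupport (eta1 ψ s) ⊆ shell (1 / 4) 3 2 :=
  (d.tsupport_eta1 s).trans d.subset

/-- `η₁` has compact support. [folklore] -/
theorem hasCompactSupport_eta1 (s : ℝ) : HasCompactSupport (eta1 ψ s) :=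
  (d.hasCompactSupport_slice s).mul_right

/-- `η₁` is axially symmetric. [folklore] -/
theorem isAxisymmetricScalar_eta1 (s : ℝ) : IsAxisymmetricScalar (eta1 ψ s) :=
  fun θ x => by simp only [eta1, d.axisym s θ x, cylRadius_rotZ]

/-- `η₁ = 0` off `K₀`. [folklore] -/
theorem eta1_eq_zero (s : ℝ) {x : ℝ³} (hx : x ∉ K₀) : eta1 ψ s x = 0 := by
  rw [eta1, d.zero s x hx, zero_mul]

/-- `Dη₁ = 0` off `K₀`. [folklore] -/
theorem fderiv_eta1_eq_zero (s : ℝ) {x : ℝ³} (hx : x ∉ K₀) : fderiv ℝ (eta1 ψ s) x = 0 :=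
  fderiv_of_notMem_tsupport ℝ fun h => hx (d.tsupport_eta1 s h)

/-- `|η₁| ≤ 4`. [folklore] -/
theorem abs_eta1_le (s : ℝ) (x : ℝ³) : |eta1 ψ s x| ≤ 4 := by
  by_cases hx : x ∈ K₀
  · have hρ := cylRadius_gt_of_mem_shell (d.subset hx)
    have hρ0 : 0 < cylRadius x := by linarith
    rw [eta1, abs_mul, abs_inv, abs_of_pos hρ0]
    calc |ψ s x| * (cylRadius x)⁻¹ ≤ 1 * (1 / 4)⁻¹ := by
          gcongr
          · exact d.abs_slice_le s x
      _ = 4 := by norm_num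
  · rw [d.eta1_eq_zero s hx, abs_zero]
    norm_num

/-- `‖Dη₁(s, ·)‖ ≤ 4M + 16` on the slab. [folklore] -/
theorem norm_fderiv_eta1_le {s : ℝ} (hs : s ∈ Icc (-(2 : ℝ) ^ 2) 0) (x : ℝ³) :
    ‖fderiv ℝ (eta1 ψ s) x‖ ≤ 4 * M + 16 := by
  by_cases hx : x ∈ K₀
  · have hρ := cylRadius_gt_of_mem_shell (d.subset hx)
    have hρ0 : 0 < cylRadius x := by linarith
    have hd := ((d.contDiff_slice s (n := 1)).differentiable one_ne_zero) x
    have h := norm_fderiv_mul_le hd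
      ((contDiffAt_inv_cylRadius (n := 1) hρ0.ne').differentiableAt one_ne_zero)
    rw [show (fun y => ψ s y * (cylRadius y)⁻¹) = eta1 ψ s from rfl] at h
    refine h.trans ?_
    rw [abs_inv, abs_of_pos hρ0]
    have h1 : ‖fderiv ℝ (ψ s) x‖ * (cylRadius x)⁻¹ ≤ M * 4 := by
      calc ‖fderiv ℝ (ψ s) x‖ * (cylRadius x)⁻¹ ≤ M * (1 / 4)⁻¹ := by
            gcongr
            · exact d.M_nonneg
            · exact d.norm_fderiv_slice_le hs x
        _ = M * 4 := by norm_num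
    have h2 : |ψ s x| * ‖fderiv ℝ (fun y => (cylRadius y)⁻¹) x‖ ≤ 1 * 16 := by
      refine mul_le_mul (d.abs_slice_le s x) ?_ (norm_nonneg _) zero_le_one
      calc ‖fderiv ℝ (fun y => (cylRadius y)⁻¹) x‖ ≤ (cylRadius x ^ 2)⁻¹ :=
            norm_fderiv_inv_cylRadius_le hρ0.ne'
        _ ≤ ((1 / 4 : ℝ) ^ 2)⁻¹ := by gcongr
        _ = 16 := by norm_num
    linarith
  · rw [d.fderiv_eta1_eq_zero s hx, norm_zero]
    linarith [d.M_nonneg]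

/-! ### `u = η₁ χ` and `φ = η₁ u` -/

variable {V : ℝ → ℝ³ → ℝ³} {P : ℝ → ℝ³ → ℝ} (hV : IsSmoothAxisymmetricSolutionOn Q V P)
  (hχ : AngularVorticityEqOn Q V) {s : ℝ} (hs : s ∈ Ioo (-(2 : ℝ) ^ 2) 0)

include hχ hs in
/-- `u(s, ·)` is `C¹`. [folklore] -/
theorem contDiff_uFun : ContDiff ℝ 1 (uFun ψ V s) :=
  contDiff_mul_of_tsupport_subset (d.contDiff_eta1 s) (d.tsupport_eta1_shell s) fun _ hx =>
    (hχ.contDiffAt_slice hs hx).of_le (by norm_num)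

/-- `u(s, ·)` has compact support. [folklore] -/
theorem hasCompactSupport_uFun (V : ℝ → ℝ³ → ℝ³) (s : ℝ) : HasCompactSupport (uFun ψ V s) :=
  (d.hasCompactSupport_eta1 s).mul_right

/-- `tsupport u(s, ·) ⊆ K₀`. [folklore] -/
theorem tsupport_uFun (V : ℝ → ℝ³ → ℝ³) (s : ℝ) : tsupport (uFun ψ V s) ⊆ K₀ :=
  (tsupport_cutoff_mul_subset _ _).trans (d.tsupport_eta1 s)

/-- `tsupport u(s, ·) ⊆ 𝒞̃`. [folklore] -/
theorem tsupport_uFun_shell (V : ℝ → ℝ³ → ℝ³) (s : ℝ) : tsupport (uFun ψ V s) ⊆ 𝒞 :=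
  (d.tsupport_uFun V s).trans d.subset

/-- `u(s, x) = 0` for `x ∉ K₀`. [folklore] -/
theorem uFun_eq_zero (V : ℝ → ℝ³ → ℝ³) (s : ℝ) {x : ℝ³} (hx : x ∉ K₀) : uFun ψ V s x = 0 := by
  rw [uFun, d.eta1_eq_zero s hx, zero_mul]

/-- `Du(s, x) = 0` for `x ∉ K₀`. [folklore] -/
theorem fderiv_uFun_eq_zero (V : ℝ → ℝ³ → ℝ³) (s : ℝ) {x : ℝ³} (hx : x ∉ K₀) :
    fderiv ℝ (uFun ψ V s) x = 0 :=
  fderiv_of_notMem_tsupport ℝ fun h => hx (d.tsupport_uFun V s h)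

include hV hs in
/-- `u(s, ·)` is an axially symmetric scalar. [folklore] -/
theorem isAxisymmetricScalar_uFun : IsAxisymmetricScalar (uFun ψ V s) := by
  intro θ x
  by_cases hx : x ∈ 𝒞
  · rw [uFun, uFun, d.isAxisymmetricScalar_eta1 s θ x, hV.angularVorticity_rotZ_slice hs θ hx]
  · have h1 : x ∉ K₀ := fun h => hx (d.subset h)
    have h2 : rotZ θ x ∉ K₀ := fun h => hx ((rotZ_mem_shell_iff θ).1 (d.subset h))
    rw [d.uFun_eq_zero V s h1, d.uFun_eq_zero V s h2]

/-- `u(s, ·)` is supported in `{1/4 ≤ ϱ ≤ 3}`. [folklore] -/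
theorem uFun_support (V : ℝ → ℝ³ → ℝ³) (s : ℝ) (x : ℝ³) (hx : uFun ψ V s x ≠ 0) :
    1 / 4 ≤ cylRadius x ∧ cylRadius x ≤ 3 := by
  have hx' : x ∈ 𝒞 := by
    by_contra h
    exact hx (d.uFun_eq_zero V s fun h' => h (d.subset h'))
  exact ⟨(cylRadius_gt_of_mem_shell hx').le, (cylRadius_lt_of_mem_shell hx').le⟩

include hχ hs in
/-- **Product rule for `u = η₁ χ`** at a point of the shell:
`Du(x) h = Dη₁(x) h · χ x + η₁ x · Dχ(x) h`. [folklore] -/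
theorem fderiv_uFun_apply {x : ℝ³} (hx : x ∈ 𝒞) (h : ℝ³) :
    fderiv ℝ (uFun ψ V s) x h =
      fderiv ℝ (eta1 ψ s) x h * angularVorticity (V s) x +
        eta1 ψ s x * fderiv ℝ (fun y => angularVorticity (V s) y) x h :=
  fderiv_mul_apply_of_differentiableAt ((d.contDiff_eta1 s (n := 1)).differentiable one_ne_zero x)
    (hχ.differentiableAt_slice hs hx) h

include hV hχ hs in
/-- **Ladyzhenskaya's inequality for `u`**: `∫ u⁴ ≤ C ∫ u² ∫ |∇u|²`
("`∫_𝒞̃ |χ̃/ϱ|⁴ dx ≤ … ≤ c ∫_𝒞̃ |∇_a(χ̃/ϱ)|² dx ∫_𝒞̃ |χ̃/ϱ|² dx`").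
[cite: SereginZajaczkowski2007, proof of Lemma 4.2, display before (4.12)] -/
theorem integral_uFun_pow_four_le :
    ∫ x, uFun ψ V s x ^ 4 ≤
      C * (∫ x, uFun ψ V s x ^ 2) * ∫ x, frobeniusNormSq (fderiv ℝ (uFun ψ V s) x) :=
  d.ladyzhenskaya.pow_four_le_frob (d.contDiff_uFun hχ hs) (d.hasCompactSupport_uFun V s)
    (d.isAxisymmetricScalar_uFun hV hs) (d.uFun_support V s)

include hχ hs in
/-- `φ(s, ·)` is `C¹`. [folklore] -/
theorem contDiff_phiFun : ContDiff ℝ 1 (phiFun ψ V s) :=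
  (d.contDiff_eta1 s).mul (d.contDiff_uFun hχ hs)

/-- `φ(s, ·)` has compact support. [folklore] -/
theorem hasCompactSupport_phiFun (V : ℝ → ℝ³ → ℝ³) (s : ℝ) : HasCompactSupport (phiFun ψ V s) :=
  (d.hasCompactSupport_eta1 s).mul_right

/-- `tsupport φ(s, ·) ⊆ K₀`. [folklore] -/
theorem tsupport_phiFun (V : ℝ → ℝ³ → ℝ³) (s : ℝ) : tsupport (phiFun ψ V s) ⊆ K₀ :=
  (tsupport_cutoff_mul_subset _ _).trans (d.tsupport_eta1 s)

/-- `tsupport φ(s, ·) ⊆ 𝒞̃`. [folklore] -/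
theorem tsupport_phiFun_shell (V : ℝ → ℝ³ → ℝ³) (s : ℝ) : tsupport (phiFun ψ V s) ⊆ 𝒞 :=
  (d.tsupport_phiFun V s).trans d.subset

/-- `φ(s, x) = 0` for `x ∉ K₀`. [folklore] -/
theorem phiFun_eq_zero (V : ℝ → ℝ³ → ℝ³) (s : ℝ) {x : ℝ³} (hx : x ∉ K₀) : phiFun ψ V s x = 0 := by
  rw [phiFun, d.eta1_eq_zero s hx, zero_mul]

/-- `Dφ(s, x) = 0` for `x ∉ K₀`. [folklore] -/
theorem fderiv_phiFun_eq_zero (V : ℝ → ℝ³ → ℝ³) (s : ℝ) {x : ℝ³} (hx : x ∉ K₀) :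
    fderiv ℝ (phiFun ψ V s) x = 0 :=
  fderiv_of_notMem_tsupport ℝ fun h => hx (d.tsupport_phiFun V s h)

include hχ hs in
/-- **Product rule for `φ = η₁ u`**: `Dφ(x) h = Dη₁(x) h · u x + η₁ x · Du(x) h`. [folklore] -/
theorem fderiv_phiFun_apply (x h : ℝ³) :
    fderiv ℝ (phiFun ψ V s) x h =
      fderiv ℝ (eta1 ψ s) x h * uFun ψ V s x + eta1 ψ s x * fderiv ℝ (uFun ψ V s) x h :=
  fderiv_mul_apply_of_differentiableAt ((d.contDiff_eta1 s (n := 1)).differentiable one_ne_zero x)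
    ((d.contDiff_uFun hχ hs).differentiable one_ne_zero x) h

/-! ### Integrability of products with `u`, `φ` and their derivatives -/

include hχ hs in
/-- `u g` is integrable for `g` continuous on `𝒞̃`. [folklore] -/
theorem integrable_uFun_mul {g : ℝ³ → ℝ} (hg : ContinuousOn g 𝒞) :
    Integrable fun x => uFun ψ V s x * g x :=
  integrable_cutoff_mul (d.contDiff_uFun hχ hs).continuous (d.hasCompactSupport_uFun V s)
    (d.tsupport_uFun_shell V s) hg

include hχ hs in
/-- `φ g` is integrable for `g` continuous on `𝒞̃`. [folklore] -/
theorem integrable_phiFun_mul {g : ℝ³ → ℝ} (hg : ContinuousOn g 𝒞) :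
    Integrable fun x => phiFun ψ V s x * g x :=
  integrable_cutoff_mul (d.contDiff_phiFun hχ hs).continuous (d.hasCompactSupport_phiFun V s)
    (d.tsupport_phiFun_shell V s) hg

include hχ hs in
/-- `∂ᵥu g` is integrable for `g` continuous on `𝒞̃`. [folklore] -/
theorem integrable_fderiv_uFun_mul {g : ℝ³ → ℝ} (hg : ContinuousOn g 𝒞) (v : ℝ³) :
    Integrable fun x => fderiv ℝ (uFun ψ V s) x v * g x :=
  integrable_cutoff_mul (((d.contDiff_uFun hχ hs).continuous_fderiv one_ne_zero).clm_apply
    continuous_const) ((d.hasCompactSupport_uFun V s).fderiv_apply (𝕜 := ℝ) v)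
    ((tsupport_fderiv_apply_subset ℝ v).trans (d.tsupport_uFun_shell V s)) hg

/-- `η₁ g` is integrable for `g` continuous on `𝒞̃`. [folklore] -/
theorem integrable_eta1_mul (s : ℝ) {g : ℝ³ → ℝ} (hg : ContinuousOn g 𝒞) :
    Integrable fun x => eta1 ψ s x * g x :=
  integrable_cutoff_mul (d.contDiff_eta1 s (n := 0)).continuous (d.hasCompactSupport_eta1 s)
    (d.tsupport_eta1_shell s) hg

/-- `η g` is integrable for `g` continuous on `𝒞̃`. [folklore] -/
theorem integrable_η_mul {g : ℝ³ → ℝ} (hg : ContinuousOn g 𝒞) : Integrable fun x => η x * g x :=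
  integrable_cutoff_mul d.η_contDiff.continuous d.η_hasCompactSupport d.η_tsupport hg

end CutoffData

end FixedTimeFunctions

/-! ## The energy identity (4.9) at a fixed time: integrations by parts -/

section EnergyIdentity

variable {ψ : ℝ → ℝ³ → ℝ} {K₀ : Set ℝ³} {η : ℝ³ → ℝ} {M Mη C : ℝ}

namespace CutoffData

variable (d : CutoffData ψ K₀ η M Mη C)

variable {V : ℝ → ℝ³ → ℝ³} {P : ℝ → ℝ³ → ℝ} (hV : IsSmoothAxisymmetricSolutionOn Q V P)
  (hχ : AngularVorticityEqOn Q V) {s : ℝ} (hs : s ∈ Ioo (-(2 : ℝ) ^ 2) 0)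

include d hχ hs in
/-- **The dissipation identity** (the term `∫ φ Δχ` of (4.9)): with `u = η₁χ`, `φ = η₁u`,
`∫ φ Δχ = -∫ Σᵢ (∂ᵢu)² + ∫ χ² Σᵢ (∂ᵢη₁)²`
(integration by parts `∫ φ ∂ᵢ∂ᵢχ = -∫ ∂ᵢφ ∂ᵢχ` and the pointwise identity
`∂ᵢ(η₁²χ) ∂ᵢχ = (∂ᵢ(η₁χ))² - χ² (∂ᵢη₁)²`; this is how the dissipation `∫ |∇_a(χ̃/ϱ)|²` of (4.9)
arises). [cite: SereginZajaczkowski2007, proof of Lemma 4.2, (4.9)] -/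
theorem integral_phiFun_mul_laplacian :
    ∫ x, phiFun ψ V s x * (Δ fun y => angularVorticity (V s) y) x =
      -(∫ x, ∑ i, fderiv ℝ (uFun ψ V s) x (𝐞 i) ^ 2) +
        ∫ x, angularVorticity (V s) x ^ 2 * ∑ i, fderiv ℝ (eta1 ψ s) x (𝐞 i) ^ 2 := by
  set χf : ℝ³ → ℝ := fun y => angularVorticity (V s) y with hχf
  set g : Fin 3 → ℝ³ → ℝ := fun i y => fderiv ℝ χf y (𝐞 i) with hg
  -- regularity of the pieces on the shell
  have hgc : ∀ i, ContinuousOn (g i) 𝒞 := fun i =>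
    (hχ.continuousOn_fderiv_slice hs).clm_apply continuousOn_const
  have hgd : ∀ i, ∀ x ∈ 𝒞, DifferentiableAt ℝ (g i) x := fun i x hx =>
    hχ.differentiableAt_fderiv_apply_slice hs hx (𝐞 i)
  have hg'c : ∀ i, ContinuousOn (fun x => fderiv ℝ (g i) x (𝐞 i)) 𝒞 := fun i =>
    hχ.continuousOn_fderiv_fderiv_apply_slice hs (𝐞 i)
  have hχc : ContinuousOn χf 𝒞 := hχ.continuousOn_slice hs
  -- (1) `φ Δχ = Σᵢ φ ∂ᵢgᵢ` pointwise
  have h1 : ∀ x, phiFun ψ V s x * (Δ χf) x = ∑ i, phiFun ψ V s x * fderiv ℝ (g i) x (𝐞 i) := by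
    intro x
    by_cases hx : x ∈ 𝒞
    · rw [laplacian_eq_sum_of_contDiffAt (hχ.contDiffAt_slice hs hx), Finset.mul_sum]
    · rw [d.phiFun_eq_zero V s fun h => hx (d.subset h)]
      simp
  -- (2) the pointwise identity `∂ᵢφ gᵢ = (∂ᵢu)² - χ²(∂ᵢη₁)²`
  have h2 : ∀ i x, fderiv ℝ (phiFun ψ V s) x (𝐞 i) * g i x =
      fderiv ℝ (uFun ψ V s) x (𝐞 i) ^ 2 - χf x ^ 2 * fderiv ℝ (eta1 ψ s) x (𝐞 i) ^ 2 := by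
    intro i x
    by_cases hx : x ∈ 𝒞
    · rw [d.fderiv_phiFun_apply hχ hs x, d.fderiv_uFun_apply hχ hs hx]
      simp only [hg, uFun, hχf]
      ring
    · have hK : x ∉ K₀ := fun h => hx (d.subset h)
      rw [d.fderiv_phiFun_eq_zero V s hK, d.fderiv_uFun_eq_zero V s hK, d.fderiv_eta1_eq_zero s hK]
      simp
  -- (3) integration by parts, one direction at a time
  have h3 : ∀ i, ∫ x, phiFun ψ V s x * fderiv ℝ (g i) x (𝐞 i) =
      -∫ x, fderiv ℝ (phiFun ψ V s) x (𝐞 i) * g i x := fun i =>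
    integral_mul_fderiv_apply_eq_neg_of_tsupport_subset (isOpen_shell _ _ _)
      (d.contDiff_phiFun hχ hs) (d.hasCompactSupport_phiFun V s) (d.tsupport_phiFun_shell V s)
      (hgd i) (hgc i) (𝐞 i) (hg'c i)
  -- integrability
  have hi1 : ∀ i, Integrable fun x => phiFun ψ V s x * fderiv ℝ (g i) x (𝐞 i) := fun i =>
    d.integrable_phiFun_mul hχ hs (hg'c i)
  have hiu : ∀ i, Integrable fun x => fderiv ℝ (uFun ψ V s) x (𝐞 i) ^ 2 := by
    intro i
    have hc : Continuous fun x => fderiv ℝ (uFun ψ V s) x (𝐞 i) :=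
      ((d.contDiff_uFun hχ hs).continuous_fderiv one_ne_zero).clm_apply continuous_const
    have h := d.integrable_fderiv_uFun_mul hχ hs (g := fun x => fderiv ℝ (uFun ψ V s) x (𝐞 i))
      hc.continuousOn (𝐞 i)
    refine h.congr (Eventually.of_forall fun x => ?_)
    simp only [sq]
  have hie : ∀ i, Integrable fun x => χf x ^ 2 * fderiv ℝ (eta1 ψ s) x (𝐞 i) ^ 2 := by
    intro i
    have hθ : Continuous fun x => fderiv ℝ (eta1 ψ s) x (𝐞 i) ^ 2 :=
      (((d.contDiff_eta1 s (n := 1)).continuous_fderiv one_ne_zero).clm_apply continuous_const).pow 2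
    have hθc : HasCompactSupport fun x => fderiv ℝ (eta1 ψ s) x (𝐞 i) ^ 2 :=
      ((d.hasCompactSupport_eta1 s).fderiv_apply (𝕜 := ℝ) (𝐞 i)).comp_left
        (g := fun t : ℝ => t ^ 2) (zero_pow two_ne_zero)
    have hθW : tsupport (fun x => fderiv ℝ (eta1 ψ s) x (𝐞 i) ^ 2) ⊆ 𝒞 := by
      refine (tsupport_comp_subset (g := fun t : ℝ => t ^ 2) (zero_pow two_ne_zero) _).trans ?_
      exact (tsupport_fderiv_apply_subset ℝ (𝐞 i)).trans (d.tsupport_eta1_shell s)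
    have h := integrable_cutoff_mul hθ hθc hθW (hχc.pow 2)
    refine h.congr (Eventually.of_forall fun x => ?_)
    simp only [Pi.pow_apply]
    ring
  -- assembling
  calc ∫ x, phiFun ψ V s x * (Δ χf) x
      = ∫ x, ∑ i, phiFun ψ V s x * fderiv ℝ (g i) x (𝐞 i) := integral_congr_ae
          (Eventually.of_forall h1)
    _ = ∑ i, ∫ x, phiFun ψ V s x * fderiv ℝ (g i) x (𝐞 i) :=
          integral_finsetSum _ fun i _ => hi1 i
    _ = ∑ i, -∫ x, fderiv ℝ (phiFun ψ V s) x (𝐞 i) * g i x := Finset.sum_congr rfl fun i _ => h3 i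
    _ = -∑ i, ∫ x, (fderiv ℝ (uFun ψ V s) x (𝐞 i) ^ 2 - χf x ^ 2 * fderiv ℝ (eta1 ψ s) x (𝐞 i) ^ 2) := by
          rw [Finset.sum_neg_distrib]
          congr 1
          refine Finset.sum_congr rfl fun i _ => integral_congr_ae (Eventually.of_forall (h2 i))
    _ = -∑ i, ((∫ x, fderiv ℝ (uFun ψ V s) x (𝐞 i) ^ 2) -
          ∫ x, χf x ^ 2 * fderiv ℝ (eta1 ψ s) x (𝐞 i) ^ 2) := by
          congr 1
          exact Finset.sum_congr rfl fun i _ => integral_sub (hiu i) (hie i)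
    _ = -(∫ x, ∑ i, fderiv ℝ (uFun ψ V s) x (𝐞 i) ^ 2) +
          ∫ x, χf x ^ 2 * ∑ i, fderiv ℝ (eta1 ψ s) x (𝐞 i) ^ 2 := by
          rw [Finset.sum_sub_distrib, integral_finsetSum _ fun i _ => hiu i, neg_sub, sub_eq_neg_add]
          congr 1
          rw [← integral_finsetSum _ fun i _ => hie i]
          refine integral_congr_ae (Eventually.of_forall fun x => ?_)
          simp only [Finset.mul_sum]

include d hV hχ hs in
/-- **The transport identity** (the terms `V_ϱχ̃_{,ϱ} + V₃χ̃_{,3}` of (4.8) against `χ̃ϱ⁻²`):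
`∫ φ Dχ·V = -∫ χ² η₁ Dη₁·V` (write `φ Dχ·V = ½ Σᵢ (η₁²Vᵢ) ∂ᵢ(χ²)`, integrate by parts, and use
`Σᵢ ∂ᵢ(η₁²Vᵢ) = 2η₁ Dη₁·V + η₁² div V` with `div V = 0`).
[cite: SereginZajaczkowski2007, proof of Lemma 4.2, (4.3) and (4.8)–(4.9)] -/
theorem integral_phiFun_mul_fderiv_apply_velocity :
    ∫ x, phiFun ψ V s x * fderiv ℝ (fun y => angularVorticity (V s) y) x (V s x) =
      -∫ x, angularVorticity (V s) x ^ 2 * (eta1 ψ s x * fderiv ℝ (eta1 ψ s) x (V s x)) := by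
  set χf : ℝ³ → ℝ := fun y => angularVorticity (V s) y with hχf
  set g : Fin 3 → ℝ³ → ℝ := fun i y => fderiv ℝ χf y (𝐞 i) with hg
  set f : Fin 3 → ℝ³ → ℝ := fun i y => eta1 ψ s y ^ 2 * V s y i with hf
  have hχc : ContinuousOn χf 𝒞 := hχ.continuousOn_slice hs
  have hχd : ∀ x ∈ 𝒞, DifferentiableAt ℝ χf x := fun x hx => hχ.differentiableAt_slice hs hx
  have hgc : ∀ i, ContinuousOn (g i) 𝒞 := fun i =>
    (hχ.continuousOn_fderiv_slice hs).clm_apply continuousOn_const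
  -- the cut-off `η₁²`
  have he2 : ContDiff ℝ 1 fun y => eta1 ψ s y ^ 2 := (d.contDiff_eta1 s (n := 1)).pow 2
  have he2W : tsupport (fun y => eta1 ψ s y ^ 2) ⊆ K₀ :=
    (tsupport_comp_subset (g := fun t : ℝ => t ^ 2) (zero_pow two_ne_zero) _).trans
      (d.tsupport_eta1 s)
  have he2c : HasCompactSupport fun y => eta1 ψ s y ^ 2 :=
    (d.hasCompactSupport_eta1 s).comp_left (g := fun t : ℝ => t ^ 2) (zero_pow two_ne_zero)
  have he2d : ∀ x, DifferentiableAt ℝ (fun y => eta1 ψ s y ^ 2) x :=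
    he2.differentiable one_ne_zero
  -- the functions `fᵢ = η₁² Vᵢ`
  have hVi : ∀ i, ∀ x ∈ 𝒞, ContDiffAt ℝ 1 (fun y => V s y i) x := fun i x hx =>
    contDiffAt_euclidean.1 (hV.contDiffAt_slice hs hx) i
  have hfC : ∀ i, ContDiff ℝ 1 (f i) := fun i =>
    contDiff_mul_of_tsupport_subset he2 (he2W.trans d.subset) (hVi i)
  have hfc : ∀ i, HasCompactSupport (f i) := fun i => he2c.mul_right
  have hfW : ∀ i, tsupport (f i) ⊆ 𝒞 := fun i =>
    (tsupport_cutoff_mul_subset _ _).trans (he2W.trans d.subset)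
  -- the function `χ²`
  have h2d : ∀ x ∈ 𝒞, DifferentiableAt ℝ (fun y => χf y ^ 2) x := fun x hx => (hχd x hx).pow 2
  have h2c : ContinuousOn (fun y => χf y ^ 2) 𝒞 := hχc.pow 2
  have h2' : ∀ i, ∀ x ∈ 𝒞, fderiv ℝ (fun y => χf y ^ 2) x (𝐞 i) = 2 * χf x * g i x :=
    fun i x hx => fderiv_sq_apply (hχd x hx) (𝐞 i)
  have h2'c : ∀ i, ContinuousOn (fun x => fderiv ℝ (fun y => χf y ^ 2) x (𝐞 i)) 𝒞 := fun i =>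
    ((continuousOn_const.mul hχc).mul (hgc i)).congr (h2' i)
  -- (1) pointwise: `φ Dχ·V = ½ Σᵢ fᵢ ∂ᵢ(χ²)`
  have h1 : ∀ x, phiFun ψ V s x * fderiv ℝ χf x (V s x) =
      2⁻¹ * ∑ i, f i x * fderiv ℝ (fun y => χf y ^ 2) x (𝐞 i) := by
    intro x
    by_cases hx : x ∈ 𝒞
    · rw [fderiv_apply_eq_sum χf x (V s x), Finset.mul_sum, Finset.mul_sum]
      refine Finset.sum_congr rfl fun i _ => ?_
      rw [h2' i x hx]
      simp only [hf, phiFun, uFun, hχf]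
      ring
    · have hK : x ∉ K₀ := fun h => hx (d.subset h)
      rw [d.phiFun_eq_zero V s hK]
      simp [hf, d.eta1_eq_zero s hK]
  -- (2) pointwise: `Σᵢ ∂ᵢfᵢ = 2 η₁ Dη₁·V`
  have h2 : ∀ x, ∑ i, fderiv ℝ (f i) x (𝐞 i) = 2 * eta1 ψ s x * fderiv ℝ (eta1 ψ s) x (V s x) := by
    intro x
    by_cases hx : x ∈ 𝒞
    · have hVd : DifferentiableAt ℝ (V s) x := hV.differentiableAt_slice hs hx
      have e1 : ∀ i, fderiv ℝ (f i) x (𝐞 i) =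
          2 * eta1 ψ s x * (V s x i * fderiv ℝ (eta1 ψ s) x (𝐞 i)) +
            eta1 ψ s x ^ 2 * fderiv ℝ (V s) x (𝐞 i) i := by
        intro i
        rw [hf, fderiv_mul_apply_of_differentiableAt (he2d x)
          ((hVi i x hx).differentiableAt one_ne_zero),
          fderiv_sq_apply ((d.contDiff_eta1 s (n := 1)).differentiable one_ne_zero x),
          fderiv_coord_apply hVd]
        ring
      simp only [e1, Finset.sum_add_distrib, ← Finset.mul_sum]
      rw [← fderiv_apply_eq_sum, ← divergence_eq_sum_apply, hV.divergence_slice hs hx, mul_zero,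
        add_zero]
    · have hK : x ∉ K₀ := fun h => hx (d.subset h)
      have e0 : ∀ i, fderiv ℝ (f i) x (𝐞 i) = 0 := fun i => by
        rw [hf, fderiv_cutoff_mul_of_notMem (θ := fun y => eta1 ψ s y ^ 2) fun h => hK (he2W h)]
        rfl
      rw [Finset.sum_eq_zero fun i _ => e0 i, d.eta1_eq_zero s hK]
      ring
  -- (3) integration by parts
  have h3 : ∀ i, ∫ x, f i x * fderiv ℝ (fun y => χf y ^ 2) x (𝐞 i) =
      -∫ x, fderiv ℝ (f i) x (𝐞 i) * χf x ^ 2 := fun i =>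
    integral_mul_fderiv_apply_eq_neg_of_tsupport_subset (isOpen_shell _ _ _) (hfC i) (hfc i)
      (hfW i) h2d h2c (𝐞 i) (h2'c i)
  -- integrability
  have hi1 : ∀ i, Integrable fun x => f i x * fderiv ℝ (fun y => χf y ^ 2) x (𝐞 i) := fun i =>
    integrable_cutoff_mul (hfC i).continuous (hfc i) (hfW i) (h2'c i)
  have hi2 : ∀ i, Integrable fun x => fderiv ℝ (f i) x (𝐞 i) * χf x ^ 2 := fun i =>
    integrable_cutoff_mul (((hfC i).continuous_fderiv one_ne_zero).clm_apply continuous_const)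
      ((hfc i).fderiv_apply (𝕜 := ℝ) (𝐞 i))
      ((tsupport_fderiv_apply_subset ℝ (𝐞 i)).trans (hfW i)) h2c
  -- assembling
  calc ∫ x, phiFun ψ V s x * fderiv ℝ χf x (V s x)
      = ∫ x, 2⁻¹ * ∑ i, f i x * fderiv ℝ (fun y => χf y ^ 2) x (𝐞 i) :=
        integral_congr_ae (Eventually.of_forall h1)
    _ = 2⁻¹ * ∑ i, ∫ x, f i x * fderiv ℝ (fun y => χf y ^ 2) x (𝐞 i) := by
        rw [integral_const_mul, integral_finsetSum _ fun i _ => hi1 i]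
    _ = 2⁻¹ * ∑ i, -∫ x, fderiv ℝ (f i) x (𝐞 i) * χf x ^ 2 := by
        congr 1
        exact Finset.sum_congr rfl fun i _ => h3 i
    _ = -(2⁻¹ * ∫ x, (∑ i, fderiv ℝ (f i) x (𝐞 i)) * χf x ^ 2) := by
        rw [Finset.sum_neg_distrib, ← integral_finsetSum _ fun i _ => hi2 i, mul_neg]
        congr 2
        refine integral_congr_ae (Eventually.of_forall fun x => ?_)
        simp only [Finset.sum_mul]
    _ = -∫ x, χf x ^ 2 * (eta1 ψ s x * fderiv ℝ (eta1 ψ s) x (V s x)) := by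
        rw [← integral_const_mul]
        congr 1
        refine integral_congr_ae (Eventually.of_forall fun x => ?_)
        simp only [h2]
        ring

include d hV hχ hs in
/-- **The source identity** (the term `J₁ = (2/ϱ)V_φV_{φ,3}ψ` of (4.8) against `χ̃ϱ⁻²`,
"`∫_𝒞̃ J₁ χ̃/ϱ² dx = -∫_𝒞̃ (V_φ²/ϱ²)(χ̃/ϱ)_{,3} ψ dx - ∫_𝒞̃ (V_φ²/ϱ²)(χ̃/ϱ) ψ_{,3} dx`"):
`∫ φ (2/ϱ) V_φ ∂₃V_φ = -∫ ∂₃(φ/ϱ) V_φ²` (integration by parts in `x₃`).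
[cite: SereginZajaczkowski2007, proof of Lemma 4.2, display before (4.10)] -/
theorem integral_phiFun_mul_source :
    ∫ x, phiFun ψ V s x * (2 / cylRadius x * swirlVelocity (V s) x *
        fderiv ℝ (fun y => swirlVelocity (V s) y) x eZ) =
      -∫ x, fderiv ℝ (fun y => phiFun ψ V s y * (cylRadius y)⁻¹) x eZ *
        swirlVelocity (V s) x ^ 2 := by
  set g₅ : ℝ³ → ℝ := fun y => swirlVelocity (V s) y ^ 2 with hg₅
  set f₅ : ℝ³ → ℝ := fun y => phiFun ψ V s y * (cylRadius y)⁻¹ with hf₅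
  have hsw : ∀ x ∈ 𝒞, ContDiffAt ℝ 1 (fun y => swirlVelocity (V s) y) x := fun x hx =>
    contDiffAt_swirlVelocity (hV.contDiffAt_slice hs hx) (cylRadius_pos_of_mem_shell hx).ne'
  have hg₅C : ∀ x ∈ 𝒞, ContDiffAt ℝ 1 g₅ x := fun x hx => (hsw x hx).pow 2
  have hg₅d : ∀ x ∈ 𝒞, DifferentiableAt ℝ g₅ x := fun x hx =>
    (hg₅C x hx).differentiableAt one_ne_zero
  have hg₅c : ContinuousOn g₅ 𝒞 := continuousOn_shell_of_contDiffAt hg₅C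
  have hg₅'c : ContinuousOn (fun x => fderiv ℝ g₅ x eZ) 𝒞 :=
    continuousOn_fderiv_apply_shell_of_contDiffAt hg₅C eZ
  have hf₅C : ContDiff ℝ 1 f₅ :=
    contDiff_mul_of_tsupport_subset (d.contDiff_phiFun hχ hs) (d.tsupport_phiFun_shell V s)
      fun x hx => contDiffAt_inv_cylRadius (cylRadius_pos_of_mem_shell hx).ne'
  have hf₅c : HasCompactSupport f₅ := (d.hasCompactSupport_phiFun V s).mul_right
  have hf₅W : tsupport f₅ ⊆ 𝒞 := (tsupport_cutoff_mul_subset _ _).trans (d.tsupport_phiFun_shell V s)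
  -- pointwise
  have h1 : ∀ x, phiFun ψ V s x * (2 / cylRadius x * swirlVelocity (V s) x *
      fderiv ℝ (fun y => swirlVelocity (V s) y) x eZ) = f₅ x * fderiv ℝ g₅ x eZ := by
    intro x
    by_cases hx : x ∈ 𝒞
    · rw [hg₅, fderiv_sq_apply ((hsw x hx).differentiableAt one_ne_zero) eZ, hf₅, div_eq_mul_inv]
      ring
    · have hK : x ∉ K₀ := fun h => hx (d.subset h)
      simp only [hf₅, d.phiFun_eq_zero V s hK, zero_mul]
  calc ∫ x, phiFun ψ V s x * (2 / cylRadius x * swirlVelocity (V s) x *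
        fderiv ℝ (fun y => swirlVelocity (V s) y) x eZ)
      = ∫ x, f₅ x * fderiv ℝ g₅ x eZ := integral_congr_ae (Eventually.of_forall h1)
    _ = -∫ x, fderiv ℝ f₅ x eZ * g₅ x :=
        integral_mul_fderiv_apply_eq_neg_of_tsupport_subset (isOpen_shell _ _ _) hf₅C hf₅c hf₅W
          hg₅d hg₅c eZ hg₅'c

end CutoffData

end EnergyIdentity

/-! ## Pointwise facts for the estimates (4.10)–(4.12) -/

section Pointwise

/-- **Young's inequality with a parameter**: `2ab ≤ ε a² + ε⁻¹ b²` for `ε > 0`. [folklore] -/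
theorem two_mul_le_eps (a b : ℝ) {ε : ℝ} (hε : 0 < ε) : 2 * a * b ≤ ε * a ^ 2 + ε⁻¹ * b ^ 2 := by
  have h : 0 ≤ (ε * a - b) ^ 2 / ε := div_nonneg (sq_nonneg _) hε.le
  have he : ε ≠ 0 := hε.ne'
  calc 2 * a * b = ε * a ^ 2 + ε⁻¹ * b ^ 2 - (ε * a - b) ^ 2 / ε := by field_simp; ring
    _ ≤ ε * a ^ 2 + ε⁻¹ * b ^ 2 := by linarith

/-- `u² f² ≤ (ε u⁴ + ε⁻¹ f⁴)/2`. [folklore] -/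
theorem sq_mul_sq_le_eps (u f : ℝ) {ε : ℝ} (hε : 0 < ε) :
    u ^ 2 * f ^ 2 ≤ 2⁻¹ * (ε * u ^ 4 + ε⁻¹ * f ^ 4) := by
  have h := two_mul_le_eps (u ^ 2) (f ^ 2) hε
  nlinarith

/-- The standard basis vectors are unit vectors (the tree's `LocalHelmholtz.norm_basisFun`,
restated to keep the imports light). [folklore] -/
theorem norm_basisFun_eq_one (i : Fin 3) : ‖(𝐞 i : ℝ³)‖ = 1 :=
  (EuclideanSpace.basisFun (Fin 3) ℝ).orthonormal.1 i

/-- A partial derivative is bounded by the operator norm of the derivative: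
`(L eᵢ)² ≤ ‖L‖²`. [folklore] -/
theorem apply_basisFun_sq_le_norm_sq (L : ℝ³ →L[ℝ] ℝ) (i : Fin 3) : L (𝐞 i) ^ 2 ≤ ‖L‖ ^ 2 := by
  have h : |L (𝐞 i)| ≤ ‖L‖ := by
    rw [← Real.norm_eq_abs]
    exact (L.le_opNorm _).trans (by rw [norm_basisFun_eq_one, mul_one])
  calc L (𝐞 i) ^ 2 = |L (𝐞 i)| ^ 2 := (sq_abs _).symm
    _ ≤ ‖L‖ ^ 2 := pow_le_pow_left₀ (abs_nonneg _) h 2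

/-- `Σᵢ (L eᵢ)² ≤ 3 ‖L‖²`. [folklore] -/
theorem sum_apply_basisFun_sq_le (L : ℝ³ →L[ℝ] ℝ) : ∑ i, L (𝐞 i) ^ 2 ≤ 3 * ‖L‖ ^ 2 :=
  calc ∑ i, L (𝐞 i) ^ 2 ≤ ∑ _i : Fin 3, ‖L‖ ^ 2 :=
        Finset.sum_le_sum fun i _ => apply_basisFun_sq_le_norm_sq L i
    _ = 3 * ‖L‖ ^ 2 := by simp

/-- One square is at most the sum of squares: `w₂² ≤ Σᵢ wᵢ²` (used for `(∂₃u)² ≤ Σᵢ (∂ᵢu)²`).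
[folklore] -/
theorem sq_le_sum_sq (w : Fin 3 → ℝ) (i : Fin 3) : w i ^ 2 ≤ ∑ j, w j ^ 2 :=
  Finset.single_le_sum (f := fun j => w j ^ 2) (fun _ _ => sq_nonneg _) (Finset.mem_univ i)

/-- The radial frame vector as `-ϱ⁻¹ J(J x)`. [folklore] -/
theorem eR_eq (x : ℝ³) : eR x = (cylRadius x)⁻¹ • (-rotGen (rotGen x)) := by
  rw [eR]
  congr 1
  ext i
  fin_cases i <;> simp [rotGen]

/-- `e_r` is continuous on the shell. [folklore] -/
theorem continuousOn_eR_shell : ContinuousOn eR 𝒞 := by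
  have h : eR = fun x => (cylRadius x)⁻¹ • (-rotGen (rotGen x)) := funext eR_eq
  rw [h]
  refine ContinuousOn.smul (continuous_cylRadius.continuousOn.inv₀ fun x hx =>
    (cylRadius_pos_of_mem_shell hx).ne') ?_
  exact ((rotGenL.continuous.comp rotGenL.continuous).neg).continuousOn

/-- The radial velocity of a field continuous on the shell is continuous there. [folklore] -/
theorem continuousOn_radialVelocity {v : ℝ³ → ℝ³} (hv : ContinuousOn v 𝒞) :
    ContinuousOn (fun x => radialVelocity v x) 𝒞 :=
  hv.inner continuousOn_eR_shell

end Pointwise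

/-! ## Pointwise bounds for the terms of (4.9) -/

section FixedTimeBounds

variable {ψ : ℝ → ℝ³ → ℝ} {K₀ : Set ℝ³} {η : ℝ³ → ℝ} {M Mη C : ℝ}

namespace CutoffData

variable (d : CutoffData ψ K₀ η M Mη C)

variable {V : ℝ → ℝ³ → ℝ³} {P : ℝ → ℝ³ → ℝ} (hV : IsSmoothAxisymmetricSolutionOn Q V P)
  (hχ : AngularVorticityEqOn Q V) {s : ℝ} (hs : s ∈ Ioo (-(2 : ℝ) ^ 2) 0)

/-- **Splitting of the time derivative of the density**:
`∂ₛ(u²) = 2 φ ∂ₛχ + 2 u (χ ϱ⁻¹ ∂ₛψ)`. [folklore] -/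
theorem dFun_eq (V : ℝ → ℝ³ → ℝ³) (s : ℝ) (x : ℝ³) :
    dFun ψ V s x = 2 * (phiFun ψ V s x * timeDeriv (fun t y => angularVorticity (V t) y) s x) +
      2 * (uFun ψ V s x * (angularVorticity (V s) x * (cylRadius x)⁻¹ * deriv (fun t => ψ t x) s)) := by
  simp only [dFun, phiFun, uFun, eta1]
  ring

include d in
/-- **The transport terms combine into `J₃`** pointwise: at a point of the shell,
`χ² η₁ Dη₁·V + φ V_ϱ χ/ϱ = χ² ψ (Dψ·V) ϱ⁻²` (`Dη₁·V = (Dψ·V)/ϱ - ψ V_ϱ/ϱ²`, the `V_ϱ` terms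
cancel: "`J₃ = χ(V_ϱψ_{,ϱ} + V₃ψ_{,3})`"). [cite: SereginZajaczkowski2007, proof of Lemma 4.2, (4.8) (the term J₃)] -/
theorem transport_pointwise {x : ℝ³} (hx : x ∈ 𝒞) :
    angularVorticity (V s) x ^ 2 * (eta1 ψ s x * fderiv ℝ (eta1 ψ s) x (V s x)) +
        phiFun ψ V s x * (radialVelocity (V s) x * angularVorticity (V s) x / cylRadius x) =
      angularVorticity (V s) x ^ 2 * (ψ s x * fderiv ℝ (ψ s) x (V s x)) * (cylRadius x)⁻¹ ^ 2 := by
  have hρ : cylRadius x ≠ 0 := (cylRadius_pos_of_mem_shell hx).ne'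
  have hdψ : DifferentiableAt ℝ (ψ s) x := (d.contDiff_slice s (n := 1)).differentiable one_ne_zero x
  have hdρ : DifferentiableAt ℝ (fun y => (cylRadius y)⁻¹) x :=
    (hasFDerivAt_inv_cylRadius_comp hρ).differentiableAt
  have e1 : fderiv ℝ (eta1 ψ s) x (V s x) =
      fderiv ℝ (ψ s) x (V s x) * (cylRadius x)⁻¹ +
        ψ s x * fderiv ℝ (fun y => (cylRadius y)⁻¹) x (V s x) :=
    fderiv_mul_apply_of_differentiableAt hdψ hdρ _
  have e2 : fderiv ℝ (fun y => (cylRadius y)⁻¹) x (V s x) =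
      -(cylRadius x ^ 2)⁻¹ * radialVelocity (V s) x := by
    rw [(hasFDerivAt_inv_cylRadius_comp hρ).fderiv, ContinuousLinearMap.comp_apply,
      ContinuousLinearMap.toSpanSingleton_apply, innerSL_apply_apply, radialVelocity,
      real_inner_comm, smul_eq_mul, mul_comm]
  simp only [phiFun, uFun, eta1, e1, e2]
  field_simp
  ring

include d in
/-- **Bound for the `J₃` term**: `χ²ψ(Dψ·V)ϱ⁻² ≤ 2M ((ηχ)² + u² (η‖V‖)²)`
("`∫ J₃ χ̃/ϱ² ≤ c (∫|χ|²)^{1/2} (∫ |V^a·∇_aψ|² |χ̃/ϱ|²)^{1/2}`", pointwise and with Young).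
[cite: SereginZajaczkowski2007, proof of Lemma 4.2, display before (4.12)] -/
theorem transport_bound {s : ℝ} (hs : s ∈ Icc (-(2 : ℝ) ^ 2) 0) (V : ℝ → ℝ³ → ℝ³) (x : ℝ³) :
    angularVorticity (V s) x ^ 2 * (ψ s x * fderiv ℝ (ψ s) x (V s x)) * (cylRadius x)⁻¹ ^ 2 ≤
      2 * M * ((η x * angularVorticity (V s) x) ^ 2 + uFun ψ V s x ^ 2 * (η x * ‖V s x‖) ^ 2) := by
  set χ := angularVorticity (V s) x with hχx
  by_cases hx : x ∈ K₀
  · have hρ0 : 0 < cylRadius x := cylRadius_pos_of_mem_shell (d.subset hx)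
    have hρ4 : (cylRadius x)⁻¹ ≤ 4 := by
      calc (cylRadius x)⁻¹ ≤ (1 / 4 : ℝ)⁻¹ := by
            gcongr; exact (cylRadius_gt_of_mem_shell (d.subset hx)).le
        _ = 4 := by norm_num
    have hη : η x = 1 := d.η_eq_one x hx
    have hψ0 : 0 ≤ ψ s x := d.nonneg s x
    have hD : fderiv ℝ (ψ s) x (V s x) ≤ M * ‖V s x‖ := by
      refine (le_abs_self _).trans ?_
      rw [← Real.norm_eq_abs]
      exact ((fderiv ℝ (ψ s) x).le_opNorm _).trans
        (mul_le_mul_of_nonneg_right (d.norm_fderiv_slice_le hs x) (norm_nonneg _))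
    have hu : |uFun ψ V s x| = ψ s x * (cylRadius x)⁻¹ * |χ| := by
      rw [uFun, eta1, abs_mul, abs_mul, abs_of_nonneg hψ0, abs_of_pos (inv_pos.2 hρ0)]
    have hab : 2 * |χ| * (|uFun ψ V s x| * ‖V s x‖) ≤ χ ^ 2 + uFun ψ V s x ^ 2 * ‖V s x‖ ^ 2 := by
      nlinarith [sq_nonneg (|χ| - |uFun ψ V s x| * ‖V s x‖), sq_abs χ, sq_abs (uFun ψ V s x)]
    rw [hη, one_mul, one_mul]
    calc χ ^ 2 * (ψ s x * fderiv ℝ (ψ s) x (V s x)) * (cylRadius x)⁻¹ ^ 2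
        ≤ χ ^ 2 * (ψ s x * (M * ‖V s x‖)) * (cylRadius x)⁻¹ ^ 2 := by
          gcongr
      _ = (ψ s x * (cylRadius x)⁻¹ * |χ|) * (cylRadius x)⁻¹ * (|χ| * M * ‖V s x‖) := by
          rw [← sq_abs χ]; ring
      _ = |uFun ψ V s x| * (cylRadius x)⁻¹ * (|χ| * M * ‖V s x‖) := by rw [hu]
      _ ≤ |uFun ψ V s x| * 4 * (|χ| * M * ‖V s x‖) := by
          gcongr
          exact mul_nonneg (mul_nonneg (abs_nonneg _) d.M_nonneg) (norm_nonneg _)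
      _ = 2 * M * (2 * |χ| * (|uFun ψ V s x| * ‖V s x‖)) := by ring
      _ ≤ 2 * M * (χ ^ 2 + uFun ψ V s x ^ 2 * ‖V s x‖ ^ 2) :=
          mul_le_mul_of_nonneg_left hab (by linarith [d.M_nonneg])
  · rw [d.zero s x hx]
    have hM := d.M_nonneg
    have : 0 ≤ 2 * M * ((η x * χ) ^ 2 + uFun ψ V s x ^ 2 * (η x * ‖V s x‖) ^ 2) := by positivity
    simpa using this

include d in
/-- **Bound for the cut-off remainder of the dissipation identity**:
`χ² Σᵢ (∂ᵢη₁)² ≤ 3 (4M + 16)² (ηχ)²`. [folklore] -/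
theorem remainder_bound {s : ℝ} (hs : s ∈ Icc (-(2 : ℝ) ^ 2) 0) (V : ℝ → ℝ³ → ℝ³) (x : ℝ³) :
    angularVorticity (V s) x ^ 2 * ∑ i, fderiv ℝ (eta1 ψ s) x (𝐞 i) ^ 2 ≤
      3 * (4 * M + 16) ^ 2 * (η x * angularVorticity (V s) x) ^ 2 := by
  by_cases hx : x ∈ K₀
  · rw [d.η_eq_one x hx, one_mul, mul_comm]
    refine mul_le_mul_of_nonneg_right ?_ (sq_nonneg _)
    calc ∑ i, fderiv ℝ (eta1 ψ s) x (𝐞 i) ^ 2 ≤ 3 * ‖fderiv ℝ (eta1 ψ s) x‖ ^ 2 :=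
          sum_apply_basisFun_sq_le _
      _ ≤ 3 * (4 * M + 16) ^ 2 := by
          gcongr
          exact d.norm_fderiv_eta1_le hs x
  · rw [d.fderiv_eta1_eq_zero s hx]
    simp only [_root_.zero_apply, ne_eq, OfNat.ofNat_ne_zero, not_false_eq_true,
      zero_pow, Finset.sum_const_zero, mul_zero]
    positivity

include d in
/-- **Bound for the `∂ₛψ` term**: `u (χ ϱ⁻¹ ∂ₛψ) ≤ 16 M (ηχ)²`
(part of "`∫ J₂ χ̃/ϱ² ≤ c ∫ |χ|²`"). [cite: SereginZajaczkowski2007, proof of Lemma 4.2, (4.11)] -/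
theorem timeCutoff_bound {s : ℝ} (hs : s ∈ Icc (-(2 : ℝ) ^ 2) 0) (V : ℝ → ℝ³ → ℝ³) (x : ℝ³) :
    uFun ψ V s x * (angularVorticity (V s) x * (cylRadius x)⁻¹ * deriv (fun t => ψ t x) s) ≤
      16 * M * (η x * angularVorticity (V s) x) ^ 2 := by
  by_cases hx : x ∈ K₀
  · have hρ0 : 0 < cylRadius x := cylRadius_pos_of_mem_shell (d.subset hx)
    have hρ4 : (cylRadius x)⁻¹ ≤ 4 := by
      calc (cylRadius x)⁻¹ ≤ (1 / 4 : ℝ)⁻¹ := by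
            gcongr; exact (cylRadius_gt_of_mem_shell (d.subset hx)).le
        _ = 4 := by norm_num
    have hM := d.M_nonneg
    rw [d.η_eq_one x hx, one_mul]
    refine (le_abs_self _).trans ?_
    have h1 : |uFun ψ V s x| ≤ 4 * |angularVorticity (V s) x| := by
      rw [uFun, eta1, abs_mul, abs_mul, abs_inv, abs_of_pos hρ0]
      calc |ψ s x| * (cylRadius x)⁻¹ * |angularVorticity (V s) x|
          ≤ 1 * 4 * |angularVorticity (V s) x| := by
            gcongr
            · exact d.abs_slice_le s x
        _ = 4 * |angularVorticity (V s) x| := by ring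
    have h2 : |angularVorticity (V s) x * (cylRadius x)⁻¹ * deriv (fun t => ψ t x) s| ≤
        |angularVorticity (V s) x| * 4 * M := by
      rw [abs_mul, abs_mul, abs_inv, abs_of_pos hρ0]
      gcongr
      · exact d.abs_deriv_time_le hs x
    rw [abs_mul]
    calc |uFun ψ V s x| * |angularVorticity (V s) x * (cylRadius x)⁻¹ * deriv (fun t => ψ t x) s|
        ≤ (4 * |angularVorticity (V s) x|) * (|angularVorticity (V s) x| * 4 * M) :=
          mul_le_mul h1 h2 (abs_nonneg _) (by positivity)
      _ = 16 * M * angularVorticity (V s) x ^ 2 := by rw [← sq_abs (angularVorticity _ _)]; ring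
  · rw [d.uFun_eq_zero V s hx, zero_mul]
    have := d.M_nonneg
    positivity

/-- **The zeroth-order term has a sign**: `φ χ/ϱ² = (η₁χ)²/ϱ² ≥ 0`. [folklore] -/
theorem zeroth_nonneg (V : ℝ → ℝ³ → ℝ³) (s : ℝ) (x : ℝ³) :
    0 ≤ phiFun ψ V s x * (angularVorticity (V s) x / cylRadius x ^ 2) := by
  have h : phiFun ψ V s x * (angularVorticity (V s) x / cylRadius x ^ 2) =
      (eta1 ψ s x * angularVorticity (V s) x) ^ 2 / cylRadius x ^ 2 := by
    simp only [phiFun, uFun]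
    ring
  rw [h]
  positivity

/-- `(ηχ)² ≤ ‖curl‖²-constant times `|∇V|²`: `(η ω_φ)² ≤ ‖curlCLM‖² |DV|²_F`. [folklore] -/
theorem eta_mul_sq_le (hη1 : ∀ x, |η x| ≤ 1) (v : ℝ³ → ℝ³) (x : ℝ³) :
    (η x * angularVorticity v x) ^ 2 ≤ ‖curlCLM‖ ^ 2 * frobeniusNormSq (fderiv ℝ v x) := by
  have h1 : |angularVorticity v x| ≤ ‖curl v x‖ := abs_angularVorticity_le_norm_curl v x
  have h2 := norm_curl_sq_le_frobeniusNormSq v x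
  calc (η x * angularVorticity v x) ^ 2 = |η x| ^ 2 * |angularVorticity v x| ^ 2 := by
        rw [mul_pow, sq_abs, sq_abs]
    _ ≤ 1 ^ 2 * ‖curl v x‖ ^ 2 := by
        gcongr
        · exact hη1 x
    _ ≤ ‖curlCLM‖ ^ 2 * frobeniusNormSq (fderiv ℝ v x) := by rw [one_pow, one_mul]; exact h2

include d in
/-- On `K₀` the second component function is the swirl velocity: `(η/ϱ)⟪V, Jx⟫ = V_φ`. [folklore] -/
theorem compFun_two_eq {x : ℝ³} (hx : x ∈ K₀) :
    η x * (cylRadius x)⁻¹ * ⟪V s x, rotGenL x + 0⟫ = swirlVelocity (V s) x := by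
  have hρ : cylRadius x ≠ 0 := (cylRadius_pos_of_mem_shell (d.subset hx)).ne'
  rw [add_zero, rotGenL_apply, ← cylRadius_mul_swirlVelocity hρ, d.η_eq_one x hx]
  field_simp

include d hχ hs in
/-- **Bound for the source term after integration by parts**:
`|∂₃(φ/ϱ) V_φ²| ≤ f₂² (M₃ |u| + 16 |∂₃u|)`, `M₃ = 16M + 128`, `f₂ = (η/ϱ)⟪V, Jx⟫`
("`≤ c (∫ |V_φ|⁴/ϱ⁴)^{1/2} (∫ |(χ̃/ϱ)_{,3}|² + ∫ |χ̃/ϱ|²)^{1/2}`", pointwise).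
[cite: SereginZajaczkowski2007, proof of Lemma 4.2, display before (4.10)] -/
theorem source_bound (x : ℝ³) :
    |fderiv ℝ (fun y => phiFun ψ V s y * (cylRadius y)⁻¹) x eZ * swirlVelocity (V s) x ^ 2| ≤
      (η x * (cylRadius x)⁻¹ * ⟪V s x, rotGenL x + 0⟫) ^ 2 *
        ((16 * M + 128) * |uFun ψ V s x| + 16 * |fderiv ℝ (uFun ψ V s) x eZ|) := by
  have hs' : s ∈ Icc (-(2 : ℝ) ^ 2) 0 := Ioo_subset_Icc_self hs
  by_cases hx : x ∈ K₀
  · have hx𝒞 : x ∈ 𝒞 := d.subset hx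
    have hρ0 : 0 < cylRadius x := cylRadius_pos_of_mem_shell hx𝒞
    have hρ4 : (cylRadius x)⁻¹ ≤ 4 := by
      calc (cylRadius x)⁻¹ ≤ (1 / 4 : ℝ)⁻¹ := by
            gcongr; exact (cylRadius_gt_of_mem_shell hx𝒞).le
        _ = 4 := by norm_num
    -- `φ/ϱ = η₃ u`, `η₃ = η₁/ϱ`
    set η₃ : ℝ³ → ℝ := fun y => eta1 ψ s y * (cylRadius y)⁻¹ with hη₃
    have hfun : (fun y => phiFun ψ V s y * (cylRadius y)⁻¹) = fun y => η₃ y * uFun ψ V s y := by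
      funext y; simp only [hη₃, phiFun]; ring
    have hdη1 : DifferentiableAt ℝ (eta1 ψ s) x :=
      (d.contDiff_eta1 s (n := 1)).differentiable one_ne_zero x
    have hdρ : DifferentiableAt ℝ (fun y => (cylRadius y)⁻¹) x :=
      (hasFDerivAt_inv_cylRadius_comp hρ0.ne').differentiableAt
    have hdη₃ : DifferentiableAt ℝ η₃ x := hdη1.mul hdρ
    have hdu : DifferentiableAt ℝ (uFun ψ V s) x :=
      (d.contDiff_uFun hχ hs).differentiable one_ne_zero x
    have hη₃b : |η₃ x| ≤ 16 := by
      rw [hη₃]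
      dsimp only
      rw [abs_mul, abs_inv, abs_of_pos hρ0]
      calc |eta1 ψ s x| * (cylRadius x)⁻¹ ≤ 4 * 4 := by
            gcongr; exact d.abs_eta1_le s x
        _ = 16 := by norm_num
    have hDη₃ : ‖fderiv ℝ η₃ x‖ ≤ 16 * M + 128 := by
      refine (norm_fderiv_mul_le hdη1 hdρ).trans ?_
      rw [abs_inv, abs_of_pos hρ0]
      have h1 : ‖fderiv ℝ (eta1 ψ s) x‖ * (cylRadius x)⁻¹ ≤ (4 * M + 16) * 4 := by
        gcongr
        · linarith [d.M_nonneg]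
        · exact d.norm_fderiv_eta1_le hs' x
      have h2 : |eta1 ψ s x| * ‖fderiv ℝ (fun y => (cylRadius y)⁻¹) x‖ ≤ 4 * 16 := by
        refine mul_le_mul (d.abs_eta1_le s x) ?_ (norm_nonneg _) (by norm_num)
        calc ‖fderiv ℝ (fun y => (cylRadius y)⁻¹) x‖ ≤ (cylRadius x ^ 2)⁻¹ :=
              norm_fderiv_inv_cylRadius_le hρ0.ne'
          _ ≤ ((1 / 4 : ℝ) ^ 2)⁻¹ := by
              gcongr; exact (cylRadius_gt_of_mem_shell hx𝒞).le
          _ = 16 := by norm_num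
      linarith
    have hD3 : |fderiv ℝ η₃ x eZ| ≤ 16 * M + 128 := by
      rw [← Real.norm_eq_abs]
      refine ((fderiv ℝ η₃ x).le_opNorm eZ).trans ?_
      have : ‖(eZ : ℝ³)‖ = 1 := by
        rw [eZ, ← EuclideanSpace.basisFun_apply]; exact norm_basisFun_eq_one 2
      rw [this, mul_one]
      exact hDη₃
    rw [hfun, fderiv_mul_apply_of_differentiableAt hdη₃ hdu, ← d.compFun_two_eq hx, abs_mul,
      abs_of_nonneg (sq_nonneg (η x * (cylRadius x)⁻¹ * ⟪V s x, rotGenL x + 0⟫)), mul_comm]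
    refine mul_le_mul_of_nonneg_left ?_ (sq_nonneg _)
    calc |fderiv ℝ η₃ x eZ * uFun ψ V s x + η₃ x * fderiv ℝ (uFun ψ V s) x eZ|
        ≤ |fderiv ℝ η₃ x eZ| * |uFun ψ V s x| + |η₃ x| * |fderiv ℝ (uFun ψ V s) x eZ| := by
          rw [← abs_mul, ← abs_mul]; exact abs_add_le _ _
      _ ≤ (16 * M + 128) * |uFun ψ V s x| + 16 * |fderiv ℝ (uFun ψ V s) x eZ| := by
          gcongr
  · rw [fderiv_cutoff_mul_of_notMem (θ := phiFun ψ V s) fun h => hx (d.tsupport_phiFun V s h)]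
    simp only [_root_.zero_apply, zero_mul, abs_zero]
    have := d.M_nonneg
    positivity

end CutoffData

end FixedTimeBounds

/-! ## The arithmetic of (4.13) -/

section Arithmetic

/-- The constant of the fixed-time energy inequality in terms of the cut-off bound `M`, the
Ladyzhenskaya constant `C`, the component constant `Λ` and the curl constant `c_ω`
(a polynomial; any larger constant would do). [folklore] -/
def lemma42EnergyConst' (M C Λ cω : ℝ) : ℝ :=
  (36 * M + 6 * (4 * M + 16) ^ 2) * cω + (72 * M ^ 2 * C ^ 2 + 22 * M * C + 640 * C) * Λ +
    16 * M + 129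

/-- **The bookkeeping of (4.9)–(4.13)** ("Combining estimates (4.9)–(4.12) and applying Young's
inequality, we arrive at the final inequality (4.13)"): the real-arithmetic step turning the
identity `E = 2(T + P₃ - P₄ + P₅) + 2 I₂` for `E = ∂ₛ ∫ u²` and the bounds of the individual
terms (transport `T`, dissipation `P₃ = -D + R₃`, sign term `P₄ ≥ 0`, source `P₅`, cut-off
term `I₂`, Ladyzhenskaya bounds `U₄ ≤ C y D`, `Fⱼ ≤ C Λ A (A + G)`, `X ≤ c_ω G`, `A ≤ K`) into
`E ≤ c (1 + K)² (1 + G) (1 + y)`; the dissipation `D` absorbs the `U₄` and `∂₃u` contributions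
(choice `ε = (12 M C (1 + y) + 1)⁻¹`). [cite: SereginZajaczkowski2007, proof of Lemma 4.2, (4.13)] -/
theorem energy_arith {M C Λ cω K y Dint X A G T W U4 F1 F2 F3 R3 P3 P4 P5 I2 D3 E Pt : ℝ}
    (hM : 0 ≤ M) (hC : 0 ≤ C) (hΛ : 0 ≤ Λ) (hcω : 0 ≤ cω) (hK : 0 ≤ K) (hy : 0 ≤ y)
    (hD : 0 ≤ Dint) (hA0 : 0 ≤ A) (hG0 : 0 ≤ G)
    (hE : E = 2 * Pt + 2 * I2) (hPt : Pt = T + P3 - P4 + P5)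
    (hT : T ≤ 2 * M * X + 2 * M * W)
    (hW : ∀ ε : ℝ, 0 < ε → W ≤ 2⁻¹ * (3 * ε * U4 + ε⁻¹ * (F1 + F2 + F3)))
    (hP3 : P3 = -Dint + R3) (hR3 : R3 ≤ 3 * (4 * M + 16) ^ 2 * X) (hP4 : 0 ≤ P4)
    (hP5 : P5 ≤ ((16 * M + 128) / 2 + 256) * F2 + (16 * M + 128) / 2 * y + D3 / 4)
    (hD3 : D3 ≤ Dint) (hI2 : I2 ≤ 16 * M * X) (hU4 : U4 ≤ C * y * Dint)
    (hF1 : F1 ≤ C * Λ * (A * (A + G))) (hF2 : F2 ≤ C * Λ * (A * (A + G)))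
    (hF3 : F3 ≤ C * Λ * (A * (A + G))) (hXG : X ≤ cω * G) (hAK : A ≤ K) :
    E ≤ lemma42EnergyConst' M C Λ cω * (1 + K) ^ 2 * (1 + G) * (1 + y) := by
  -- the auxiliary quantity `Qa = (1 + K)² (1 + G)`
  set Qa : ℝ := (1 + K) ^ 2 * (1 + G) with hQ
  have hQ0 : 0 ≤ Qa := by positivity
  have hKG : 0 ≤ K * G := mul_nonneg hK hG0
  have hK2G : 0 ≤ K ^ 2 * G := mul_nonneg (sq_nonneg K) hG0
  have hQ1 : 1 ≤ Qa := by
    have h2 : Qa - 1 = 2 * K + K ^ 2 + G + 2 * (K * G) + K ^ 2 * G := by rw [hQ]; ring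
    rw [← sub_nonneg, h2]
    positivity
  have hWa : A * (A + G) ≤ Qa := by
    have h1 : A * (A + G) ≤ K * (K + G) := mul_le_mul hAK (by linarith) (by positivity) hK
    have h2 : Qa - A * (A + G) = 1 + 2 * K + G + K * G + K ^ 2 * G + (K * (K + G) - A * (A + G)) := by
      rw [hQ]; ring
    have s := sub_nonneg.2 h1
    rw [← sub_nonneg, h2]
    positivity
  have hGQ : G ≤ Qa := by
    have h2 : Qa - G = 1 + 2 * K + K ^ 2 + 2 * (K * G) + K ^ 2 * G := by rw [hQ]; ring
    rw [← sub_nonneg, h2]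
    positivity
  have hCΛ : 0 ≤ C * Λ := mul_nonneg hC hΛ
  have hWa' : C * Λ * (A * (A + G)) ≤ C * Λ * Qa := mul_le_mul_of_nonneg_left hWa hCΛ
  have hF1Q : F1 ≤ C * Λ * Qa := hF1.trans hWa'
  have hF2Q : F2 ≤ C * Λ * Qa := hF2.trans hWa'
  have hF3Q : F3 ≤ C * Λ * Qa := hF3.trans hWa'
  -- the choice of `ε`
  set ε : ℝ := (12 * M * C * (1 + y) + 1)⁻¹ with hε
  have hden : 0 < 12 * M * C * (1 + y) + 1 := by positivity
  have hε0 : 0 < ε := inv_pos.2 hden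
  have hεinv : ε⁻¹ = 12 * M * C * (1 + y) + 1 := by rw [hε, inv_inv]
  have hW' := hW ε hε0
  rw [hεinv] at hW'
  -- (i) the `U4` part is absorbed by the dissipation: `M (3 ε U4) ≤ Dint/4`
  have hcoef : 3 * M * C * y * ε ≤ 1 / 4 := by
    rw [hε, ← div_eq_mul_inv, div_le_iff₀ hden]
    have hMC : 0 ≤ M * C := mul_nonneg hM hC
    linarith
  have h1 : M * (3 * ε * U4) ≤ Dint / 4 := by
    calc M * (3 * ε * U4) ≤ M * (3 * ε * (C * y * Dint)) := by gcongr
      _ = (3 * M * C * y * ε) * Dint := by ring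
      _ ≤ (1 / 4) * Dint := mul_le_mul_of_nonneg_right hcoef hD
      _ = Dint / 4 := by ring
  -- (ii) `2 M W ≤ Dint/4 + M (12MC(1+y) + 1) (3 C Λ Qa)`
  have hMW : 2 * M * W ≤ Dint / 4 + (36 * M ^ 2 * C ^ 2 * (1 + y) + 3 * M * C) * (Λ * Qa) := by
    have hsum : F1 + F2 + F3 ≤ 3 * (C * Λ * Qa) := by linarith
    have h2 : M * ((12 * M * C * (1 + y) + 1) * (F1 + F2 + F3)) ≤
        M * ((12 * M * C * (1 + y) + 1) * (3 * (C * Λ * Qa))) := by gcongr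
    have h3 := mul_le_mul_of_nonneg_left hW' (by positivity : (0 : ℝ) ≤ 2 * M)
    have key : Dint / 4 + (36 * M ^ 2 * C ^ 2 * (1 + y) + 3 * M * C) * (Λ * Qa) - 2 * M * W =
        (Dint / 4 - M * (3 * ε * U4)) +
        (M * ((12 * M * C * (1 + y) + 1) * (3 * (C * Λ * Qa))) -
          M * ((12 * M * C * (1 + y) + 1) * (F1 + F2 + F3))) +
        (2 * M * (2⁻¹ * (3 * ε * U4 + (12 * M * C * (1 + y) + 1) * (F1 + F2 + F3))) -
          2 * M * W) := by ring
    have s1 := sub_nonneg.2 h1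
    have s2 := sub_nonneg.2 h2
    have s3 := sub_nonneg.2 h3
    rw [← sub_nonneg, key]
    positivity
  -- (iii) the source term
  have hP5' : P5 ≤ (8 * M * C + 320 * C) * (Λ * Qa) + (16 * M + 128) / 2 * y + Dint / 4 := by
    have h2 : ((16 * M + 128) / 2 + 256) * F2 ≤ ((16 * M + 128) / 2 + 256) * (C * Λ * Qa) :=
      mul_le_mul_of_nonneg_left hF2Q (by positivity)
    have key : (8 * M * C + 320 * C) * (Λ * Qa) + (16 * M + 128) / 2 * y + Dint / 4 - P5 =
        (((16 * M + 128) / 2 + 256) * F2 + (16 * M + 128) / 2 * y + D3 / 4 - P5) +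
        (((16 * M + 128) / 2 + 256) * (C * Λ * Qa) - ((16 * M + 128) / 2 + 256) * F2) +
        (Dint - D3) / 4 := by ring
    have s1 := sub_nonneg.2 hP5
    have s2 := sub_nonneg.2 h2
    have s3 := sub_nonneg.2 hD3
    rw [← sub_nonneg, key]
    positivity
  -- (iv) the `X` terms in terms of `G`
  have hMX : M * X ≤ M * (cω * G) := mul_le_mul_of_nonneg_left hXG hM
  have hsqX : (4 * M + 16) ^ 2 * X ≤ (4 * M + 16) ^ 2 * (cω * G) :=
    mul_le_mul_of_nonneg_left hXG (sq_nonneg _)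
  -- (v) `E` in terms of `G`, `Qa`, `y`
  have hE1 : E ≤ (36 * M + 6 * (4 * M + 16) ^ 2) * (cω * G) +
      (72 * M ^ 2 * C ^ 2 * (1 + y) + 6 * M * C + 16 * M * C + 640 * C) * (Λ * Qa) +
      (16 * M + 128) * y := by
    have key : (36 * M + 6 * (4 * M + 16) ^ 2) * (cω * G) +
        (72 * M ^ 2 * C ^ 2 * (1 + y) + 6 * M * C + 16 * M * C + 640 * C) * (Λ * Qa) +
        (16 * M + 128) * y - E =
        Dint + 2 * P4 + 2 * (2 * M * X + 2 * M * W - T) +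
          2 * (Dint / 4 + (36 * M ^ 2 * C ^ 2 * (1 + y) + 3 * M * C) * (Λ * Qa) - 2 * M * W) +
          2 * (3 * (4 * M + 16) ^ 2 * X - R3) +
          2 * ((8 * M * C + 320 * C) * (Λ * Qa) + (16 * M + 128) / 2 * y + Dint / 4 - P5) +
          2 * (16 * M * X - I2) + 36 * (M * (cω * G) - M * X) +
          6 * ((4 * M + 16) ^ 2 * (cω * G) - (4 * M + 16) ^ 2 * X) := by
      rw [hE, hPt, hP3]; ring
    have s1 := sub_nonneg.2 hT
    have s2 := sub_nonneg.2 hMW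
    have s3 := sub_nonneg.2 hR3
    have s4 := sub_nonneg.2 hP5'
    have s5 := sub_nonneg.2 hI2
    have s6 := sub_nonneg.2 hMX
    have s7 := sub_nonneg.2 hsqX
    rw [← sub_nonneg, key]
    positivity
  -- (vi) every term is dominated by `Qa (1 + y)`
  have hGQy : G ≤ Qa * (1 + y) := hGQ.trans (le_mul_of_one_le_right hQ0 (by linarith))
  have hyQy : y ≤ Qa * (1 + y) := by
    have h : 1 * y ≤ Qa * y := mul_le_mul_of_nonneg_right hQ1 hy
    have key : Qa * (1 + y) - y = Qa + (Qa * y - 1 * y) := by ring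
    have s := sub_nonneg.2 h
    rw [← sub_nonneg, key]
    positivity
  have key : lemma42EnergyConst' M C Λ cω * (1 + K) ^ 2 * (1 + G) * (1 + y) -
      ((36 * M + 6 * (4 * M + 16) ^ 2) * (cω * G) +
        (72 * M ^ 2 * C ^ 2 * (1 + y) + 6 * M * C + 16 * M * C + 640 * C) * (Λ * Qa) +
        (16 * M + 128) * y) =
      (36 * M + 6 * (4 * M + 16) ^ 2) * cω * (Qa * (1 + y) - G) +
        (22 * M * C + 640 * C) * Λ * (Qa * y) + (16 * M + 128) * (Qa * (1 + y) - y) +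
        Qa * (1 + y) := by
    rw [lemma42EnergyConst', hQ]; ring
  have s1 := sub_nonneg.2 hGQy
  have s2 := sub_nonneg.2 hyQy
  have hfin : (36 * M + 6 * (4 * M + 16) ^ 2) * (cω * G) +
      (72 * M ^ 2 * C ^ 2 * (1 + y) + 6 * M * C + 16 * M * C + 640 * C) * (Λ * Qa) +
      (16 * M + 128) * y ≤ lemma42EnergyConst' M C Λ cω * (1 + K) ^ 2 * (1 + G) * (1 + y) := by
    rw [← sub_nonneg, key]
    positivity
  exact hE1.trans hfin

end Arithmetic

/-! ## The energy inequality (4.13) at a fixed time -/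

section FixedTimeEnergy

/-- **The constant of (4.13)** for cut-off data with bounds `M` (for `Dψ`), `M_η` (for `Dη`) and
Ladyzhenskaya constant `C`: `lemma42EnergyConst' M C Λ c_ω` with the component constant
`Λ = 288 (12 M_η + 56)²` and the curl constant `c_ω = ‖curlCLM‖²`. [folklore] -/
def lemma42EnergyConst (M Mη C : ℝ) : ℝ :=
  lemma42EnergyConst' M C (288 * (12 * Mη + 56) ^ 2) (‖curlCLM‖ ^ 2)

/-- `1 ≤ lemma42EnergyConst` for nonnegative parameters. [folklore] -/
theorem one_le_lemma42EnergyConst {M Mη C : ℝ} (hM : 0 ≤ M) (hC : 0 ≤ C) :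
    1 ≤ lemma42EnergyConst M Mη C := by
  rw [lemma42EnergyConst, lemma42EnergyConst']
  have h1 : 0 ≤ (36 * M + 6 * (4 * M + 16) ^ 2) * ‖curlCLM‖ ^ 2 := by positivity
  have h2 : 0 ≤ (72 * M ^ 2 * C ^ 2 + 22 * M * C + 640 * C) * (288 * (12 * Mη + 56) ^ 2) := by
    positivity
  linarith

/-- **Simplification of the Ladyzhenskaya bound of a component function**:
`C (B₀l)² A (2(B₁l + B₀‖L‖)² A + 2(B₀l)² G) ≤ C Λ A (A + G)` once `Λ` dominates the two
products of constants. [folklore] -/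
theorem compFun_bound_le {C B₀ B₁ l nL A G Λ : ℝ} (hC : 0 ≤ C) (hA : 0 ≤ A) (hG : 0 ≤ G)
    (h1 : (B₀ * l) ^ 2 * (2 * (B₁ * l + B₀ * nL) ^ 2) ≤ Λ)
    (h2 : (B₀ * l) ^ 2 * (2 * (B₀ * l) ^ 2) ≤ Λ) :
    C * ((B₀ * l) ^ 2 * A) * (2 * (B₁ * l + B₀ * nL) ^ 2 * A + 2 * (B₀ * l) ^ 2 * G) ≤
      C * Λ * (A * (A + G)) := by
  have key : C * Λ * (A * (A + G)) -
      C * ((B₀ * l) ^ 2 * A) * (2 * (B₁ * l + B₀ * nL) ^ 2 * A + 2 * (B₀ * l) ^ 2 * G) =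
      C * A * ((Λ - (B₀ * l) ^ 2 * (2 * (B₁ * l + B₀ * nL) ^ 2)) * A +
        (Λ - (B₀ * l) ^ 2 * (2 * (B₀ * l) ^ 2)) * G) := by ring
  have s1 := sub_nonneg.2 h1
  have s2 := sub_nonneg.2 h2
  rw [← sub_nonneg, key]
  positivity

/-- **Young's inequality for the source term**: from `|h| ≤ f² (M₃ |u| + 16 |d|)` to
`|h| ≤ (M₃/2)(f⁴ + u²) + 256 f⁴ + d²/4`. [folklore] -/
theorem source_young {M₃ f u d₃ h : ℝ} (hM : 0 ≤ M₃) (hh : |h| ≤ f ^ 2 * (M₃ * |u| + 16 * |d₃|)) :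
    |h| ≤ M₃ / 2 * (f ^ 4 + u ^ 2) + 256 * f ^ 4 + 4⁻¹ * d₃ ^ 2 := by
  have ha : 2 * f ^ 2 * |u| ≤ f ^ 4 + u ^ 2 := by
    have e : f ^ 4 + u ^ 2 - 2 * f ^ 2 * |u| = (f ^ 2 - |u|) ^ 2 := by
      rw [← sq_abs u]; ring
    rw [← sub_nonneg, e]
    positivity
  have hb : 2 * f ^ 2 * |d₃| ≤ 32 * (f ^ 2) ^ 2 + 32⁻¹ * d₃ ^ 2 := by
    have e : 32 * (f ^ 2) ^ 2 + 32⁻¹ * d₃ ^ 2 - 2 * f ^ 2 * |d₃| = (32 * f ^ 2 - |d₃|) ^ 2 / 32 := by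
      rw [← sq_abs d₃]; ring
    rw [← sub_nonneg, e]
    positivity
  calc |h| ≤ f ^ 2 * (M₃ * |u| + 16 * |d₃|) := hh
    _ = M₃ / 2 * (2 * f ^ 2 * |u|) + 8 * (2 * f ^ 2 * |d₃|) := by ring
    _ ≤ M₃ / 2 * (f ^ 4 + u ^ 2) + 8 * (32 * (f ^ 2) ^ 2 + 32⁻¹ * d₃ ^ 2) :=
        add_le_add (mul_le_mul_of_nonneg_left ha (by positivity))
          (mul_le_mul_of_nonneg_left hb (by norm_num))
    _ = M₃ / 2 * (f ^ 4 + u ^ 2) + 256 * f ^ 4 + 4⁻¹ * d₃ ^ 2 := by ring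

variable {ψ : ℝ → ℝ³ → ℝ} {K₀ : Set ℝ³} {η : ℝ³ → ℝ} {M Mη C : ℝ}

namespace CutoffData

variable (d : CutoffData ψ K₀ η M Mη C)

variable {V : ℝ → ℝ³ → ℝ³} {P : ℝ → ℝ³ → ℝ} (hV : IsSmoothAxisymmetricSolutionOn Q V P)
  (hχ : AngularVorticityEqOn Q V) {s : ℝ} (hs : s ∈ Ioo (-(2 : ℝ) ^ 2) 0)

include d in
/-- The component constant dominates the constants of the first two components. [folklore] -/
theorem Λ_bound_one_two {nL : ℝ} (hnL0 : 0 ≤ nL) (hnL : nL ≤ 1) :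
    (4 * 3 : ℝ) ^ 2 * (2 * ((4 * Mη + 16) * 3 + 4 * nL) ^ 2) ≤ 288 * (12 * Mη + 56) ^ 2 ∧
      (4 * 3 : ℝ) ^ 2 * (2 * (4 * 3 : ℝ) ^ 2) ≤ 288 * (12 * Mη + 56) ^ 2 := by
  have hMη := d.Mη_nonneg
  have hb : (4 * Mη + 16) * 3 + 4 * nL ≤ 12 * Mη + 56 := by linarith
  have hb0 : 0 ≤ (4 * Mη + 16) * 3 + 4 * nL := by positivity
  have h1 : ((4 * Mη + 16) * 3 + 4 * nL) ^ 2 ≤ (12 * Mη + 56) ^ 2 := pow_le_pow_left₀ hb0 hb 2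
  have h2 : (56 : ℝ) ^ 2 ≤ (12 * Mη + 56) ^ 2 := pow_le_pow_left₀ (by norm_num) (by linarith) 2
  constructor
  · nlinarith
  · nlinarith

include d in
/-- The component constant dominates the constants of the third component. [folklore] -/
theorem Λ_bound_three :
    (1 * 1 : ℝ) ^ 2 * (2 * (Mη * 1 + 1 * 0) ^ 2) ≤ 288 * (12 * Mη + 56) ^ 2 ∧
      (1 * 1 : ℝ) ^ 2 * (2 * (1 * 1 : ℝ) ^ 2) ≤ 288 * (12 * Mη + 56) ^ 2 := by
  have hMη := d.Mη_nonneg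
  have h2 : (56 : ℝ) ^ 2 ≤ (12 * Mη + 56) ^ 2 := pow_le_pow_left₀ (by norm_num) (by linarith) 2
  have h3 : Mη ^ 2 ≤ (12 * Mη + 56) ^ 2 := pow_le_pow_left₀ hMη (by linarith) 2
  constructor
  · nlinarith
  · nlinarith

include d hV hχ hs in
/-- **Seregin–Zajaczkowski's final inequality (4.13) at a fixed time** `s ∈ ]-2², 0[` with
`∫_𝒞̃ |∇V(·, s)|² < ∞`: for the energy density `u² = |χ̃/ϱ|²`,
`∫ ∂ₛ(u²) dx ≤ c (1 + K)² (1 + ∫_𝒞̃ |∇V|² dx)(1 + ∫ u² dx)`, `K ≥ 𝒜₂`, `c = lemma42EnergyConst`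
(the energy identity (4.9): transport, dissipation, zeroth-order and source terms by the three
integrations by parts above; the estimates (4.10)–(4.12) by Ladyzhenskaya's inequality for
`χ̃/ϱ` and for the components of `ηV`; Young's inequality and the absorption of the
dissipation, `energy_arith`). [cite: SereginZajaczkowski2007, proof of Lemma 4.2, (4.9)–(4.13)] -/
theorem integral_dFun_le {K : ℝ≥0} (hK : szEnergy V P (fun t x => fderiv ℝ (V t) x) ≤ K)
    (hG : shellGradEnergy V s ≠ ⊤) :
    ∫ x, dFun ψ V s x ≤ lemma42EnergyConst M Mη C * (1 + K) ^ 2 *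
      (1 + (shellGradEnergy V s).toReal) * (1 + ∫ x, uFun ψ V s x ^ 2) := by
  have hs' : s ∈ Icc (-(2 : ℝ) ^ 2) 0 := Ioo_subset_Icc_self hs
  -- abbreviations
  set χf : ℝ³ → ℝ := fun y => angularVorticity (V s) y with hχf
  set u : ℝ³ → ℝ := uFun ψ V s with hu
  set φ : ℝ³ → ℝ := phiFun ψ V s with hφ
  -- regularity on the shell
  have hρne : ∀ x ∈ 𝒞, cylRadius x ≠ 0 := fun x hx => (cylRadius_pos_of_mem_shell hx).ne'
  have hχc : ContinuousOn χf 𝒞 := hχ.continuousOn_slice hs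
  have hVc : ContinuousOn (V s) 𝒞 := hV.continuousOn_slice hs
  have hVC : ∀ x ∈ 𝒞, ContDiffAt ℝ 1 (V s) x := fun x hx => hV.contDiffAt_slice hs hx
  have hVa : ∀ θ' : ℝ, ∀ x ∈ 𝒞, V s (rotZ θ' x) = rotZ θ' (V s x) := fun θ' x hx =>
    hV.rotZ_slice hs θ' hx
  have hρc : ContinuousOn (fun x : ℝ³ => (cylRadius x)⁻¹) 𝒞 :=
    continuous_cylRadius.continuousOn.inv₀ hρne
  have huC : ContDiff ℝ 1 u := d.contDiff_uFun hχ hs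
  have huc : Continuous u := huC.continuous
  have hucs : HasCompactSupport u := d.hasCompactSupport_uFun V s
  have hηc : Continuous η := d.η_contDiff.continuous
  have hη1 : ContDiff ℝ 1 η := d.η_contDiff.of_le (by simp)
  have hswC : ∀ x ∈ 𝒞, ContDiffAt ℝ 1 (fun y => swirlVelocity (V s) y) x := fun x hx =>
    contDiffAt_swirlVelocity (hVC x hx) (hρne x hx)
  -- the slice energies `A ≤ K` and `G < ∞`
  obtain ⟨hAi, hAK⟩ := hV.integrableOn_norm_sq_slice hs hK
  obtain ⟨hGi, hGeq⟩ := hV.integrableOn_frobeniusNormSq_slice hs hG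
  set A : ℝ := ∫ x in 𝒞, ‖V s x‖ ^ 2 with hA
  set G : ℝ := ∫ x in 𝒞, frobeniusNormSq (fderiv ℝ (V s) x) with hGdef
  have hA0 : 0 ≤ A := setIntegral_nonneg (isOpen_shell _ _ _).measurableSet fun x _ => sq_nonneg _
  have hG0 : 0 ≤ G :=
    setIntegral_nonneg (isOpen_shell _ _ _).measurableSet fun x _ => frobeniusNormSq_nonneg _
  -- the three component functions and their `L⁴` bounds
  set θ₁ : ℝ³ → ℝ := fun x => η x * (cylRadius x)⁻¹ with hθ₁
  set f₁ : ℝ³ → ℝ := fun x => θ₁ x * ⟪V s x, (rotGenL.comp rotGenL) x + 0⟫ with hf₁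
  set f₂ : ℝ³ → ℝ := fun x => θ₁ x * ⟪V s x, rotGenL x + 0⟫ with hf₂
  set f₃ : ℝ³ → ℝ := fun x => η x * ⟪V s x, (0 : ℝ³ →L[ℝ] ℝ³) x + eZ⟫ with hf₃
  set Λ : ℝ := 288 * (12 * Mη + 56) ^ 2 with hΛ
  have hΛ0 : 0 ≤ Λ := by positivity
  have hC0 : 0 ≤ C := d.ladyzhenskaya.nonneg
  have hF1 : ∫ x, f₁ x ^ 4 ≤ C * Λ * (A * (A + G)) := by
    have h := integral_compFun_pow_four_le (L := rotGenL.comp rotGenL) (c := 0) d.ladyzhenskaya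
      d.contDiff_η_div d.hasCompactSupport_η_div d.tsupport_η_div d.isAxisymmetricScalar_η_div
      hVC hVa rotGenL_comp_rotGenL_rotZ rotZ_zero_vec d.abs_η_div_le d.norm_fderiv_η_div_le
      (fun x hx => norm_rotGenL_comp_apply_le hx) hAi hGi
    obtain ⟨h1, h2⟩ := d.Λ_bound_one_two (norm_nonneg (rotGenL.comp rotGenL)) norm_rotGenL_comp_le
    exact h.trans (compFun_bound_le hC0 hA0 hG0 h1 h2)
  have hF2 : ∫ x, f₂ x ^ 4 ≤ C * Λ * (A * (A + G)) := by
    have h := integral_compFun_pow_four_le (L := rotGenL) (c := 0) d.ladyzhenskaya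
      d.contDiff_η_div d.hasCompactSupport_η_div d.tsupport_η_div d.isAxisymmetricScalar_η_div
      hVC hVa rotGenL_rotZ rotZ_zero_vec d.abs_η_div_le d.norm_fderiv_η_div_le
      (fun x hx => norm_rotGenL_apply_le hx) hAi hGi
    obtain ⟨h1, h2⟩ := d.Λ_bound_one_two (norm_nonneg rotGenL) norm_rotGenL_le
    exact h.trans (compFun_bound_le hC0 hA0 hG0 h1 h2)
  have hF3 : ∫ x, f₃ x ^ 4 ≤ C * Λ * (A * (A + G)) := by
    have h := integral_compFun_pow_four_le (L := (0 : ℝ³ →L[ℝ] ℝ³)) (c := eZ) d.ladyzhenskaya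
      hη1 d.η_hasCompactSupport d.η_tsupport d.η_axisym
      hVC hVa zero_clm_rotZ rotZ_eZ d.abs_η_le d.η_norm_fderiv_le
      (fun x _ => norm_zero_apply_add_eZ_le x) hAi hGi
    rw [norm_zero] at h
    obtain ⟨h1, h2⟩ := d.Λ_bound_three
    exact h.trans (compFun_bound_le hC0 hA0 hG0 h1 h2)
  -- the energy `y`, the dissipation `Dint` and Ladyzhenskaya for `u`
  set y : ℝ := ∫ x, u x ^ 2 with hy
  set Dint : ℝ := ∫ x, ∑ i, fderiv ℝ u x (𝐞 i) ^ 2 with hDint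
  have hy0 : 0 ≤ y := integral_nonneg fun x => sq_nonneg _
  have hD0 : 0 ≤ Dint := integral_nonneg fun x => Finset.sum_nonneg fun i _ => sq_nonneg _
  have hU4 : ∫ x, u x ^ 4 ≤ C * y * Dint := by
    have h := d.integral_uFun_pow_four_le hV hχ hs
    have heq : ∫ x, frobeniusNormSq (fderiv ℝ u x) = Dint :=
      integral_congr_ae (Eventually.of_forall fun x => frobeniusNormSq_eq_sum_sq _)
    rw [heq] at h
    exact h
  -- integrability of compactly supported continuous functions
  have iu4 : Integrable fun x => u x ^ 4 := by
    have hc : HasCompactSupport fun x => u x ^ 4 :=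
      hucs.comp_left (g := fun t : ℝ => t ^ 4) (zero_pow four_ne_zero)
    exact (huc.pow 4).integrable_of_hasCompactSupport hc
  have iu2 : Integrable fun x => u x ^ 2 := by
    have hc : HasCompactSupport fun x => u x ^ 2 :=
      hucs.comp_left (g := fun t : ℝ => t ^ 2) (zero_pow two_ne_zero)
    exact (huc.pow 2).integrable_of_hasCompactSupport hc
  have hθ₁C : ContDiff ℝ 1 θ₁ := d.contDiff_η_div
  have hθ₁cs : HasCompactSupport θ₁ := d.hasCompactSupport_η_div
  have hfC : ∀ (θ : ℝ³ → ℝ) (L : ℝ³ →L[ℝ] ℝ³) (c : ℝ³), ContDiff ℝ 1 θ → HasCompactSupport θ →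
      tsupport θ ⊆ 𝒞 → Integrable fun x => (θ x * ⟪V s x, L x + c⟫) ^ 4 := by
    intro θ L c hθ hθcs hθW
    have hf := contDiff_compFun hθ hθW hVC L c
    have hfc : HasCompactSupport fun x => θ x * ⟪V s x, L x + c⟫ := hasCompactSupport_cutoff_mul hθcs
    have hc : HasCompactSupport fun x => (θ x * ⟪V s x, L x + c⟫) ^ 4 :=
      hfc.comp_left (g := fun t : ℝ => t ^ 4) (zero_pow four_ne_zero)
    exact (hf.continuous.pow 4).integrable_of_hasCompactSupport hc
  have iF1 : Integrable fun x => f₁ x ^ 4 := hfC θ₁ _ _ hθ₁C hθ₁cs d.tsupport_η_div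
  have iF2 : Integrable fun x => f₂ x ^ 4 := hfC θ₁ _ _ hθ₁C hθ₁cs d.tsupport_η_div
  have iF3 : Integrable fun x => f₃ x ^ 4 := hfC η _ _ hη1 d.η_hasCompactSupport d.η_tsupport
  have iDu : ∀ i, Integrable fun x => fderiv ℝ u x (𝐞 i) ^ 2 := by
    intro i
    have hc' : Continuous fun x => fderiv ℝ u x (𝐞 i) :=
      (huC.continuous_fderiv one_ne_zero).clm_apply continuous_const
    have hc : HasCompactSupport fun x => fderiv ℝ u x (𝐞 i) ^ 2 :=
      (hucs.fderiv_apply (𝕜 := ℝ) (𝐞 i)).comp_left (g := fun t : ℝ => t ^ 2) (zero_pow two_ne_zero)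
    exact (hc'.pow 2).integrable_of_hasCompactSupport hc
  have iDint : Integrable fun x => ∑ i, fderiv ℝ u x (𝐞 i) ^ 2 := integrable_finsetSum _ fun i _ => iDu i
  have iX : Integrable fun x => (η x * χf x) ^ 2 := by
    have h := d.integrable_η_mul (g := fun x => η x * χf x ^ 2) (hηc.continuousOn.mul (hχc.pow 2))
    exact h.congr (Eventually.of_forall fun x => by ring)
  have iW : Integrable fun x => u x ^ 2 * (η x * ‖V s x‖) ^ 2 := by
    have h := d.integrable_uFun_mul hχ hs (g := fun x => u x * (η x * ‖V s x‖) ^ 2)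
      (huc.continuousOn.mul ((hηc.continuousOn.mul hVc.norm).pow 2))
    exact h.congr (Eventually.of_forall fun x => by simp only [hu]; ring)
  -- the real quantities
  set X : ℝ := ∫ x, (η x * χf x) ^ 2 with hX
  set W : ℝ := ∫ x, u x ^ 2 * (η x * ‖V s x‖) ^ 2 with hW
  have hX0 : 0 ≤ X := integral_nonneg fun x => sq_nonneg _
  -- `X ≤ c_ω G`
  have hXG : X ≤ ‖curlCLM‖ ^ 2 * G := by
    rw [hGdef, ← integral_const_mul]
    refine integral_le_setIntegral_shell iX (fun x hx => ?_) (hGi.const_mul _) fun x _ =>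
      eta_mul_sq_le d.abs_η_le (V s) x
    rw [image_eq_zero_of_notMem_tsupport fun h => hx (d.η_tsupport h), zero_mul,
      zero_pow two_ne_zero]
  -- `W ≤ ½(3εU₄ + ε⁻¹(F₁ + F₂ + F₃))`
  have hWle : ∀ ε : ℝ, 0 < ε → W ≤ 2⁻¹ * (3 * ε * (∫ x, u x ^ 4) +
      ε⁻¹ * ((∫ x, f₁ x ^ 4) + (∫ x, f₂ x ^ 4) + ∫ x, f₃ x ^ 4)) := by
    intro ε hε
    have hpt : ∀ x, u x ^ 2 * (η x * ‖V s x‖) ^ 2 ≤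
        2⁻¹ * (ε * u x ^ 4 + ε⁻¹ * f₁ x ^ 4) + 2⁻¹ * (ε * u x ^ 4 + ε⁻¹ * f₂ x ^ 4) +
          2⁻¹ * (ε * u x ^ 4 + ε⁻¹ * f₃ x ^ 4) := by
      intro x
      have hsplit : u x ^ 2 * (η x * ‖V s x‖) ^ 2 =
          u x ^ 2 * f₁ x ^ 2 + u x ^ 2 * f₂ x ^ 2 + u x ^ 2 * f₃ x ^ 2 := by
        by_cases hx : x ∈ 𝒞
        · have h := sum_compFun_sq_eq (θ₃ := η) (V s) (hρne x hx)
          simp only [hf₁, hf₂, hf₃, hθ₁]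
          rw [mul_pow (η x) ‖V s x‖, ← h]
          ring
        · have hK : x ∉ K₀ := fun h => hx (d.subset h)
          simp only [hu, d.uFun_eq_zero V s hK]
          ring
      rw [hsplit]
      exact add_le_add (add_le_add (sq_mul_sq_le_eps _ _ hε) (sq_mul_sq_le_eps _ _ hε))
        (sq_mul_sq_le_eps _ _ hε)
    have hi : Integrable fun x => 2⁻¹ * (ε * u x ^ 4 + ε⁻¹ * f₁ x ^ 4) +
        2⁻¹ * (ε * u x ^ 4 + ε⁻¹ * f₂ x ^ 4) + 2⁻¹ * (ε * u x ^ 4 + ε⁻¹ * f₃ x ^ 4) :=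
      ((((iu4.const_mul ε).add (iF1.const_mul _)).const_mul _).add
        (((iu4.const_mul ε).add (iF2.const_mul _)).const_mul _)).add
        (((iu4.const_mul ε).add (iF3.const_mul _)).const_mul _)
    calc W ≤ ∫ x, (2⁻¹ * (ε * u x ^ 4 + ε⁻¹ * f₁ x ^ 4) +
          2⁻¹ * (ε * u x ^ 4 + ε⁻¹ * f₂ x ^ 4) + 2⁻¹ * (ε * u x ^ 4 + ε⁻¹ * f₃ x ^ 4)) :=
          integral_mono_of_nonneg (Eventually.of_forall fun x => by positivity) hi
            (Eventually.of_forall hpt)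
      _ = 2⁻¹ * (3 * ε * (∫ x, u x ^ 4) +
          ε⁻¹ * ((∫ x, f₁ x ^ 4) + (∫ x, f₂ x ^ 4) + ∫ x, f₃ x ^ 4)) := by
          rw [integral_add, integral_add, integral_const_mul, integral_const_mul, integral_const_mul,
            integral_add, integral_add, integral_add, integral_const_mul, integral_const_mul,
            integral_const_mul, integral_const_mul]
          · ring
          · exact iu4.const_mul ε
          · exact iF3.const_mul _
          · exact iu4.const_mul ε
          · exact iF2.const_mul _
          · exact iu4.const_mul ε
          · exact iF1.const_mul _
          · exact ((iu4.const_mul ε).add (iF1.const_mul _)).const_mul _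
          · exact ((iu4.const_mul ε).add (iF2.const_mul _)).const_mul _
          · exact (((iu4.const_mul ε).add (iF1.const_mul _)).const_mul _).add
              (((iu4.const_mul ε).add (iF2.const_mul _)).const_mul _)
          · exact ((iu4.const_mul ε).add (iF3.const_mul _)).const_mul _
  -- the transport terms: `-P₁ + P₂ = T ≤ 2MX + 2MW`
  have hdψc : Continuous fun x => fderiv ℝ (ψ s) x :=
    (d.contDiff_slice s (n := 1)).continuous_fderiv one_ne_zero
  have hc2 : ContinuousOn (fun x => radialVelocity (V s) x * χf x / cylRadius x) 𝒞 :=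
    ((continuousOn_radialVelocity hVc).mul hχc).div continuous_cylRadius.continuousOn hρne
  have hc1 : ContinuousOn (fun x => fderiv ℝ χf x (V s x)) 𝒞 :=
    (hχ.continuousOn_fderiv_slice hs).clm_apply hVc
  have iT : Integrable fun x => χf x ^ 2 * (ψ s x * fderiv ℝ (ψ s) x (V s x)) * (cylRadius x)⁻¹ ^ 2 := by
    have h := integrable_cutoff_mul (d.contDiff_slice s (n := 0)).continuous (d.hasCompactSupport_slice s)
      (d.tsupport_slice_shell s) (g := fun x => χf x ^ 2 * fderiv ℝ (ψ s) x (V s x) * (cylRadius x)⁻¹ ^ 2)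
      (((hχc.pow 2).mul (hdψc.continuousOn.clm_apply hVc)).mul (hρc.pow 2))
    exact h.congr (Eventually.of_forall fun x => by ring)
  have hP1 := d.integral_phiFun_mul_fderiv_apply_velocity hV hχ hs
  have hTeq : -(∫ x, φ x * fderiv ℝ χf x (V s x)) +
      ∫ x, φ x * (radialVelocity (V s) x * χf x / cylRadius x) =
      ∫ x, χf x ^ 2 * (ψ s x * fderiv ℝ (ψ s) x (V s x)) * (cylRadius x)⁻¹ ^ 2 := by
    have iT1 : Integrable fun x => χf x ^ 2 * (eta1 ψ s x * fderiv ℝ (eta1 ψ s) x (V s x)) := by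
      have h := d.integrable_eta1_mul s (g := fun x => χf x ^ 2 * fderiv ℝ (eta1 ψ s) x (V s x))
        ((hχc.pow 2).mul ((((d.contDiff_eta1 s (n := 1)).continuous_fderiv
          one_ne_zero).continuousOn).clm_apply hVc))
      exact h.congr (Eventually.of_forall fun x => by ring)
    rw [hP1, neg_neg, ← integral_add iT1 (d.integrable_phiFun_mul hχ hs hc2)]
    refine integral_congr_ae (Eventually.of_forall fun x => ?_)
    by_cases hx : x ∈ 𝒞
    · exact d.transport_pointwise hx
    · have hK : x ∉ K₀ := fun h => hx (d.subset h)
      simp only [d.phiFun_eq_zero V s hK, d.eta1_eq_zero s hK, d.zero s x hK]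
      ring
  have hTle : ∫ x, χf x ^ 2 * (ψ s x * fderiv ℝ (ψ s) x (V s x)) * (cylRadius x)⁻¹ ^ 2 ≤
      2 * M * X + 2 * M * W := by
    calc ∫ x, χf x ^ 2 * (ψ s x * fderiv ℝ (ψ s) x (V s x)) * (cylRadius x)⁻¹ ^ 2
        ≤ ∫ x, 2 * M * ((η x * χf x) ^ 2 + u x ^ 2 * (η x * ‖V s x‖) ^ 2) :=
          integral_mono iT ((iX.add iW).const_mul _) fun x => d.transport_bound hs' V x
      _ = 2 * M * X + 2 * M * W := by
          rw [integral_const_mul, integral_add iX iW]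
          ring
  -- the dissipation identity and the remainder
  have hP3 := d.integral_phiFun_mul_laplacian hχ hs
  have hR3 : ∫ x, χf x ^ 2 * ∑ i, fderiv ℝ (eta1 ψ s) x (𝐞 i) ^ 2 ≤ 3 * (4 * M + 16) ^ 2 * X := by
    calc ∫ x, χf x ^ 2 * ∑ i, fderiv ℝ (eta1 ψ s) x (𝐞 i) ^ 2
        ≤ ∫ x, 3 * (4 * M + 16) ^ 2 * (η x * χf x) ^ 2 :=
          integral_mono_of_nonneg (Eventually.of_forall fun x => mul_nonneg (sq_nonneg _)
            (Finset.sum_nonneg fun i _ => sq_nonneg _)) (iX.const_mul _)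
            (Eventually.of_forall fun x => d.remainder_bound hs' V x)
      _ = 3 * (4 * M + 16) ^ 2 * X := integral_const_mul _ _
  -- the zeroth-order term
  have hP4 : 0 ≤ ∫ x, φ x * (χf x / cylRadius x ^ 2) :=
    integral_nonneg fun x => zeroth_nonneg V s x
  -- the source term
  have hP5 := d.integral_phiFun_mul_source hV hχ hs
  have iD3 : Integrable fun x => fderiv ℝ u x eZ ^ 2 := by
    have h := iDu 2
    rwa [EuclideanSpace.basisFun_apply] at h
  have hD3 : ∫ x, fderiv ℝ u x eZ ^ 2 ≤ Dint := by
    refine integral_mono iD3 iDint fun x => ?_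
    have h := sq_le_sum_sq (fun i => fderiv ℝ u x (𝐞 i)) 2
    rwa [EuclideanSpace.basisFun_apply] at h
  have hP5le : -(∫ x, fderiv ℝ (fun y => φ y * (cylRadius y)⁻¹) x eZ * swirlVelocity (V s) x ^ 2) ≤
      ((16 * M + 128) / 2 + 256) * (∫ x, f₂ x ^ 4) + (16 * M + 128) / 2 * y +
        (∫ x, fderiv ℝ u x eZ ^ 2) / 4 := by
    set hsrc : ℝ³ → ℝ := fun x => fderiv ℝ (fun y => φ y * (cylRadius y)⁻¹) x eZ *
      swirlVelocity (V s) x ^ 2 with hhsrc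
    have hM3 : 0 ≤ 16 * M + 128 := by linarith only [d.M_nonneg]
    have hpt : ∀ x, |hsrc x| ≤ (16 * M + 128) / 2 * (f₂ x ^ 4 + u x ^ 2) + 256 * f₂ x ^ 4 +
        4⁻¹ * fderiv ℝ u x eZ ^ 2 := fun x => source_young hM3 (d.source_bound hχ hs x)
    have hi : Integrable fun x => (16 * M + 128) / 2 * (f₂ x ^ 4 + u x ^ 2) + 256 * f₂ x ^ 4 +
        4⁻¹ * fderiv ℝ u x eZ ^ 2 :=
      (((iF2.add iu2).const_mul _).add (iF2.const_mul _)).add (iD3.const_mul _)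
    calc -(∫ x, hsrc x) ≤ |∫ x, hsrc x| := neg_le_abs _
      _ ≤ ∫ x, |hsrc x| := abs_integral_le_integral_abs
      _ ≤ ∫ x, ((16 * M + 128) / 2 * (f₂ x ^ 4 + u x ^ 2) + 256 * f₂ x ^ 4 +
          4⁻¹ * fderiv ℝ u x eZ ^ 2) :=
          integral_mono_of_nonneg (Eventually.of_forall fun x => abs_nonneg _) hi
            (Eventually.of_forall hpt)
      _ = ((16 * M + 128) / 2 + 256) * (∫ x, f₂ x ^ 4) + (16 * M + 128) / 2 * y +
          (∫ x, fderiv ℝ u x eZ ^ 2) / 4 := by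
          rw [integral_add, integral_add, integral_const_mul, integral_add iF2 iu2, integral_const_mul,
            integral_const_mul]
          · ring
          · exact (iF2.add iu2).const_mul _
          · exact iF2.const_mul _
          · exact ((iF2.add iu2).const_mul _).add (iF2.const_mul _)
          · exact iD3.const_mul _
  -- the cut-off term `I₂`
  have hcψt : Continuous fun x : ℝ³ => deriv (fun t => ψ t x) s :=
    (continuous_deriv_time_slice (d.contDiff.of_le (by simp))).comp
      (continuous_const.prodMk continuous_id)
  have hcI2 : ContinuousOn (fun x => χf x * (cylRadius x)⁻¹ * deriv (fun t => ψ t x) s) 𝒞 :=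
    (hχc.mul hρc).mul hcψt.continuousOn
  have iI2 : Integrable fun x => u x * (χf x * (cylRadius x)⁻¹ * deriv (fun t => ψ t x) s) :=
    d.integrable_uFun_mul hχ hs hcI2
  have hI2 : ∫ x, u x * (χf x * (cylRadius x)⁻¹ * deriv (fun t => ψ t x) s) ≤ 16 * M * X := by
    calc ∫ x, u x * (χf x * (cylRadius x)⁻¹ * deriv (fun t => ψ t x) s)
        ≤ ∫ x, 16 * M * (η x * χf x) ^ 2 :=
          integral_mono iI2 (iX.const_mul _) fun x => d.timeCutoff_bound hs' V x
      _ = 16 * M * X := integral_const_mul _ _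
  -- the equation: `∫ φ ∂ₛχ = -P₁ + P₂ + P₃ - P₄ + P₅`
  have hc3 : ContinuousOn (fun x => (Δ χf) x) 𝒞 :=
    continuousOn_slice_of_continuousOn hχ.continuousOn_laplacian hs
  have hc4 : ContinuousOn (fun x => χf x / cylRadius x ^ 2) 𝒞 :=
    hχc.div (continuous_cylRadius.continuousOn.pow 2) fun x hx => pow_ne_zero 2 (hρne x hx)
  have hc5 : ContinuousOn (fun x => 2 / cylRadius x * swirlVelocity (V s) x *
      fderiv ℝ (fun y => swirlVelocity (V s) y) x eZ) 𝒞 :=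
    ((continuousOn_const.div continuous_cylRadius.continuousOn hρne).mul
      (continuousOn_shell_of_contDiffAt hswC)).mul (continuousOn_fderiv_apply_shell_of_contDiffAt hswC eZ)
  have hct : ContinuousOn (fun x => timeDeriv (fun t y => angularVorticity (V t) y) s x) 𝒞 :=
    continuousOn_slice_of_continuousOn hχ.continuousOn_timeDeriv hs
  have i1 := d.integrable_phiFun_mul hχ hs hc1
  have i2 := d.integrable_phiFun_mul hχ hs hc2
  have i3 := d.integrable_phiFun_mul hχ hs hc3
  have i4 := d.integrable_phiFun_mul hχ hs hc4
  have i5 := d.integrable_phiFun_mul hχ hs hc5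
  have hPDE : ∫ x, φ x * timeDeriv (fun t y => angularVorticity (V t) y) s x =
      -(∫ x, φ x * fderiv ℝ χf x (V s x)) +
        (∫ x, φ x * (radialVelocity (V s) x * χf x / cylRadius x)) +
        (∫ x, φ x * (Δ χf) x) - (∫ x, φ x * (χf x / cylRadius x ^ 2)) +
        ∫ x, φ x * (2 / cylRadius x * swirlVelocity (V s) x *
          fderiv ℝ (fun y => swirlVelocity (V s) y) x eZ) := by
    have hpt : ∀ x, φ x * timeDeriv (fun t y => angularVorticity (V t) y) s x =
        -(φ x * fderiv ℝ χf x (V s x)) + φ x * (radialVelocity (V s) x * χf x / cylRadius x) +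
          φ x * (Δ χf) x - φ x * (χf x / cylRadius x ^ 2) +
          φ x * (2 / cylRadius x * swirlVelocity (V s) x *
            fderiv ℝ (fun y => swirlVelocity (V s) y) x eZ) := by
      intro x
      by_cases hx : x ∈ 𝒞
      · rw [hχ.timeDeriv_eq hs hx]
        ring
      · have hK : x ∉ K₀ := fun h => hx (d.subset h)
        simp only [hφ, d.phiFun_eq_zero V s hK]
        ring
    rw [integral_congr_ae (Eventually.of_forall hpt), integral_add, integral_sub, integral_add,
      integral_add, integral_neg]
    · exact i1.neg
    · exact i2
    · exact i1.neg.add i2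
    · exact i3
    · exact (i1.neg.add i2).add i3
    · exact i4
    · exact ((i1.neg.add i2).add i3).sub i4
    · exact i5
  -- `∫ ∂ₛ(u²) = 2 ∫ φ ∂ₛχ + 2 I₂`
  have hE : ∫ x, dFun ψ V s x = 2 * (∫ x, φ x * timeDeriv (fun t y => angularVorticity (V t) y) s x) +
      2 * ∫ x, u x * (χf x * (cylRadius x)⁻¹ * deriv (fun t => ψ t x) s) := by
    have hpt : ∀ x, dFun ψ V s x = 2 * (φ x * timeDeriv (fun t y => angularVorticity (V t) y) s x) +
        2 * (u x * (χf x * (cylRadius x)⁻¹ * deriv (fun t => ψ t x) s)) := fun x => dFun_eq V s x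
    rw [integral_congr_ae (Eventually.of_forall hpt), integral_add, integral_const_mul,
      integral_const_mul]
    · exact (d.integrable_phiFun_mul hχ hs hct).const_mul 2
    · exact iI2.const_mul 2
  -- assembling
  have key := energy_arith (M := M) (C := C) (Λ := Λ) (cω := ‖curlCLM‖ ^ 2) (K := (K : ℝ))
    (y := y) (Dint := Dint) (X := X) (A := A) (G := G)
    (T := -(∫ x, φ x * fderiv ℝ χf x (V s x)) +
      ∫ x, φ x * (radialVelocity (V s) x * χf x / cylRadius x))
    (W := W) (U4 := ∫ x, u x ^ 4) (F1 := ∫ x, f₁ x ^ 4) (F2 := ∫ x, f₂ x ^ 4) (F3 := ∫ x, f₃ x ^ 4)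
    (R3 := ∫ x, χf x ^ 2 * ∑ i, fderiv ℝ (eta1 ψ s) x (𝐞 i) ^ 2)
    (P3 := ∫ x, φ x * (Δ χf) x) (P4 := ∫ x, φ x * (χf x / cylRadius x ^ 2))
    (P5 := ∫ x, φ x * (2 / cylRadius x * swirlVelocity (V s) x *
      fderiv ℝ (fun y => swirlVelocity (V s) y) x eZ))
    (I2 := ∫ x, u x * (χf x * (cylRadius x)⁻¹ * deriv (fun t => ψ t x) s))
    (D3 := ∫ x, fderiv ℝ u x eZ ^ 2) (E := ∫ x, dFun ψ V s x)
    (Pt := ∫ x, φ x * timeDeriv (fun t y => angularVorticity (V t) y) s x)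
    d.M_nonneg hC0 hΛ0 (sq_nonneg _) K.coe_nonneg hy0 hD0 hA0 hG0 hE (by rw [hPDE])
    (hTeq ▸ hTle) hWle hP3 hR3 hP4 (by rw [hP5]; exact hP5le) hD3 hI2 hU4 hF1 hF2 hF3 hXG hAK
  rw [← hGeq]
  exact key

end CutoffData

end FixedTimeEnergy

/-! ## The time dependence: continuity, the derivative of the energy density, Fubini -/

section TimeDependence

/-- **Continuity of a space–time cut-off product on a slab.** If `Ψ` is continuous on
`]a, b[ × ℝ³` and vanishes whenever `x ∉ K₀` (a closed subset of the open shell `𝒞̃`), and `g`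
is continuous on `]a, b[ × 𝒞̃`, then `Ψ g` is continuous on `]a, b[ × ℝ³` (near a point with
`x ∉ 𝒞̃` the product vanishes identically). [folklore] -/
theorem continuousOn_slab_cutoff_mul {Ψ g : ℝ × ℝ³ → ℝ} {K₀ : Set ℝ³} {a b : ℝ} (hK : IsClosed K₀)
    (hK𝒞 : K₀ ⊆ 𝒞) (hΨ : ContinuousOn Ψ (Ioo a b ×ˢ (univ : Set ℝ³)))
    (hΨ0 : ∀ z : ℝ × ℝ³, z.2 ∉ K₀ → Ψ z = 0) (hg : ContinuousOn g (Ioo a b ×ˢ 𝒞)) :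
    ContinuousOn (fun z => Ψ z * g z) (Ioo a b ×ˢ (univ : Set ℝ³)) := by
  intro z hz
  have hzo : Ioo a b ×ˢ (univ : Set ℝ³) ∈ 𝓝 z := (isOpen_Ioo.prod isOpen_univ).mem_nhds hz
  by_cases hx : z.2 ∈ 𝒞
  · have hz' : z ∈ Ioo a b ×ˢ 𝒞 := ⟨hz.1, hx⟩
    have hgo : Ioo a b ×ˢ 𝒞 ∈ 𝓝 z := (isOpen_Ioo.prod (isOpen_shell _ _ _)).mem_nhds hz'
    exact ((hΨ.continuousAt hzo).mul (hg.continuousAt hgo)).continuousWithinAt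
  · have hxK : z.2 ∉ K₀ := fun h => hx (hK𝒞 h)
    have hU : (univ : Set ℝ) ×ˢ K₀ᶜ ∈ 𝓝 z := (isOpen_univ.prod hK.isOpen_compl).mem_nhds ⟨mem_univ _, hxK⟩
    have h0 : (fun w => Ψ w * g w) =ᶠ[𝓝 z] fun _ => 0 := by
      filter_upwards [hU] with w hw
      rw [hΨ0 w hw.2, zero_mul]
    exact (continuousAt_const.congr h0.symm).continuousWithinAt

/-- A function continuous on the shell, lifted to the slab `]a, b[ × 𝒞̃`. [folklore] -/
theorem continuousOn_slab_of_shell {g : ℝ³ → ℝ} {a b : ℝ} (hg : ContinuousOn g 𝒞) :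
    ContinuousOn (fun z : ℝ × ℝ³ => g z.2) (Ioo a b ×ˢ 𝒞) :=
  hg.comp continuous_snd.continuousOn fun _ hz => hz.2

/-- `Q̃` as the slab product `]-2², 0[ × 𝒞̃`. [folklore] -/
theorem coe_Q_eq_prod : ((Q : Opens (ℝ × ℝ³)) : Set (ℝ × ℝ³)) = Ioo (-(2 : ℝ) ^ 2) 0 ×ˢ 𝒞 := by
  rw [coe_shellCylOpens, shellCyl_eq_prod]

variable {ψ : ℝ → ℝ³ → ℝ} {K₀ : Set ℝ³} {η : ℝ³ → ℝ} {M Mη C : ℝ}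

namespace CutoffData

variable (d : CutoffData ψ K₀ η M Mη C)

variable {V : ℝ → ℝ³ → ℝ³} {P : ℝ → ℝ³ → ℝ} (hV : IsSmoothAxisymmetricSolutionOn Q V P)
  (hχ : AngularVorticityEqOn Q V)

include d in
/-- `ψ` is jointly continuous. [folklore] -/
theorem continuous_uncurry : Continuous (uncurry ψ) := d.contDiff.continuous

include d hχ in
/-- **`u` is jointly continuous on the slab `]-2², 0[ × ℝ³`.** [folklore] -/
theorem continuousOn_uFun_slab :
    ContinuousOn (fun z : ℝ × ℝ³ => uFun ψ V z.1 z.2) (Ioo (-(2 : ℝ) ^ 2) 0 ×ˢ (univ : Set ℝ³)) := by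
  have hg : ContinuousOn (fun z : ℝ × ℝ³ => (cylRadius z.2)⁻¹ * angularVorticity (V z.1) z.2)
      (Ioo (-(2 : ℝ) ^ 2) 0 ×ˢ 𝒞) := by
    refine (continuousOn_slab_of_shell (continuous_cylRadius.continuousOn.inv₀ fun x hx =>
      (cylRadius_pos_of_mem_shell hx).ne')).mul ?_
    have h := hχ.continuousOn
    rwa [coe_Q_eq_prod] at h
  have h := continuousOn_slab_cutoff_mul (Ψ := fun z => ψ z.1 z.2) d.isCompact.isClosed d.subset
    (d.continuous_uncurry.continuousOn) (fun z hz => d.zero z.1 z.2 hz) hg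
  refine h.congr fun z _ => ?_
  simp only [uFun, eta1]
  ring

include d hχ in
/-- **`∂ₛ(u²)` is jointly continuous on the slab `]-2², 0[ × ℝ³`.** [folklore] -/
theorem continuousOn_dFun_slab :
    ContinuousOn (fun z : ℝ × ℝ³ => dFun ψ V z.1 z.2) (Ioo (-(2 : ℝ) ^ 2) 0 ×ˢ (univ : Set ℝ³)) := by
  have hcont : ContDiff ℝ 1 (uncurry ψ) := d.contDiff.of_le (by simp)
  have hg : ContinuousOn (fun z : ℝ × ℝ³ =>
      (timeDeriv (fun t y => angularVorticity (V t) y) z.1 z.2 * ψ z.1 z.2 +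
        angularVorticity (V z.1) z.2 * deriv (fun t => ψ t z.2) z.1) * (cylRadius z.2)⁻¹)
      (Ioo (-(2 : ℝ) ^ 2) 0 ×ˢ 𝒞) := by
    have h1 := hχ.continuousOn_timeDeriv
    have h2 := hχ.continuousOn
    rw [coe_Q_eq_prod] at h1 h2
    refine (((h1.mul (d.continuous_uncurry.continuousOn)).add
      (h2.mul (continuous_deriv_time_slice hcont).continuousOn)).mul
      (continuousOn_slab_of_shell (continuous_cylRadius.continuousOn.inv₀ fun x hx =>
        (cylRadius_pos_of_mem_shell hx).ne')))
  have h := continuousOn_slab_cutoff_mul (Ψ := fun z => uFun ψ V z.1 z.2) d.isCompact.isClosed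
    d.subset (d.continuousOn_uFun_slab hχ) (fun z hz => d.uFun_eq_zero V z.1 hz) hg
  refine ((continuousOn_const (c := (2 : ℝ))).mul h).congr fun z _ => ?_
  simp only [dFun, Pi.mul_apply]
  ring

include d in
/-- `∂ₛ(u²) = 0` off `K₀`. [folklore] -/
theorem dFun_eq_zero (V : ℝ → ℝ³ → ℝ³) (s : ℝ) {x : ℝ³} (hx : x ∉ K₀) : dFun ψ V s x = 0 := by
  rw [dFun, d.uFun_eq_zero V s hx]
  ring

include d hχ in
/-- **The time derivative of the energy density**: at `τ ∈ ]-2², 0[` and every `x`,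
`∂_τ (u(τ, x)²) = dFun ψ V τ x`. [folklore] -/
theorem hasDerivAt_uFun_sq {τ : ℝ} (hτ : τ ∈ Ioo (-(2 : ℝ) ^ 2) 0) (x : ℝ³) :
    HasDerivAt (fun t => uFun ψ V t x ^ 2) (dFun ψ V τ x) τ := by
  by_cases hx : x ∈ 𝒞
  · have hψ' : HasDerivAt (fun t => ψ t x) (deriv (fun t => ψ t x) τ) τ :=
      (hasDerivAt_time_slice d.differentiable_uncurry τ x).differentiableAt.hasDerivAt
    have hχ' : HasDerivAt (fun t => angularVorticity (V t) x)
        (timeDeriv (fun t y => angularVorticity (V t) y) τ x) τ :=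
      (hχ.differentiableAt_time (τ, x) (mk_mem_Q hτ hx)).hasDerivAt
    have hF : HasDerivAt (fun t => ψ t x * (cylRadius x)⁻¹ * angularVorticity (V t) x)
        (deriv (fun t => ψ t x) τ * (cylRadius x)⁻¹ * angularVorticity (V τ) x +
          ψ τ x * (cylRadius x)⁻¹ * timeDeriv (fun t y => angularVorticity (V t) y) τ x) τ :=
      (hψ'.mul_const (cylRadius x)⁻¹).fun_mul hχ'
    have h := hF.fun_mul hF
    have heq : (fun t => uFun ψ V t x ^ 2) =
        fun t => (ψ t x * (cylRadius x)⁻¹ * angularVorticity (V t) x) *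
          (ψ t x * (cylRadius x)⁻¹ * angularVorticity (V t) x) := by
      funext t
      rw [sq, uFun, eta1]
    rw [heq]
    refine h.congr_deriv ?_
    rw [dFun, uFun, eta1]
    ring
  · have hK : x ∉ K₀ := fun h => hx (d.subset h)
    have heq : (fun t => uFun ψ V t x ^ 2) = fun _ => 0 := by
      funext t
      rw [d.uFun_eq_zero V t hK, zero_pow two_ne_zero]
    rw [heq, d.dFun_eq_zero V τ hK]
    exact hasDerivAt_const τ 0

include d hχ in
/-- **The energy as a time integral** (fundamental theorem of calculus in `t` for each `x`, then
Fubini): for `-2² < t₀ < t < 0` with `ψ(t₀, ·) = 0`,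
`∫ u(t, x)² dx = ∫_{]t₀, t[} (∫ ∂ₛ(u²)(s, x) dx) ds`. [folklore] -/
theorem integral_uFun_sq_eq {t₀ t : ℝ} (ht₀ : -(2 : ℝ) ^ 2 < t₀) (ht₀t : t₀ < t) (ht : t < 0)
    (hzero : ∀ x, ψ t₀ x = 0) :
    ∫ x, uFun ψ V t x ^ 2 = ∫ s in Ioo t₀ t, ∫ x, dFun ψ V s x := by
  have hsub : Icc t₀ t ⊆ Ioo (-(2 : ℝ) ^ 2) 0 := fun s hs => ⟨lt_of_lt_of_le ht₀ hs.1, lt_of_le_of_lt hs.2 ht⟩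
  have hcu := d.continuousOn_uFun_slab (V := V) hχ
  have hcd := d.continuousOn_dFun_slab (V := V) hχ
  -- FTC in `t` for each `x`
  have hFTC : ∀ x, ∫ s in t₀..t, dFun ψ V s x = uFun ψ V t x ^ 2 := by
    intro x
    have hc : ContinuousOn (fun τ => ((τ, x) : ℝ × ℝ³)) (Icc t₀ t) :=
      (continuous_id.prodMk continuous_const).continuousOn
    have hmaps : MapsTo (fun τ => ((τ, x) : ℝ × ℝ³)) (Icc t₀ t) (Ioo (-(2 : ℝ) ^ 2) 0 ×ˢ univ) :=
      fun τ hτ => ⟨hsub hτ, mem_univ _⟩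
    have hcont : ContinuousOn (fun τ => uFun ψ V τ x ^ 2) (Icc t₀ t) :=
      ((hcu.comp hc hmaps).pow 2).congr fun τ _ => rfl
    have hcont' : ContinuousOn (fun τ => dFun ψ V τ x) (Icc t₀ t) :=
      (hcd.comp hc hmaps).congr fun τ _ => rfl
    have h := intervalIntegral.integral_eq_sub_of_hasDerivAt_of_le ht₀t.le hcont
      (fun τ hτ => d.hasDerivAt_uFun_sq hχ (hsub (Ioo_subset_Icc_self hτ)) x)
      (hcont'.intervalIntegrable_of_Icc ht₀t.le)
    have h0 : uFun ψ V t₀ x = 0 := by rw [uFun, eta1, hzero x]; ring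
    rw [h, h0]
    ring
  -- Fubini
  have hint : Integrable (uncurry fun s x => dFun ψ V s x)
      (((volume : Measure ℝ).restrict (Ioo t₀ t)).prod (volume : Measure ℝ³)) :=
    integrable_prod_of_continuousOn (G := fun z : ℝ × ℝ³ => dFun ψ V z.1 z.2) d.isCompact
      (hcd.mono (prod_mono hsub Subset.rfl)) fun s _ x hx => d.dFun_eq_zero V s hx
  have hswap := integral_integral_swap hint
  calc ∫ x, uFun ψ V t x ^ 2 = ∫ x, ∫ s in Ioo t₀ t, dFun ψ V s x := by
        refine integral_congr_ae (Eventually.of_forall fun x => ?_)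
        show uFun ψ V t x ^ 2 = ∫ s in Ioo t₀ t, dFun ψ V s x
        rw [← hFTC x, intervalIntegral.integral_of_le ht₀t.le, integral_Ioc_eq_integral_Ioo]
    _ = ∫ s in Ioo t₀ t, ∫ x, dFun ψ V s x := hswap.symm

include d hχ in
/-- The slice energy `s ↦ ∫ ∂ₛ(u²) dx` is integrable on `]t₀, t[`. [folklore] -/
theorem integrableOn_integral_dFun {t₀ t : ℝ} (ht₀ : -(2 : ℝ) ^ 2 < t₀) (ht : t < 0) :
    IntegrableOn (fun s => ∫ x, dFun ψ V s x) (Ioo t₀ t) := by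
  have hsub : Icc t₀ t ⊆ Ioo (-(2 : ℝ) ^ 2) 0 := fun s hs => ⟨lt_of_lt_of_le ht₀ hs.1, lt_of_le_of_lt hs.2 ht⟩
  have hint : Integrable (uncurry fun s x => dFun ψ V s x)
      (((volume : Measure ℝ).restrict (Ioo t₀ t)).prod (volume : Measure ℝ³)) :=
    integrable_prod_of_continuousOn (G := fun z : ℝ × ℝ³ => dFun ψ V z.1 z.2) d.isCompact
      ((d.continuousOn_dFun_slab (V := V) hχ).mono (prod_mono hsub Subset.rfl))
      fun s _ x hx => d.dFun_eq_zero V s hx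
  exact hint.integral_prod_left

end CutoffData

end TimeDependence

/-! ## From the real inequality to the `lintegral` form, and the discharge -/

section Discharge

/-- **`ofReal` of an integral is at most the `lintegral` of `ofReal`** (for an integrable real
function; the negative part only helps). [folklore] -/
theorem ofReal_integral_le_lintegral_ofReal' {α : Type*} [MeasurableSpace α] {μ : Measure α}
    {f : α → ℝ} (hfi : Integrable f μ) :
    ENNReal.ofReal (∫ x, f x ∂μ) ≤ ∫⁻ x, ENNReal.ofReal (f x) ∂μ := by
  have h1 : ∫ x, f x ∂μ ≤ ∫ x, max (f x) 0 ∂μ :=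
    integral_mono hfi hfi.pos_part fun x => le_max_left _ _
  have h2 : ENNReal.ofReal (∫ x, max (f x) 0 ∂μ) = ∫⁻ x, ENNReal.ofReal (max (f x) 0) ∂μ :=
    ofReal_integral_eq_lintegral_ofReal hfi.pos_part (Eventually.of_forall fun x => le_max_right _ _)
  have h3 : ∀ x, ENNReal.ofReal (max (f x) 0) = ENNReal.ofReal (f x) := by
    intro x
    rcases le_total (f x) 0 with h | h
    · rw [max_eq_right h, ENNReal.ofReal_zero, ENNReal.ofReal_of_nonpos h]
    · rw [max_eq_left h]
  calc ENNReal.ofReal (∫ x, f x ∂μ) ≤ ENNReal.ofReal (∫ x, max (f x) 0 ∂μ) :=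
        ENNReal.ofReal_le_ofReal h1
    _ = ∫⁻ x, ENNReal.ofReal (max (f x) 0) ∂μ := h2
    _ = ∫⁻ x, ENNReal.ofReal (f x) ∂μ := lintegral_congr h3

/-- The shell has finite volume (it lies in the ball of radius `4`). [folklore] -/
theorem volume_shell_lt_top : volume 𝒞 < ⊤ := by
  refine lt_of_le_of_lt (measure_mono fun x hx => ?_) (measure_closedBall_lt_top (x := (0 : ℝ³)) (r := 4))
  rw [mem_shell] at hx
  rw [mem_closedBall, dist_zero_right, EuclideanSpace.norm_eq]
  have hsum : ∑ i, ‖x i‖ ^ 2 = cylRadius x ^ 2 + x 2 ^ 2 := by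
    simp only [Fin.sum_univ_three, Real.norm_eq_abs, sq_abs, cylRadius_sq]
  rw [hsum]
  have hρ := cylRadius_nonneg x
  have h2 : x 2 ^ 2 < 2 ^ 2 := by
    rw [← sq_abs]
    exact pow_lt_pow_left₀ hx.2 (abs_nonneg _) two_ne_zero
  calc Real.sqrt (cylRadius x ^ 2 + x 2 ^ 2) ≤ Real.sqrt (4 ^ 2) :=
        Real.sqrt_le_sqrt (by nlinarith [hx.1.2])
    _ = 4 := Real.sqrt_sq (by norm_num)

/-- The energy density in terms of `u`: `‖ω_φ ψ/ϱ‖ₑ² = ofReal (u²)`. [folklore] -/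
theorem enorm_sq_eq_ofReal_uFun_sq (ψ : ℝ → ℝ³ → ℝ) (V : ℝ → ℝ³ → ℝ³) (t : ℝ) (x : ℝ³) :
    ‖angularVorticity (V t) x * ψ t x / cylRadius x‖ₑ ^ 2 = ENNReal.ofReal (uFun ψ V t x ^ 2) := by
  rw [← uFun_eq, Real.enorm_eq_ofReal_abs, ← ENNReal.ofReal_pow (abs_nonneg _), sq_abs]

/-- If the cut-off slice vanishes, so does the localized enstrophy. [folklore] -/
theorem vortEnergy_eq_zero_of_slice_eq_zero {ψ : ℝ → ℝ³ → ℝ} (V : ℝ → ℝ³ → ℝ³) {t : ℝ}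
    (h : ∀ x, ψ t x = 0) : vortEnergy ψ V t = 0 := by
  unfold vortEnergy
  simp only [h, mul_zero, zero_div, enorm_zero, ne_eq, OfNat.ofNat_ne_zero, not_false_eq_true,
    zero_pow, lintegral_const, zero_mul]

variable {ψ : ℝ → ℝ³ → ℝ} {K₀ : Set ℝ³} {η : ℝ³ → ℝ} {M Mη C : ℝ}

namespace CutoffData

variable (d : CutoffData ψ K₀ η M Mη C)

variable {V : ℝ → ℝ³ → ℝ³} {P : ℝ → ℝ³ → ℝ} (hV : IsSmoothAxisymmetricSolutionOn Q V P)
  (hχ : AngularVorticityEqOn Q V)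

include d hχ in
/-- **The localized enstrophy as a real integral**: `vortEnergy ψ V t = ofReal (∫ u(t, x)² dx)`
for `t ∈ ]-2², 0[`. [folklore] -/
theorem vortEnergy_eq_ofReal {t : ℝ} (ht : t ∈ Ioo (-(2 : ℝ) ^ 2) 0) :
    vortEnergy ψ V t = ENNReal.ofReal (∫ x, uFun ψ V t x ^ 2) := by
  have huc : Continuous (uFun ψ V t) := (d.contDiff_uFun hχ ht).continuous
  have hucs : HasCompactSupport (uFun ψ V t) := d.hasCompactSupport_uFun V t
  have iu2 : Integrable fun x => uFun ψ V t x ^ 2 := by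
    have hc : HasCompactSupport fun x => uFun ψ V t x ^ 2 :=
      hucs.comp_left (g := fun r : ℝ => r ^ 2) (zero_pow two_ne_zero)
    exact (huc.pow 2).integrable_of_hasCompactSupport hc
  unfold vortEnergy
  simp_rw [enorm_sq_eq_ofReal_uFun_sq]
  rw [setLIntegral_eq_of_support_subset]
  · exact (ofReal_integral_eq_lintegral_ofReal iu2 (Eventually.of_forall fun x => sq_nonneg _)).symm
  · intro x hx
    by_contra h
    have hK : x ∉ K₀ := fun h' => h (d.subset h')
    refine hx ?_
    show ENNReal.ofReal (uFun ψ V t x ^ 2) = 0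
    rw [d.uFun_eq_zero V t hK, zero_pow two_ne_zero, ENNReal.ofReal_zero]

include d hχ in
/-- **Boundedness of the localized enstrophy on `[-2², T]`, `T < 0`** (`u` is continuous on the
compact `[t₀, T] × K₀` and vanishes for `t ≤ t₀` and off `K₀`). [folklore] -/
theorem exists_vortEnergy_le {t₀ : ℝ} (ht₀ : t₀ ∈ Ioo (-(2 : ℝ) ^ 2) (-(15 / 8 : ℝ) ^ 2))
    (hzero : ∀ t x, t ≤ t₀ → ψ t x = 0) {T : ℝ} (hT : T ∈ Ioo (-(2 : ℝ) ^ 2) 0) :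
    ∃ Mb : ℝ≥0, ∀ t ∈ Icc (-(2 : ℝ) ^ 2) T, vortEnergy ψ V t ≤ Mb := by
  -- a bound for `|u|` on `[t₀, T] × K₀`
  have hsub : Icc t₀ T ×ˢ K₀ ⊆ Ioo (-(2 : ℝ) ^ 2) 0 ×ˢ (univ : Set ℝ³) :=
    prod_mono (fun t ht => ⟨lt_of_lt_of_le ht₀.1 ht.1, lt_of_le_of_lt ht.2 hT.2⟩) (subset_univ _)
  obtain ⟨S, hS⟩ := (isCompact_Icc.prod d.isCompact).exists_bound_of_continuousOn
    ((d.continuousOn_uFun_slab (V := V) hχ).mono hsub)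
  have hvol := volume_shell_lt_top
  refine ⟨(ENNReal.ofReal (S ^ 2) * volume 𝒞).toNNReal, fun t ht => ?_⟩
  rw [ENNReal.coe_toNNReal (ENNReal.mul_ne_top ENNReal.ofReal_ne_top hvol.ne)]
  by_cases htt : t ≤ t₀
  · rw [vortEnergy_eq_zero_of_slice_eq_zero V fun x => hzero t x htt]
    exact bot_le
  · have htt : t₀ < t := lt_of_not_ge htt
    have hpt : ∀ x, ‖angularVorticity (V t) x * ψ t x / cylRadius x‖ₑ ^ 2 ≤ ENNReal.ofReal (S ^ 2) := by
      intro x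
      rw [enorm_sq_eq_ofReal_uFun_sq]
      refine ENNReal.ofReal_le_ofReal ?_
      by_cases hx : x ∈ K₀
      · have h := hS (t, x) ⟨⟨htt.le, ht.2⟩, hx⟩
        rw [Real.norm_eq_abs] at h
        calc uFun ψ V t x ^ 2 = |uFun ψ V t x| ^ 2 := (sq_abs _).symm
          _ ≤ S ^ 2 := pow_le_pow_left₀ (abs_nonneg _) h 2
      · rw [d.uFun_eq_zero V t hx, zero_pow two_ne_zero]
        positivity
    calc vortEnergy ψ V t ≤ ∫⁻ _ in 𝒞, ENNReal.ofReal (S ^ 2) :=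
          setLIntegral_mono' (isOpen_shell _ _ _).measurableSet fun x _ => hpt x
      _ = ENNReal.ofReal (S ^ 2) * volume 𝒞 := setLIntegral_const _ _

include d hV hχ in
/-- **The kernel bound at a good time**, `lintegral` form: for `s ∈ ]-2², 0[`,
`ofReal (∫ ∂ₛ(u²) dx) ≤ c (1 + K)² (1 + ∫_𝒞̃ |∇V|²) (1 + vortEnergy)` in `ℝ≥0∞` (trivial when the
gradient energy of the slice is infinite). [cite: SereginZajaczkowski2007, proof of Lemma 4.2, (4.13)] -/
theorem ofReal_integral_dFun_le {s : ℝ} (hs : s ∈ Ioo (-(2 : ℝ) ^ 2) 0) {K : ℝ≥0}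
    (hK : szEnergy V P (fun t x => fderiv ℝ (V t) x) ≤ K) :
    ENNReal.ofReal (∫ x, dFun ψ V s x) ≤
      ((lemma42EnergyConst M Mη C).toNNReal : ℝ≥0∞) * (1 + K) ^ 2 * (1 + shellGradEnergy V s) *
        (1 + vortEnergy ψ V s) := by
  have hc1 : 1 ≤ lemma42EnergyConst M Mη C :=
    one_le_lemma42EnergyConst d.M_nonneg d.ladyzhenskaya.nonneg
  have hc0 : 0 ≤ lemma42EnergyConst M Mη C := zero_le_one.trans hc1
  by_cases hG : shellGradEnergy V s = ⊤
  · rw [hG, add_top]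
    have h1 : ((lemma42EnergyConst M Mη C).toNNReal : ℝ≥0∞) * (1 + K) ^ 2 ≠ 0 := by
      refine mul_ne_zero ?_ (pow_ne_zero 2 ?_)
      · rw [ne_eq, ENNReal.coe_eq_zero, Real.toNNReal_eq_zero, not_le]
        linarith
      · exact ne_of_gt (lt_of_lt_of_le zero_lt_one le_self_add)
    have h2 : (1 + vortEnergy ψ V s) ≠ 0 := ne_of_gt (lt_of_lt_of_le zero_lt_one le_self_add)
    rw [ENNReal.mul_top h1, ENNReal.top_mul h2]
    exact le_top
  · have key := d.integral_dFun_le hV hχ hs hK hG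
    have hy0 : 0 ≤ ∫ x, uFun ψ V s x ^ 2 := integral_nonneg fun x => sq_nonneg _
    calc ENNReal.ofReal (∫ x, dFun ψ V s x)
        ≤ ENNReal.ofReal (lemma42EnergyConst M Mη C * (1 + K) ^ 2 *
            (1 + (shellGradEnergy V s).toReal) * (1 + ∫ x, uFun ψ V s x ^ 2)) :=
          ENNReal.ofReal_le_ofReal key
      _ = ((lemma42EnergyConst M Mη C).toNNReal : ℝ≥0∞) * (1 + K) ^ 2 * (1 + shellGradEnergy V s) *
          (1 + vortEnergy ψ V s) := by
          rw [ENNReal.ofReal_mul (by positivity), ENNReal.ofReal_mul (by positivity),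
            ENNReal.ofReal_mul hc0, ENNReal.ofReal_pow (by positivity),
            ENNReal.ofReal_add zero_le_one K.coe_nonneg, ENNReal.ofReal_one, ENNReal.ofReal_coe_nnreal,
            ENNReal.ofReal_add zero_le_one ENNReal.toReal_nonneg, ENNReal.ofReal_one,
            ENNReal.ofReal_toReal hG, ENNReal.ofReal_add zero_le_one hy0, ENNReal.ofReal_one,
            ← d.vortEnergy_eq_ofReal hχ hs]
          rfl

end CutoffData

/-- **Seregin–Zajaczkowski 2007, proof of Lemma 4.2, the final inequality (4.13) — discharged.**
For every cut-off `ψ` of the class `IsLemma42Cutoff`, with the cut-off data of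
`IsLemma42Cutoff.exists_cutoffData` (a compact `K₀ ⊆ 𝒞̃`, a bound `M` for `Dψ`, an auxiliary
axially symmetric cut-off `η` with `‖Dη‖ ≤ M_η`, a Ladyzhenskaya constant `C` for the shell), the
constant `lemma42EnergyConst M M_η C` works: the localized enstrophy `y(t) = ∫ |χ̃/ϱ|²` is
bounded on `[-2², T]` (`CutoffData.exists_vortEnergy_le`) and, writing
`y(t) = ∫_{t₀}^{t} ∫ ∂ₛ(u²)` (fundamental theorem of calculus in `t` and Fubini,
`CutoffData.integral_uFun_sq_eq`), the fixed-time energy inequality (4.13)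
(`CutoffData.integral_dFun_le`: the identity (4.9) by three integrations by parts, the estimates
(4.10)–(4.12) by Ladyzhenskaya's inequality in the variables `(ϱ, x₃)` and Young's inequality)
bounds the kernel. [cite: SereginZajaczkowski2007, proof of Lemma 4.2, (4.6)–(4.13)] -/
theorem LocalizedVorticityEnergyInequality_holds : LocalizedVorticityEnergyInequality := by
  intro ψ hψ
  obtain ⟨K₀, η, M, Mη, C, d, t₀, ht₀, hzero⟩ := hψ.exists_cutoffData
  refine ⟨(lemma42EnergyConst M Mη C).toNNReal, fun V P hV hχ K hK => ⟨fun T hT => ?_, fun t ht => ?_⟩⟩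
  · exact d.exists_vortEnergy_le hχ ht₀ hzero hT
  · by_cases htt : t ≤ t₀
    · rw [vortEnergy_eq_zero_of_slice_eq_zero V fun x => hzero t x htt]
      exact bot_le
    · have htt : t₀ < t := lt_of_not_ge htt
      have hy := d.integral_uFun_sq_eq hχ ht₀.1 htt ht.2 fun x => hzero t₀ x le_rfl
      rw [d.vortEnergy_eq_ofReal hχ ht, hy]
      calc ENNReal.ofReal (∫ s in Ioo t₀ t, ∫ x, dFun ψ V s x)
          ≤ ∫⁻ s in Ioo t₀ t, ENNReal.ofReal (∫ x, dFun ψ V s x) :=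
            ofReal_integral_le_lintegral_ofReal' (d.integrableOn_integral_dFun hχ ht₀.1 ht.2)
        _ ≤ ∫⁻ s in Ioo t₀ t, ((lemma42EnergyConst M Mη C).toNNReal : ℝ≥0∞) * (1 + K) ^ 2 *
            (1 + shellGradEnergy V s) * (1 + vortEnergy ψ V s) :=
            setLIntegral_mono' measurableSet_Ioo fun s hs =>
              d.ofReal_integral_dFun_le hV hχ ⟨lt_trans ht₀.1 hs.1, lt_trans hs.2 ht.2⟩ hK
        _ ≤ ∫⁻ s in Ioo (-(2 : ℝ) ^ 2) t, ((lemma42EnergyConst M Mη C).toNNReal : ℝ≥0∞) *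
            (1 + K) ^ 2 * (1 + shellGradEnergy V s) * (1 + vortEnergy ψ V s) :=
            lintegral_mono_set (Ioo_subset_Ioo ht₀.1.le le_rfl)

end Discharge

end SereginZajaczkowski2007

end Literature.Analysis.FluidPDE
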